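import Literature.Analysis.FluidPDE.PalasekObukhovBlowup
import Literature.Analysis.FluidPDE.PalasekObukhovBarriers
import Literature.Analysis.FluidPDE.PalasekObukhovBarrierDynamics
import Literature.Analysis.ODE.MovingBoxInvariance
import Literature.Analysis.ODE.TruncationLimit
import Literature.Analysis.ODE.NearestNeighbourChainSmooth
import Literature.Analysis.ODE.QuadraticChainDerivBounds
import Literature.Analysis.ODE.SmoothZeroExtension
import Literature.Analysis.Distribution.PeanoKernelPointValue
import HarnessLib

/-!
# Palasek 2026, Theorem 1.3 (with Remark 1.4): the proof — discharge of `Palasek2026_viscousBlowup`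

S. Palasek, *Finite-time blow-up in an elementary model of the 3D Navier–Stokes equations*,
arXiv:2605.13827 (2026), §3 (pp. 8–11). This module PROVES the named fact stated in
`PalasekObukhovBlowup.lean`: `Palasek2026_viscousBlowup_holds : Palasek2026_viscousBlowup`
(standard axioms, no new named facts). Imports: the statement file `PalasekObukhovBlowup` (`scale`,
`obukhovRHS`, the fact), `PalasekObukhovBarriers` (barrier algebra) and `PalasekObukhovBarrierDynamics`
(whose `duhamelTerm_eq` is reused, not restated), the five `Literature/Analysis/ODE` modules and
`PeanoKernelPointValue`. One module; its seven parts (each opening with its own `/-! … -/` block; developed file by file, map in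
the cell folder `run/shared/lean/pub/ns-blowup/lit/PALASEK-DISCHARGE.md`) are:
1. Trapping (§3.1 Def. 3.1 / Lemma 3.2 for the barrier family; Prop. 3.3 / 3.4): `zetaF`, `etaF`,
   `BarrierHypotheses`, `truncRHS`, `exists_trapped_solution_bounds` — via `ODE.MovingBoxInvariance`.
2. Limit (p. 10, `K → ∞`): `exists_limit_solution` — via `ODE.TruncationLimit`.
3. Regularity (§3.3 cut-offs, `C^∞`, derivative bounds with the small factor `θ_k`):
   `exists_regular_solution`, `ampBound`, `smallFactor`, `abs_iteratedDerivWithin_solution_le`.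
4. Force (§3.3, `g_k` and its derivatives): `forceTerm`, `forceBound`.
5. Rescaling (`X_k(t) = N_k^{-α} x_k(t-T)`, `f_k`, zero extension past `T`): `blowup_witness`.
6. Assembly (Thm 1.3 + Rem 1.4 modulo standing inequalities + asymptotics): `viscousBlowup_of_hypotheses`.
7. Parameters (§3.1 (exp_small)/(ratios) explicit; `b = (α+2)/4`, `β = (max{2b, α-s}+α)/2`, `c = 1/10`,
   `N₀ = e^L` large): `barrierHypotheses_exp`, `hX_exp`, `hF_exp`, `hF0_exp`, `hblow_exp`, the discharge.
Deviations from the printed argument are recorded at the head of each part.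
-/

open Set Filter Topology MeasureTheory intervalIntegral Metric Function
open scoped ContDiff ENNReal NNReal

noncomputable section


/-!
## Part 1 (Trapping).
Palasek 2026, §3.2–§3.3: the trapped Galerkin truncations (Propositions 3.3 / 3.4)

S. Palasek, arXiv:2605.13827 (2026), §3. This file is the third block of the discharge of the named fact
`Literature.Analysis.FluidPDE.Palasek2026_viscousBlowup` (plan: cell `pub/ns-blowup`,
`lit/PALASEK-FORMALISATION.md` §4): for every truncation order `K` the truncated, cut-off viscous
system in the rescaled unknowns `x_k = N_k^α X_k`,

  `x_k' = -ρ_k(t) μ_k x_k + x_{k-1} x_k - δ_k x_{k+1}² 1_{k ≤ K-1}`, `0 ≤ k ≤ K`, `x_{-1} ≡ 0`,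

with TERMINAL data `x_k(0) = A_k`, has a solution on `[-T, 0]` which stays in Palasek's moving
rectangle `ℛ_K(t) = {η_k(t) ≤ x_k ≤ ζ_k(t)}` (Def. 3.1) — Prop. 3.4 (and Prop. 3.3 for `μ ≡ 0`),
p. 9–10 of the source. All statements are PROVED; there are no new named facts.

## Rendering

* The barrier FAMILY `ζ^K_k`, `η^K_k` of Def. 3.1 is obtained from the one-step barriers of
  `PalasekObukhovBarriers` (`zetaTop`, `zetaMid`, `zetaZero`, `eta`) by downward recursion in `k`
  (`zetaF`, `etaF`); the activation times are `t_k = -c/A_{k-2}` (`= -T = -c/A₀` for `k ≤ 2`, `tk`).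
* The parameter inequalities the printed proof obtains "after increasing `N₀`" ((exp_small),
  (ratios), `β > 2b`, `c` small) are collected, in exactly the form in which the proof USES them, in
  the hypothesis bundle `BarrierHypotheses` (S1/S2 = the two conditions of `zetaMid_bounds`, V1/V2 =
  those of `zetaZero_bounds`, E1 = the tail condition of (eta_global_bound), S4 = the exit condition
  of the case `t < t_k` on p. 9); the viscous coefficients `visc k t = ρ_k(t) ν N_k²` enter through
  four hypotheses (`visc 0 ≡ μ₀`; `0 ≤ visc k ≤ A_{k-1}/4`, i.e. `νN_k² ≤ ¼A_{k-1}` from `β > 2b`;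
  `visc k(t) = 0` for `t < t_k`; `C¹` in `t`). Instantiating them with `A_k = N_k^β`, `N_k = N₀^{b^k}`
  is the business of the parameter block.
* Lemma 3.2 for the family (`zetaF_bounds`, `zetaF_zero_bounds`, `etaF_ge_three_quarters`,
  `etaF_ge_global`) is the downward induction of the source over the one-step lemmas; the
  non-emptiness `η_k ≤ ζ_k` of the rectangle (`etaF_le_zetaF`, implicit in the source) and the right
  derivatives of the barriers at their kinks `t_k` (`hasDerivWithinAt_zetaF`) are supplied here.
* The "standard argument based on the first time of exit" run backward from `t = 0` (p. 9) is the
  abstract moving-box theorem `Literature.Analysis.ODE.exists_solution_mem_Icc_of_face_backward_of_contDiff`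
  (Deimling 1977 §5.2); the two bullet inequalities of p. 9 (`x_k' ≥ ζ_k'` on the upper face,
  `x_k' ≤ η_k'` on the lower face, incl. the viscous modification of p. 10) are
  `zetaFDeriv_le_truncRHS` and `truncRHS_le_etaFDeriv`. The a-priori energy bound of the source is not
  needed (the abstract theorem clamps the field to the box).

## Main results

* `zetaF`, `etaF`, `tk`, `blowupT`, `BarrierHypotheses`, `truncRHS`, `truncField`: Def. 3.1 and the
  truncated system (truncated_viscous).
* `zetaF_bounds`, `zetaF_zero_bounds`, `etaF_ge_three_quarters`, `etaF_ge_global`: Lemma 3.2 for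
  the whole family.
* `exists_trapped_solution`: Prop. 3.4 — a solution of the truncated system on `[-T, 0]` with
  `x_k(0) = A_k` and `η_k(t) ≤ x_k(t) ≤ ζ_k(t)`.
* `exists_trapped_solution_bounds`: the same with the `K`-uniform bounds
  (uniform_truncated_bounds_viscous) and the lower bounds inherited from Lemma 3.2.
-/

open Set Filter Topology MeasureTheory intervalIntegral

namespace Literature.Analysis.FluidPDE

namespace PalasekObukhov

/-! ### Calculus helpers -/

/-- FTC for a variable lower limit: `u ↦ ∫_u^0 g` has derivative `-g(s)` at every `s` when `g` is
continuous. [folklore] -/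
private theorem hasDerivAt_integral_lower {g : ℝ → ℝ} (hg : Continuous g) (s : ℝ) :
    HasDerivAt (fun u => ∫ r in u..0, g r) (-g s) s := by
  have h := (hg.integral_hasStrictDerivAt 0 s).hasDerivAt
  have heq : (fun u => ∫ r in u..0, g r) = fun u => -∫ r in (0 : ℝ)..u, g r := by
    funext u
    rw [integral_symm]
  rw [heq]
  exact h.neg

/-- Continuity of `u ↦ ∫_u^0 g` for continuous `g`. [folklore] -/
private theorem continuous_integral_lower {g : ℝ → ℝ} (hg : Continuous g) :
    Continuous fun u => ∫ r in u..0, g r :=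
  continuous_iff_continuousAt.2 fun s => (hasDerivAt_integral_lower hg s).continuousAt

/-- `∫_a^0 e^{λ s} ds ≤ 1/λ` for `λ > 0` (any `a`). [folklore] -/
private theorem integral_exp_mul_le_inv {lam a : ℝ} (hlam : 0 < lam) :
    ∫ s in a..0, Real.exp (lam * s) ≤ 1 / lam := by
  have h : ∀ x ∈ uIcc a 0, HasDerivAt (fun s => Real.exp (lam * s) / lam) (Real.exp (lam * x)) x := by
    intro x _
    have h1 : HasDerivAt (fun s => Real.exp (lam * s)) (Real.exp (lam * x) * lam) x := by
      simpa using ((hasDerivAt_id x).const_mul lam).exp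
    have h2 := h1.div_const lam
    rwa [mul_div_cancel_right₀ _ hlam.ne'] at h2
  have hint : IntervalIntegrable (fun s => Real.exp (lam * s)) volume a 0 :=
    (by fun_prop : Continuous fun s => Real.exp (lam * s)).intervalIntegrable _ _
  rw [integral_eq_sub_of_hasDerivAt h hint]
  have hpos := Real.exp_pos (lam * a)
  have : Real.exp (lam * 0) / lam - Real.exp (lam * a) / lam = (1 - Real.exp (lam * a)) / lam := by
    rw [mul_zero, Real.exp_zero, sub_div]
  rw [this]
  exact div_le_div_of_nonneg_right (by linarith) hlam.le

/-! ### Palasek's times `T` and `t_k` -/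

/-- The lifespan `T = c/A₀` of the construction ((tk_times_def)). [cite: Palasek2026ElementaryModel, §3.1 (tk_times_def)] -/
noncomputable def blowupT (A : ℕ → ℝ) (c : ℝ) : ℝ :=
  c / A 0

/-- The activation times `t_k = -c/A_{k-2}` (`k ≥ 3`), `t₁ = t₂ = -T` ((tk_times_def)); the formula
`-c/A_{k-2}` with truncated subtraction covers all `k` (and sets `t₀ = -T` as well).
[cite: Palasek2026ElementaryModel, §3.1 (tk_times_def)] -/
noncomputable def tk (A : ℕ → ℝ) (c : ℝ) (k : ℕ) : ℝ :=
  -(c / A (k - 2))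

/-- `t_k = -T` for `k ≤ 2`. [cite: Palasek2026ElementaryModel, §3.1 (tk_times_def)] -/
theorem tk_of_le_two {A : ℕ → ℝ} {c : ℝ} {k : ℕ} (hk : k ≤ 2) : tk A c k = -blowupT A c := by
  have h : k - 2 = 0 := by omega
  simp [tk, blowupT, h]

/-! ### The barrier family of Definition 3.1 -/

/-- **The upper barriers `ζ_k = ζ^K_k` of Def. 3.1**, all `k` at once, by downward recursion from
`k = K`: `ζ_K = zetaTop`, `ζ_k = zetaMid(ζ_{k+1})` for `1 ≤ k ≤ K-1`, `ζ₀ = zetaZero(ζ₁)` (with the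
mode-`0` viscosity `μ₀ = νN₀²`); levels `k > K` (unused) repeat `ζ_K`.
[cite: Palasek2026ElementaryModel, §3.1 Def. 3.1] -/
noncomputable def zetaF (A δ : ℕ → ℝ) (μ0 c : ℝ) (K : ℕ) (k : ℕ) : ℝ → ℝ :=
  if hk : K ≤ k then zetaTop (A K) (A (K - 1)) (tk A c K)
  else if k = 0 then zetaZero μ0 (A 0) (δ 0) (zetaF A δ μ0 c K (k + 1))
  else zetaMid (A k) (A (k - 1)) (δ k) (tk A c k) (zetaF A δ μ0 c K (k + 1))
termination_by K - k
decreasing_by all_goals omega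

/-- **The lower barriers `η_k` of Def. 3.1**: `η₀ ≡ A₀`, `η_k = A_k exp(-∫_t^0 ζ_{k-1})`.
[cite: Palasek2026ElementaryModel, §3.1 Def. 3.1] -/
noncomputable def etaF (A δ : ℕ → ℝ) (μ0 c : ℝ) (K k : ℕ) (t : ℝ) : ℝ :=
  if k = 0 then A 0 else eta (A k) (zetaF A δ μ0 c K (k - 1)) t

section Unfold

variable {A δ : ℕ → ℝ} {μ0 c : ℝ} {K k : ℕ}

/-- Levels `k ≥ K` are the top barrier. [cite: Palasek2026ElementaryModel, §3.1 Def. 3.1] -/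
theorem zetaF_of_le (hk : K ≤ k) :
    zetaF A δ μ0 c K k = zetaTop (A K) (A (K - 1)) (tk A c K) := by
  rw [zetaF, dif_pos hk]

/-- Level `0` is the bottom barrier driven by `ζ₁` (`K ≥ 1`). [cite: Palasek2026ElementaryModel, §3.1 Def. 3.1] -/
theorem zetaF_zero (hK : 1 ≤ K) :
    zetaF A δ μ0 c K 0 = zetaZero μ0 (A 0) (δ 0) (zetaF A δ μ0 c K 1) := by
  rw [zetaF, dif_neg (by omega), if_pos rfl]

/-- Levels `1 ≤ k ≤ K-1` are the Duhamel barriers driven by `ζ_{k+1}`. [cite: Palasek2026ElementaryModel, §3.1 Def. 3.1] -/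
theorem zetaF_of_pos_of_lt (hk : 1 ≤ k) (hkK : k < K) :
    zetaF A δ μ0 c K k =
      zetaMid (A k) (A (k - 1)) (δ k) (tk A c k) (zetaF A δ μ0 c K (k + 1)) := by
  rw [zetaF, dif_neg (by omega), if_neg (by omega)]

/-- `η₀ ≡ A₀`. [cite: Palasek2026ElementaryModel, §3.1 Def. 3.1] -/
theorem etaF_zero (t : ℝ) : etaF A δ μ0 c K 0 t = A 0 := by
  simp [etaF]

/-- `η_k = eta A_k ζ_{k-1}` for `k ≥ 1`. [cite: Palasek2026ElementaryModel, §3.1 Def. 3.1] -/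
theorem etaF_of_pos (hk : 1 ≤ k) (t : ℝ) :
    etaF A δ μ0 c K k t = eta (A k) (zetaF A δ μ0 c K (k - 1)) t := by
  rw [etaF, if_neg (by omega)]

end Unfold

/-! ### One-step barriers: smooth branches, continuity and right derivatives -/

section OneStep

variable {Ak Aprev δk tk₀ AK tK μ A0 δ0 : ℝ} {ζnext ζone ζprev : ℝ → ℝ} {t : ℝ}

/-- The smooth branch of `zetaMid` (the Duhamel formula without the freezing below `t_k`).
[cite: Palasek2026ElementaryModel, §3.1 Def. 3.1 (Duhamel formula)] -/
noncomputable def zetaMidSmooth (Ak Aprev δk : ℝ) (ζnext : ℝ → ℝ) (s : ℝ) : ℝ :=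
  Ak * Real.exp (Aprev / 2 * s) +
    δk * (Real.exp (Aprev / 2 * s) * ∫ r in s..0, Real.exp (-(Aprev / 2) * r) * ζnext r ^ 2)

/-- `zetaMid t = zetaMidSmooth (max t t_k)`. [cite: Palasek2026ElementaryModel, §3.1 Def. 3.1] -/
theorem zetaMid_eq_zetaMidSmooth_max (Ak Aprev δk tk₀ : ℝ) (ζnext : ℝ → ℝ) (t : ℝ) :
    zetaMid Ak Aprev δk tk₀ ζnext t = zetaMidSmooth Ak Aprev δk ζnext (max t tk₀) := by
  unfold zetaMid zetaMidSmooth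
  rw [duhamelTerm_eq]

/-- On `t ≥ t_k` the barrier is its smooth branch. [cite: Palasek2026ElementaryModel, §3.1 Def. 3.1] -/
theorem zetaMid_eq_of_tk_le (h : tk₀ ≤ t) :
    zetaMid Ak Aprev δk tk₀ ζnext t = zetaMidSmooth Ak Aprev δk ζnext t := by
  rw [zetaMid_eq_zetaMidSmooth_max, max_eq_left h]

/-- Below `t_k` the barrier is frozen at its value at `t_k`. [cite: Palasek2026ElementaryModel, §3.1 Def. 3.1] -/
theorem zetaMid_eq_of_le_tk (h : t ≤ tk₀) :
    zetaMid Ak Aprev δk tk₀ ζnext t = zetaMidSmooth Ak Aprev δk ζnext tk₀ := by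
  rw [zetaMid_eq_zetaMidSmooth_max, max_eq_right h]

/-- **The ODE of Def. 3.1 on the smooth branch**: `ζ' = ½A_{k-1}ζ - δ_kζ_{k+1}²` (continuous
`ζ_{k+1}`). [cite: Palasek2026ElementaryModel, §3.1 Def. 3.1] -/
theorem hasDerivAt_zetaMidSmooth (Ak Aprev δk : ℝ) (hζ : Continuous ζnext) (s : ℝ) :
    HasDerivAt (zetaMidSmooth Ak Aprev δk ζnext)
      (Aprev / 2 * zetaMidSmooth Ak Aprev δk ζnext s - δk * ζnext s ^ 2) s := by
  have hg : Continuous fun r => Real.exp (-(Aprev / 2) * r) * ζnext r ^ 2 := by fun_prop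
  have hI := hasDerivAt_integral_lower hg s
  have hE : HasDerivAt (fun s => Real.exp (Aprev / 2 * s))
      (Real.exp (Aprev / 2 * s) * (Aprev / 2)) s := by
    simpa using ((hasDerivAt_id s).const_mul (Aprev / 2)).exp
  have h : HasDerivAt (zetaMidSmooth Ak Aprev δk ζnext)
      (Ak * (Real.exp (Aprev / 2 * s) * (Aprev / 2)) +
        δk * (Real.exp (Aprev / 2 * s) * (Aprev / 2) *
            (∫ r in s..0, Real.exp (-(Aprev / 2) * r) * ζnext r ^ 2) +
          Real.exp (Aprev / 2 * s) * -(Real.exp (-(Aprev / 2) * s) * ζnext s ^ 2))) s := by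
    unfold zetaMidSmooth
    exact (hE.const_mul Ak).add ((hE.mul hI).const_mul δk)
  refine h.congr_deriv ?_
  have hee : Real.exp (Aprev / 2 * s) * Real.exp (-(Aprev / 2) * s) = 1 := by
    rw [← Real.exp_add, show Aprev / 2 * s + -(Aprev / 2) * s = 0 by ring, Real.exp_zero]
  unfold zetaMidSmooth
  linear_combination (-δk * ζnext s ^ 2) * hee

/-- Continuity of the smooth branch. [cite: Palasek2026ElementaryModel, §3.1 Def. 3.1] -/
theorem continuous_zetaMidSmooth (Ak Aprev δk : ℝ) (hζ : Continuous ζnext) :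
    Continuous (zetaMidSmooth Ak Aprev δk ζnext) :=
  continuous_iff_continuousAt.2 fun s => (hasDerivAt_zetaMidSmooth Ak Aprev δk hζ s).continuousAt

/-- Continuity of `ζ_k` (given a continuous `ζ_{k+1}`). [cite: Palasek2026ElementaryModel, §3.1 Def. 3.1] -/
theorem continuous_zetaMid_of_continuous (Ak Aprev δk tk₀ : ℝ) (hζ : Continuous ζnext) :
    Continuous (zetaMid Ak Aprev δk tk₀ ζnext) := by
  have heq : zetaMid Ak Aprev δk tk₀ ζnext =
      zetaMidSmooth Ak Aprev δk ζnext ∘ fun t => max t tk₀ := by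
    funext t
    exact zetaMid_eq_zetaMidSmooth_max Ak Aprev δk tk₀ ζnext t
  rw [heq]
  exact (continuous_zetaMidSmooth Ak Aprev δk hζ).comp (continuous_id.max continuous_const)

/-- **Right derivative of `ζ_k` on `[t_k, 0)` (and beyond)**: the ODE value of Def. 3.1, also AT the
kink `t = t_k`. [cite: Palasek2026ElementaryModel, §3.1 Def. 3.1] -/
theorem hasDerivWithinAt_zetaMid_Ici_of_le (hζ : Continuous ζnext) (h : tk₀ ≤ t) :
    HasDerivWithinAt (zetaMid Ak Aprev δk tk₀ ζnext)
      (Aprev / 2 * zetaMid Ak Aprev δk tk₀ ζnext t - δk * ζnext t ^ 2) (Ici t) t := by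
  have hD := hasDerivAt_zetaMidSmooth Ak Aprev δk hζ t
  refine (hD.hasDerivWithinAt.congr (fun s hs => zetaMid_eq_of_tk_le (h.trans hs))
    (zetaMid_eq_of_tk_le h)).congr_deriv ?_
  rw [zetaMid_eq_of_tk_le h]

/-- **Right derivative of `ζ_k` below `t_k`**: zero (the barrier is frozen). [cite: Palasek2026ElementaryModel, §3.1 Def. 3.1] -/
theorem hasDerivWithinAt_zetaMid_Ici_of_lt (h : t < tk₀) :
    HasDerivWithinAt (zetaMid Ak Aprev δk tk₀ ζnext) 0 (Ici t) t := by
  have hc : HasDerivAt (fun _ : ℝ => zetaMidSmooth Ak Aprev δk ζnext tk₀) 0 t :=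
    hasDerivAt_const t _
  refine (hc.congr_of_eventuallyEq ?_).hasDerivWithinAt
  filter_upwards [Iio_mem_nhds h] with s hs
  exact zetaMid_eq_of_le_tk hs.le

/-- The top barrier on `t ≥ t_K`. [cite: Palasek2026ElementaryModel, §3.1 Def. 3.1] -/
theorem zetaTop_eq_of_le (h : tK ≤ t) : zetaTop AK Aprev tK t = AK * Real.exp (Aprev / 2 * t) := by
  simp [zetaTop, barrierProfile, max_eq_left h]

/-- The top barrier below `t_K` is frozen. [cite: Palasek2026ElementaryModel, §3.1 Def. 3.1] -/
theorem zetaTop_eq_of_ge (h : t ≤ tK) : zetaTop AK Aprev tK t = AK * Real.exp (Aprev / 2 * tK) := by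
  simp [zetaTop, barrierProfile, max_eq_right h]

/-- Continuity of the top barrier. [cite: Palasek2026ElementaryModel, §3.1 Def. 3.1] -/
theorem continuous_zetaTop (AK Aprev tK : ℝ) : Continuous (zetaTop AK Aprev tK) := by
  unfold zetaTop barrierProfile
  fun_prop

/-- **Right derivative of `ζ_K` on `[t_K, ∞)`**: `½A_{K-1}ζ_K`. [cite: Palasek2026ElementaryModel, §3.1 Def. 3.1] -/
theorem hasDerivWithinAt_zetaTop_Ici_of_le (h : tK ≤ t) :
    HasDerivWithinAt (zetaTop AK Aprev tK) (Aprev / 2 * zetaTop AK Aprev tK t) (Ici t) t := by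
  have hE : HasDerivAt (fun s => AK * Real.exp (Aprev / 2 * s))
      (AK * (Real.exp (Aprev / 2 * t) * (Aprev / 2))) t := by
    simpa using (((hasDerivAt_id t).const_mul (Aprev / 2)).exp).const_mul AK
  refine (hE.hasDerivWithinAt.congr (fun s hs => zetaTop_eq_of_le (h.trans hs))
    (zetaTop_eq_of_le h)).congr_deriv ?_
  rw [zetaTop_eq_of_le h]
  ring

/-- **Right derivative of `ζ_K` below `t_K`**: zero. [cite: Palasek2026ElementaryModel, §3.1 Def. 3.1] -/
theorem hasDerivWithinAt_zetaTop_Ici_of_lt (h : t < tK) :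
    HasDerivWithinAt (zetaTop AK Aprev tK) 0 (Ici t) t := by
  have hc : HasDerivAt (fun _ : ℝ => AK * Real.exp (Aprev / 2 * tK)) 0 t := hasDerivAt_const t _
  refine (hc.congr_of_eventuallyEq ?_).hasDerivWithinAt
  filter_upwards [Iio_mem_nhds h] with s hs
  exact zetaTop_eq_of_ge hs.le

/-- The bottom barrier, factorised: `ζ₀(t) = e^{-μt}(A₀ + δ₀∫_t^0 e^{μs}ζ₁(s)² ds)`.
[cite: Palasek2026ElementaryModel, §3.1 Def. 3.1 and proof of (z0_bound)] -/
theorem zetaZero_eq_exp_mul (μ A0 δ0 : ℝ) (ζone : ℝ → ℝ) (t : ℝ) :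
    zetaZero μ A0 δ0 ζone t =
      Real.exp (-(μ * t)) * (A0 + δ0 * ∫ s in t..0, Real.exp (μ * s) * ζone s ^ 2) := by
  unfold zetaZero
  have h : ∫ s in t..0, Real.exp (μ * (s - t)) * ζone s ^ 2 =
      Real.exp (-(μ * t)) * ∫ s in t..0, Real.exp (μ * s) * ζone s ^ 2 := by
    rw [← intervalIntegral.integral_const_mul]
    refine intervalIntegral.integral_congr fun s _ => ?_
    rw [show μ * (s - t) = -(μ * t) + μ * s by ring, Real.exp_add]
    ring
  rw [h]
  ring

/-- **The ODE of Def. 3.1 for `ζ₀`**: `ζ₀' = -μζ₀ - δ₀ζ₁²` (continuous `ζ₁`). [cite: Palasek2026ElementaryModel, §3.1 Def. 3.1] -/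
theorem hasDerivAt_zetaZero_of_continuous (μ A0 δ0 : ℝ) (hζ : Continuous ζone) (t : ℝ) :
    HasDerivAt (zetaZero μ A0 δ0 ζone)
      (-μ * zetaZero μ A0 δ0 ζone t - δ0 * ζone t ^ 2) t := by
  have hg : Continuous fun s => Real.exp (μ * s) * ζone s ^ 2 := by fun_prop
  have hI := hasDerivAt_integral_lower hg t
  have hE : HasDerivAt (fun s => Real.exp (-(μ * s))) (Real.exp (-(μ * t)) * -μ) t := by
    simpa using (((hasDerivAt_id t).const_mul μ).neg).exp
  have h : HasDerivAt (zetaZero μ A0 δ0 ζone)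
      (Real.exp (-(μ * t)) * -μ * (A0 + δ0 * ∫ s in t..0, Real.exp (μ * s) * ζone s ^ 2) +
        Real.exp (-(μ * t)) * (δ0 * -(Real.exp (μ * t) * ζone t ^ 2))) t := by
    have heq : zetaZero μ A0 δ0 ζone = fun s =>
        Real.exp (-(μ * s)) * (A0 + δ0 * ∫ r in s..0, Real.exp (μ * r) * ζone r ^ 2) := by
      funext s
      exact zetaZero_eq_exp_mul μ A0 δ0 ζone s
    rw [heq]
    exact hE.mul ((hI.const_mul δ0).const_add A0)
  refine h.congr_deriv ?_
  have hee : Real.exp (-(μ * t)) * Real.exp (μ * t) = 1 := by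
    rw [← Real.exp_add, show -(μ * t) + μ * t = 0 by ring, Real.exp_zero]
  rw [zetaZero_eq_exp_mul]
  linear_combination (-δ0 * ζone t ^ 2) * hee

/-- Continuity of `ζ₀`. [cite: Palasek2026ElementaryModel, §3.1 Def. 3.1] -/
theorem continuous_zetaZero_of_continuous (μ A0 δ0 : ℝ) (hζ : Continuous ζone) :
    Continuous (zetaZero μ A0 δ0 ζone) :=
  continuous_iff_continuousAt.2 fun s => (hasDerivAt_zetaZero_of_continuous μ A0 δ0 hζ s).continuousAt

/-- **The ODE of Def. 3.1 for `η_k`**: `η_k' = ζ_{k-1}η_k` (continuous `ζ_{k-1}`). [cite: Palasek2026ElementaryModel, §3.1 Def. 3.1] -/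
theorem hasDerivAt_eta_of_continuous (Ak : ℝ) (hζ : Continuous ζprev) (t : ℝ) :
    HasDerivAt (eta Ak ζprev) (ζprev t * eta Ak ζprev t) t := by
  have hI := hasDerivAt_integral_lower hζ t
  have h : HasDerivAt (eta Ak ζprev)
      (Ak * (Real.exp (-∫ s in t..0, ζprev s) * -(-ζprev t))) t := by
    unfold eta
    exact (hI.neg.exp).const_mul Ak
  refine h.congr_deriv ?_
  unfold eta
  ring

/-- Continuity of `η_k`. [cite: Palasek2026ElementaryModel, §3.1 Def. 3.1] -/
theorem continuous_eta_of_continuous (Ak : ℝ) (hζ : Continuous ζprev) :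
    Continuous (eta Ak ζprev) :=
  continuous_iff_continuousAt.2 fun s => (hasDerivAt_eta_of_continuous Ak hζ s).continuousAt

/-- `η` is non-decreasing where the previous barrier is non-negative. [cite: Palasek2026ElementaryModel, §3.1 Def. 3.1] -/
theorem eta_le_eta_of_le {Ak : ℝ} (hAk : 0 ≤ Ak) (hζ : Continuous ζprev) {s t : ℝ} (hst : s ≤ t)
    (hnn : ∀ r ∈ Icc s t, 0 ≤ ζprev r) : eta Ak ζprev s ≤ eta Ak ζprev t := by
  unfold eta
  have hsplit : ∫ r in s..0, ζprev r = (∫ r in s..t, ζprev r) + ∫ r in t..0, ζprev r :=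
    (integral_add_adjacent_intervals (hζ.intervalIntegrable _ _) (hζ.intervalIntegrable _ _)).symm
  have hnn' : 0 ≤ ∫ r in s..t, ζprev r := intervalIntegral.integral_nonneg hst hnn
  refine mul_le_mul_of_nonneg_left (Real.exp_le_exp.2 ?_) hAk
  rw [hsplit]
  linarith

end OneStep

/-! ### The parameter inequalities of §3.1, in the form the proof uses them -/

/-- **The standing parameter inequalities of §3.1** under which Def. 3.1 / Lemma 3.2 / Prop. 3.3–3.4
are run (`A_k` increasing and positive, `δ_k ≥ 0`, `c > 0` with `e^{-2c} ≥ ¾`, `μ₀ ≥ 0`), together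
with the finitely many consequences of (exp_small)/(ratios) that the printed proofs invoke "after
increasing `N₀`": V1/V2 (proof of (z0_bound), p. 9), S1/S2 (Cases 1–2 of the proof of (z_bound),
p. 8), E1 (tail of (eta_global_bound), p. 9), S4 (the case `t < t_k` of the proof of Prop. 3.3,
p. 9, with `x_k = ζ_k` on the face). [cite: Palasek2026ElementaryModel, §3.1 (exp_small), (ratios), Lemma 3.2, Prop. 3.3] -/
structure BarrierHypotheses (A δ : ℕ → ℝ) (μ0 c : ℝ) : Prop where
  A_pos : ∀ k, 0 < A k
  A_mono : Monotone A
  δ_nonneg : ∀ k, 0 ≤ δ k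
  c_pos : 0 < c
  exp_two_c : 3 / 4 ≤ Real.exp (-(2 * c))
  μ0_nonneg : 0 ≤ μ0
  V1 : Real.exp (μ0 * blowupT A c) ≤ 3 / 2
  V2 : 12 * δ 0 * A 1 ^ 2 ≤ A 0 ^ 2
  S1 : ∀ k, 1 ≤ k →
    4 * δ k * A (k + 1) ^ 2 * (-tk A c k) * Real.exp (A k * tk A c (k + 1)) ≤
      1 / 2 * A k * Real.exp (A (k - 1) / 2 * tk A c k)
  S2 : ∀ k, 1 ≤ k → 8 * δ k * A (k + 1) ^ 2 ≤ 1 / 2 * A k ^ 2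
  E1 : ∀ j, 3 ≤ j →
    2 * A j * blowupT A c * Real.exp (A (j - 1) / 2 * tk A c j) ≤ A j / A (j - 1)
  S4 : ∀ k, 3 ≤ k →
    4 * δ k * A (k + 1) ^ 2 * Real.exp (A k * tk A c (k + 1)) ≤
      A (k - 1) * A k * Real.exp (A (k - 1) / 2 * tk A c k - 5 * (A (k - 2) / A (k - 3)))

namespace BarrierHypotheses

variable {A δ : ℕ → ℝ} {μ0 c : ℝ} (hH : BarrierHypotheses A δ μ0 c)
include hH

/-- `T > 0`. [cite: Palasek2026ElementaryModel, §3.1 (tk_times_def)] -/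
theorem blowupT_pos : 0 < blowupT A c :=
  div_pos hH.c_pos (hH.A_pos 0)

/-- `t_k < 0`. [cite: Palasek2026ElementaryModel, §3.1 (tk_times_def)] -/
theorem tk_neg (k : ℕ) : tk A c k < 0 := by
  have := div_pos hH.c_pos (hH.A_pos (k - 2))
  unfold tk
  linarith

/-- `-T ≤ t_k`. [cite: Palasek2026ElementaryModel, §3.1 (tk_times_def)] -/
theorem neg_blowupT_le_tk (k : ℕ) : -blowupT A c ≤ tk A c k := by
  have h := div_le_div_of_nonneg_left hH.c_pos.le (hH.A_pos 0) (hH.A_mono (Nat.zero_le (k - 2)))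
  unfold tk blowupT
  linarith

/-- `t_k ≤ t_{k+1}` ("since `A_k` is increasing"). [cite: Palasek2026ElementaryModel, §3.1 (tk_times_def)] -/
theorem tk_le_tk_succ (k : ℕ) : tk A c k ≤ tk A c (k + 1) := by
  have h := div_le_div_of_nonneg_left hH.c_pos.le (hH.A_pos (k - 2))
    (hH.A_mono (show k - 2 ≤ k + 1 - 2 by omega))
  unfold tk
  linarith

/-- `t_k` is non-decreasing in `k`. [cite: Palasek2026ElementaryModel, §3.1 (tk_times_def)] -/
theorem tk_mono : Monotone (tk A c) :=
  monotone_nat_of_le_succ hH.tk_le_tk_succ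

/-- `A_{k-2} t_k = -c`. [cite: Palasek2026ElementaryModel, §3.1 (tk_times_def)] -/
theorem A_mul_tk (k : ℕ) : A (k - 2) * tk A c k = -c := by
  have := (hH.A_pos (k - 2)).ne'
  unfold tk
  field_simp

/-- `e^{-c/2} ≥ ½` (from `e^{-2c} ≥ ¾`). [cite: Palasek2026ElementaryModel, §3.1 ("fix a small constant c > 0")] -/
theorem half_le_exp_neg_half_c : 1 / 2 ≤ Real.exp (-(c / 2)) := by
  have h1 : Real.exp (-(2 * c)) ≤ Real.exp (-(c / 2)) := Real.exp_le_exp.2 (by linarith [hH.c_pos])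
  linarith [hH.exp_two_c]

end BarrierHypotheses

/-! ### Lemma 3.2 for the family -/

section Family

variable {A δ : ℕ → ℝ} {μ0 c : ℝ} {K : ℕ}

/-- Levels `k ≥ K` are continuous. [cite: Palasek2026ElementaryModel, §3.1 Def. 3.1] -/
theorem continuous_zetaF_of_le {k : ℕ} (hk : K ≤ k) : Continuous (zetaF A δ μ0 c K k) := by
  rw [zetaF_of_le hk]
  exact continuous_zetaTop _ _ _

/-- The downward induction of the proof of Lemma 3.2: continuity and (z_bound) for `ζ_k`,
`1 ≤ k ≤ K`. [cite: Palasek2026ElementaryModel, §3.1 Lemma 3.2 (z_bound)] -/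
theorem zetaF_spec_aux (hH : BarrierHypotheses A δ μ0 c) :
    ∀ j k : ℕ, k + j = K → 1 ≤ k →
      Continuous (zetaF A δ μ0 c K k) ∧ ∀ t : ℝ, t ≤ 0 →
        A k * barrierProfile (A (k - 1)) (tk A c k) t ≤ zetaF A δ μ0 c K k t ∧
          zetaF A δ μ0 c K k t ≤ 2 * A k * barrierProfile (A (k - 1)) (tk A c k) t := by
  intro j
  induction j with
  | zero =>
    intro k hk h1
    have hkK : K ≤ k := by omega
    refine ⟨continuous_zetaF_of_le hkK, fun t _ => ?_⟩
    have hKk : K = k := by omega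
    rw [zetaF_of_le hkK, hKk]
    exact zetaTop_bounds (hH.A_pos k).le _ _ _
  | succ j ih =>
    intro k hk h1
    have hkK : k < K := by omega
    obtain ⟨hcont, hbds⟩ := ih (k + 1) (by omega) (by omega)
    have hk1 : k + 1 - 1 = k := by omega
    rw [hk1] at hbds
    rw [zetaF_of_pos_of_lt h1 hkK]
    refine ⟨continuous_zetaMid_of_continuous _ _ _ _ hcont, fun t ht => ?_⟩
    have hnext : ∀ s ∈ Icc (tk A c k) 0, 0 ≤ zetaF A δ μ0 c K (k + 1) s ∧
        zetaF A δ μ0 c K (k + 1) s ≤ 2 * A (k + 1) * barrierProfile (A k) (tk A c (k + 1)) s := by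
      intro s hs
      refine ⟨le_trans ?_ (hbds s hs.2).1, (hbds s hs.2).2⟩
      exact (mul_pos (hH.A_pos _) (barrierProfile_pos _ _ _)).le
    exact zetaMid_bounds (hH.A_pos (k - 1)) (hH.A_mono (Nat.sub_le k 1)) (hH.δ_nonneg k)
      (hH.tk_le_tk_succ k) (hH.tk_neg (k + 1)).le (le_refl (1 / 2 : ℝ)) hcont.continuousOn
      hnext (hH.S1 k h1) (hH.S2 k h1) ht

/-- **Every barrier `ζ_k` is continuous.** [cite: Palasek2026ElementaryModel, §3.1 Def. 3.1] -/
theorem continuous_zetaF (hH : BarrierHypotheses A δ μ0 c) (hK : 1 ≤ K) (k : ℕ) :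
    Continuous (zetaF A δ μ0 c K k) := by
  rcases le_or_gt K k with hk | hk
  · exact continuous_zetaF_of_le hk
  rcases Nat.eq_zero_or_pos k with rfl | hk0
  · rw [zetaF_zero hK]
    exact continuous_zetaZero_of_continuous _ _ _
      (zetaF_spec_aux hH (K - 1) 1 (by omega) le_rfl).1
  · exact (zetaF_spec_aux hH (K - k) k (by omega) hk0).1

/-- **Lemma 3.2, (z_bound), for the family**: `A_k E_k(t) ≤ ζ_k(t) ≤ 2A_k E_k(t)`,
`E_k(t) = exp(½A_{k-1}max{t,t_k})`, `1 ≤ k ≤ K`, `t ≤ 0`. [cite: Palasek2026ElementaryModel, §3.1 Lemma 3.2 (z_bound)] -/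
theorem zetaF_bounds (hH : BarrierHypotheses A δ μ0 c) {k : ℕ} (hk : 1 ≤ k) (hkK : k ≤ K)
    {t : ℝ} (ht : t ≤ 0) :
    A k * barrierProfile (A (k - 1)) (tk A c k) t ≤ zetaF A δ μ0 c K k t ∧
      zetaF A δ μ0 c K k t ≤ 2 * A k * barrierProfile (A (k - 1)) (tk A c k) t :=
  (zetaF_spec_aux hH (K - k) k (by omega) hk).2 t ht

/-- **Lemma 3.2, (z0_bound), for the family**: `A₀ ≤ ζ₀ ≤ 2A₀` on `[-T, 0]`. [cite: Palasek2026ElementaryModel, §3.1 Lemma 3.2 (z0_bound)] -/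
theorem zetaF_zero_bounds (hH : BarrierHypotheses A δ μ0 c) (hK : 1 ≤ K) {t : ℝ}
    (ht : t ∈ Icc (-blowupT A c) 0) :
    A 0 ≤ zetaF A δ μ0 c K 0 t ∧ zetaF A δ μ0 c K 0 t ≤ 2 * A 0 := by
  rw [zetaF_zero hK]
  refine zetaZero_bounds hH.μ0_nonneg (hH.A_pos 0) (hH.δ_nonneg 0)
    (continuous_zetaF hH hK 1).continuousOn (fun s hs => ?_) hH.V1 hH.V2 ht
  have hb := zetaF_bounds hH le_rfl hK hs.2
  have hmax : max s (tk A c 1) = s :=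
    max_eq_left (by rw [tk_of_le_two (by norm_num)]; exact hs.1)
  simp only [barrierProfile, hmax, Nat.sub_self] at hb
  exact ⟨le_trans (mul_pos (hH.A_pos 1) (Real.exp_pos _)).le hb.1, hb.2⟩

/-- The profile is at most `1` for `t ≤ 0`. [cite: Palasek2026ElementaryModel, §3.1 Lemma 3.2] -/
theorem barrierProfile_le_one (hH : BarrierHypotheses A δ μ0 c) (k : ℕ) {t : ℝ} (ht : t ≤ 0) :
    barrierProfile (A (k - 1)) (tk A c k) t ≤ 1 := by
  unfold barrierProfile
  rw [Real.exp_le_one_iff]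
  have h1 : max t (tk A c k) ≤ 0 := max_le ht (hH.tk_neg k).le
  have h2 : 0 ≤ A (k - 1) / 2 := by linarith [hH.A_pos (k - 1)]
  nlinarith

/-- **All barriers are non-negative** on `[-T, 0]`. [cite: Palasek2026ElementaryModel, §3.1 Lemma 3.2] -/
theorem zetaF_nonneg (hH : BarrierHypotheses A δ μ0 c) (hK : 1 ≤ K) (k : ℕ) {t : ℝ}
    (ht : t ∈ Icc (-blowupT A c) 0) : 0 ≤ zetaF A δ μ0 c K k t := by
  rcases Nat.eq_zero_or_pos k with rfl | hk0
  · exact (hH.A_pos 0).le.trans (zetaF_zero_bounds hH hK ht).1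
  rcases le_or_gt k K with hk | hk
  · exact le_trans (mul_pos (hH.A_pos _) (barrierProfile_pos _ _ _)).le
      (zetaF_bounds hH hk0 hk ht.2).1
  · rw [zetaF_of_le hk.le]
    unfold zetaTop
    exact (mul_pos (hH.A_pos _) (barrierProfile_pos _ _ _)).le

/-- Crude upper bound `ζ_k ≤ 2A_k` on `t ≤ 0` (`1 ≤ k ≤ K`). [cite: Palasek2026ElementaryModel, §3.1 Lemma 3.2] -/
theorem zetaF_le_two_mul (hH : BarrierHypotheses A δ μ0 c) {k : ℕ} (hk : 1 ≤ k) (hkK : k ≤ K)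
    {t : ℝ} (ht : t ≤ 0) : zetaF A δ μ0 c K k t ≤ 2 * A k := by
  have h := (zetaF_bounds hH hk hkK ht).2
  have hp := barrierProfile_le_one hH k ht
  have hA := (hH.A_pos k).le
  nlinarith

/-- Crude lower bound `ζ_k(s) ≥ ½A_k` on `[t_{k+1}, 0] ∩ [-T, 0]` (`k ≤ K`): there
`½A_{k-1}max{s,t_k} ≥ ½A_{k-1}t_{k+1} = -c/2` and `e^{-c/2} ≥ ½`. [cite: Palasek2026ElementaryModel, §3.1 Lemma 3.2] -/
theorem half_le_zetaF (hH : BarrierHypotheses A δ μ0 c) (hK : 1 ≤ K) {k : ℕ} (hkK : k ≤ K)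
    {s : ℝ} (hs : s ∈ Icc (tk A c (k + 1)) 0) (hsT : -blowupT A c ≤ s) :
    1 / 2 * A k ≤ zetaF A δ μ0 c K k s := by
  rcases Nat.eq_zero_or_pos k with rfl | hk0
  · have := (zetaF_zero_bounds hH hK ⟨hsT, hs.2⟩).1
    linarith [hH.A_pos 0]
  · have hb := (zetaF_bounds hH hk0 hkK hs.2).1
    have hprof : Real.exp (-(c / 2)) ≤ barrierProfile (A (k - 1)) (tk A c k) s := by
      unfold barrierProfile
      refine Real.exp_le_exp.2 ?_
      have h1 : tk A c (k + 1) ≤ max s (tk A c k) := hs.1.trans (le_max_left _ _)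
      have h2 : A (k + 1 - 2) * tk A c (k + 1) = -c := hH.A_mul_tk (k + 1)
      have h3 : k + 1 - 2 = k - 1 := by omega
      rw [h3] at h2
      have h4 : 0 ≤ A (k - 1) := (hH.A_pos _).le
      nlinarith
    have hhalf := hH.half_le_exp_neg_half_c
    have hA := (hH.A_pos k).le
    calc 1 / 2 * A k ≤ A k * Real.exp (-(c / 2)) := by nlinarith
      _ ≤ A k * barrierProfile (A (k - 1)) (tk A c k) s := mul_le_mul_of_nonneg_left hprof hA
      _ ≤ _ := hb

/-- **Every lower barrier `η_k` is continuous.** [cite: Palasek2026ElementaryModel, §3.1 Def. 3.1] -/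
theorem continuous_etaF (hH : BarrierHypotheses A δ μ0 c) (hK : 1 ≤ K) (k : ℕ) :
    Continuous (etaF A δ μ0 c K k) := by
  rcases Nat.eq_zero_or_pos k with rfl | hk0
  · have heq : etaF A δ μ0 c K 0 = fun _ => A 0 := funext fun t => etaF_zero t
    rw [heq]
    exact continuous_const
  · have heq : etaF A δ μ0 c K k = eta (A k) (zetaF A δ μ0 c K (k - 1)) := by
      funext t
      exact etaF_of_pos hk0 t
    rw [heq]
    exact continuous_eta_of_continuous _ (continuous_zetaF hH hK _)

/-- `η_k > 0`. [cite: Palasek2026ElementaryModel, §3.1 Def. 3.1] -/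
theorem etaF_pos (hH : BarrierHypotheses A δ μ0 c) (k : ℕ) (t : ℝ) : 0 < etaF A δ μ0 c K k t := by
  rcases Nat.eq_zero_or_pos k with rfl | hk0
  · rw [etaF_zero]
    exact hH.A_pos 0
  · rw [etaF_of_pos hk0]
    exact mul_pos (hH.A_pos k) (Real.exp_pos _)

/-- `η_k ≤ A_k` on `[-T, 0]`. [cite: Palasek2026ElementaryModel, §3.1 Def. 3.1] -/
theorem etaF_le (hH : BarrierHypotheses A δ μ0 c) (hK : 1 ≤ K) (k : ℕ) {t : ℝ}
    (ht : t ∈ Icc (-blowupT A c) 0) : etaF A δ μ0 c K k t ≤ A k := by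
  rcases Nat.eq_zero_or_pos k with rfl | hk0
  · rw [etaF_zero]
  · rw [etaF_of_pos hk0]
    exact eta_le (hH.A_pos k).le ht.2 fun s hs => zetaF_nonneg hH hK _ ⟨ht.1.trans hs.1, hs.2⟩

/-- **Lemma 3.2, (eta_quarter_bound), for the family**: `η_k ≥ ¾A_k` on `[t_{k+1}, 0]`
(`k ≤ K`). [cite: Palasek2026ElementaryModel, §3.1 Lemma 3.2 (eta_quarter_bound)] -/
theorem etaF_ge_three_quarters (hH : BarrierHypotheses A δ μ0 c) (hK : 1 ≤ K) {k : ℕ}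
    (hkK : k ≤ K) {t : ℝ} (ht : t ∈ Icc (tk A c (k + 1)) 0) :
    3 / 4 * A k ≤ etaF A δ μ0 c K k t := by
  have htT : -blowupT A c ≤ t := (hH.neg_blowupT_le_tk _).trans ht.1
  rcases Nat.eq_zero_or_pos k with rfl | hk0
  · rw [etaF_zero]
    linarith [hH.A_pos 0]
  · rw [etaF_of_pos hk0]
    have htk : -(c / A (k - 1)) ≤ t := by
      have h1 : tk A c (k + 1) = -(c / A (k + 1 - 2)) := rfl
      have h2 : k + 1 - 2 = k - 1 := by omega
      rw [h1, h2] at ht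
      exact ht.1
    refine eta_ge_three_quarters (hH.A_pos k).le (hH.A_pos (k - 1)) hH.exp_two_c ht.2 htk
      ((continuous_zetaF hH hK _).intervalIntegrable _ _) fun s hs => ?_
    have hsT : s ∈ Icc (-blowupT A c) 0 := ⟨htT.trans hs.1, hs.2⟩
    refine ⟨zetaF_nonneg hH hK _ hsT, ?_⟩
    rcases Nat.eq_zero_or_pos (k - 1) with h0 | h1
    · rw [h0]
      exact (zetaF_zero_bounds hH hK hsT).2
    · exact zetaF_le_two_mul hH h1 (by omega) hs.2

/-- The integral estimate behind (eta_global_bound): `∫_t^0 ζ_j ≤ 5A_j/A_{j-1}` on `[-T, 0]`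
(`1 ≤ j ≤ K`): `≤ 4A_j/A_{j-1}` from the part above `t_j` and `≤ A_j/A_{j-1}` (E1) from the frozen
part below `t_j`. [cite: Palasek2026ElementaryModel, §3.1 Lemma 3.2, proof of (eta_global_bound)] -/
theorem integral_zetaF_le (hH : BarrierHypotheses A δ μ0 c) {j : ℕ} (hj : 1 ≤ j) (hjK : j ≤ K)
    {t : ℝ} (ht : t ∈ Icc (-blowupT A c) 0) :
    ∫ s in t..0, zetaF A δ μ0 c K j s ≤ 5 * (A j / A (j - 1)) := by
  have hK : 1 ≤ K := hj.trans hjK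
  have hcont := continuous_zetaF hH hK j
  have hAp := hH.A_pos (j - 1)
  have hAj := hH.A_pos j
  have hratio : 0 ≤ A j / A (j - 1) := (div_pos hAj hAp).le
  -- the part above `max t t_j`
  have habove : ∀ t', t' ∈ Icc (tk A c j) 0 →
      ∫ s in t'..0, zetaF A δ μ0 c K j s ≤ 4 * (A j / A (j - 1)) := by
    intro t' ht'
    have hlam : 0 < A (j - 1) / 2 := by linarith
    calc ∫ s in t'..0, zetaF A δ μ0 c K j s
        ≤ ∫ s in t'..0, 2 * A j * Real.exp (A (j - 1) / 2 * s) := by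
          refine intervalIntegral.integral_mono_on ht'.2 (hcont.intervalIntegrable _ _)
            ((by fun_prop : Continuous fun s => 2 * A j * Real.exp (A (j - 1) / 2 * s)).intervalIntegrable
              _ _) fun s hs => ?_
          have hb := (zetaF_bounds hH hj hjK hs.2).2
          have hmax : max s (tk A c j) = s := max_eq_left (ht'.1.trans hs.1)
          simpa [barrierProfile, hmax] using hb
      _ = 2 * A j * ∫ s in t'..0, Real.exp (A (j - 1) / 2 * s) := by
          rw [intervalIntegral.integral_const_mul]
      _ ≤ 2 * A j * (1 / (A (j - 1) / 2)) :=
          mul_le_mul_of_nonneg_left (integral_exp_mul_le_inv hlam) (by linarith)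
      _ = 4 * (A j / A (j - 1)) := by
          field_simp
          ring
  by_cases hcase : tk A c j ≤ t
  · have h := habove t ⟨hcase, ht.2⟩
    linarith
  · rw [not_le] at hcase
    -- then `j ≥ 3` (for `j ≤ 2`, `t_j = -T ≤ t`)
    have hj3 : 3 ≤ j := by
      by_contra hlt
      rw [not_le] at hlt
      have := tk_of_le_two (A := A) (c := c) (show j ≤ 2 by omega)
      rw [this] at hcase
      linarith [ht.1]
    have hsplit : ∫ s in t..0, zetaF A δ μ0 c K j s =
        (∫ s in t..tk A c j, zetaF A δ μ0 c K j s) + ∫ s in tk A c j..0, zetaF A δ μ0 c K j s :=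
      (integral_add_adjacent_intervals (hcont.intervalIntegrable _ _)
        (hcont.intervalIntegrable _ _)).symm
    -- the frozen part
    have hfrozen : ∫ s in t..tk A c j, zetaF A δ μ0 c K j s ≤ A j / A (j - 1) := by
      set C := 2 * A j * Real.exp (A (j - 1) / 2 * tk A c j) with hC
      have hCnn : 0 ≤ C := by positivity
      calc ∫ s in t..tk A c j, zetaF A δ μ0 c K j s ≤ ∫ s in t..tk A c j, C := by
            refine intervalIntegral.integral_mono_on hcase.le (hcont.intervalIntegrable _ _)
              intervalIntegrable_const fun s hs => ?_
            have hb := (zetaF_bounds hH hj hjK (hs.2.trans (hH.tk_neg j).le)).2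
            have hmax : max s (tk A c j) = tk A c j := max_eq_right hs.2
            simpa [barrierProfile, hmax, hC] using hb
        _ = (tk A c j - t) * C := by
            rw [intervalIntegral.integral_const, smul_eq_mul]
        _ ≤ blowupT A c * C := by
            refine mul_le_mul_of_nonneg_right ?_ hCnn
            linarith [ht.1, hH.tk_neg j]
        _ = 2 * A j * blowupT A c * Real.exp (A (j - 1) / 2 * tk A c j) := by
            rw [hC]
            ring
        _ ≤ A j / A (j - 1) := hH.E1 j hj3
    have h2 := habove (tk A c j) ⟨le_rfl, (hH.tk_neg j).le⟩
    rw [hsplit]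
    linarith

/-- **Lemma 3.2, (eta_global_bound), for the family**: `η_k(t) ≥ A_k exp(-5A_{k-1}/A_{k-2})` on
`[-T, 0]`, `2 ≤ k ≤ K + 1`. [cite: Palasek2026ElementaryModel, §3.1 Lemma 3.2 (eta_global_bound)] -/
theorem etaF_ge_global (hH : BarrierHypotheses A δ μ0 c) {k : ℕ} (hk : 2 ≤ k) (hkK : k ≤ K + 1)
    {t : ℝ} (ht : t ∈ Icc (-blowupT A c) 0) :
    A k * Real.exp (-(5 * (A (k - 1) / A (k - 2)))) ≤ etaF A δ μ0 c K k t := by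
  have hk1 : 1 ≤ k := by omega
  rw [etaF_of_pos hk1]
  have h := integral_zetaF_le (K := K) hH (j := k - 1) (by omega) (by omega) ht
  have h2 : k - 1 - 1 = k - 2 := by omega
  rw [h2] at h
  exact eta_ge_of_integral_le (hH.A_pos k).le h

/-- **The rectangle `ℛ_K(t)` is non-empty: `η_k(t) ≤ ζ_k(t)`** on `[-T, 0]` (`k ≤ K`). On
`[t_k, 0]`, `ζ_{k-1} ≥ ½A_{k-1}` gives `η_k(t) ≤ A_k e^{½A_{k-1}t} ≤ ζ_k(t)`; below `t_k` both sides are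
compared with their values at `t_k` (`η_k` increases, `ζ_k` is frozen).
[cite: Palasek2026ElementaryModel, §3.1 Def. 3.1 and Lemma 3.2] -/
theorem etaF_le_zetaF (hH : BarrierHypotheses A δ μ0 c) (hK : 1 ≤ K) {k : ℕ} (hkK : k ≤ K)
    {t : ℝ} (ht : t ∈ Icc (-blowupT A c) 0) :
    etaF A δ μ0 c K k t ≤ zetaF A δ μ0 c K k t := by
  rcases Nat.eq_zero_or_pos k with rfl | hk0
  · rw [etaF_zero]
    exact (zetaF_zero_bounds hH hK ht).1
  rw [etaF_of_pos hk0]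
  set t' := max t (tk A c k) with ht'def
  have ht't : t ≤ t' := le_max_left _ _
  have ht'k : tk A c k ≤ t' := le_max_right _ _
  have ht'0 : t' ≤ 0 := max_le ht.2 (hH.tk_neg k).le
  have ht'T : -blowupT A c ≤ t' := ht.1.trans ht't
  have hcont := continuous_zetaF hH hK (k - 1)
  -- Step 1: `η_k(t) ≤ η_k(t')`
  have h1 : eta (A k) (zetaF A δ μ0 c K (k - 1)) t ≤ eta (A k) (zetaF A δ μ0 c K (k - 1)) t' :=
    eta_le_eta_of_le (hH.A_pos k).le hcont ht't fun r hr =>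
      zetaF_nonneg hH hK _ ⟨ht.1.trans hr.1, hr.2.trans ht'0⟩
  -- Step 2: `η_k(t') ≤ A_k e^{½A_{k-1}t'}`
  have hint : (0 - t') * (1 / 2 * A (k - 1)) ≤ ∫ r in t'..0, zetaF A δ μ0 c K (k - 1) r := by
    have hkk : k - 1 + 1 = k := by omega
    have := intervalIntegral.integral_mono_on ht'0
      (intervalIntegrable_const : IntervalIntegrable (fun _ : ℝ => 1 / 2 * A (k - 1)) volume t' 0)
      (hcont.intervalIntegrable _ _)
      (fun r hr => half_le_zetaF hH hK (k := k - 1) (by omega)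
        ⟨by rw [hkk]; exact ht'k.trans hr.1, hr.2⟩ (ht'T.trans hr.1))
    rwa [intervalIntegral.integral_const, smul_eq_mul] at this
  have h2 : eta (A k) (zetaF A δ μ0 c K (k - 1)) t' ≤ A k * Real.exp (A (k - 1) / 2 * t') := by
    unfold eta
    refine mul_le_mul_of_nonneg_left (Real.exp_le_exp.2 ?_) (hH.A_pos k).le
    linarith
  -- Step 3: `A_k e^{½A_{k-1}t'} ≤ ζ_k(t)`
  have h3 : A k * Real.exp (A (k - 1) / 2 * t') ≤ zetaF A δ μ0 c K k t :=
    (zetaF_bounds hH hk0 hkK ht.2).1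
  exact h1.trans (h2.trans h3)

/-- The barriers at the terminal time: `ζ_k(0) = A_k` (`k ≤ K`). [cite: Palasek2026ElementaryModel, §3.1 Def. 3.1] -/
theorem zetaF_at_zero (hH : BarrierHypotheses A δ μ0 c) (hK : 1 ≤ K) {k : ℕ} (hkK : k ≤ K) :
    zetaF A δ μ0 c K k 0 = A k := by
  rcases Nat.eq_zero_or_pos k with rfl | hk0
  · rw [zetaF_zero hK]
    simp [zetaZero]
  rcases hkK.lt_or_eq with hlt | heq
  · rw [zetaF_of_pos_of_lt hk0 hlt]
    simp [zetaMid, duhamelTerm, max_eq_left (hH.tk_neg k).le]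
  · subst heq
    rw [zetaF_of_le le_rfl]
    simp [zetaTop, barrierProfile, max_eq_left (hH.tk_neg k).le]

/-- `η_k(0) = A_k`. [cite: Palasek2026ElementaryModel, §3.1 Def. 3.1] -/
theorem etaF_at_zero (k : ℕ) : etaF A δ μ0 c K k 0 = A k := by
  rcases Nat.eq_zero_or_pos k with rfl | hk0
  · exact etaF_zero 0
  · rw [etaF_of_pos hk0]
    simp [eta]

end Family

/-! ### Right derivatives of the barrier family -/

section Derivatives

variable {A δ : ℕ → ℝ} {μ0 c : ℝ} {K : ℕ}

/-- **The right derivative of `ζ_k` at `t`** (value of the piecewise ODE of Def. 3.1 from the right: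
`0` below `t_k`, `½A_{k-1}ζ_k - δ_kζ_{k+1}²1_{k≤K-1}` on `[t_k, 0)`, `-μ₀ζ₀ - δ₀ζ₁²` for `k = 0`).
[cite: Palasek2026ElementaryModel, §3.1 Def. 3.1] -/
noncomputable def zetaFDeriv (A δ : ℕ → ℝ) (μ0 c : ℝ) (K k : ℕ) (t : ℝ) : ℝ :=
  if K ≤ k then (if tk A c K ≤ t then A (K - 1) / 2 * zetaF A δ μ0 c K k t else 0)
  else if k = 0 then -μ0 * zetaF A δ μ0 c K 0 t - δ 0 * zetaF A δ μ0 c K 1 t ^ 2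
  else if tk A c k ≤ t then
    A (k - 1) / 2 * zetaF A δ μ0 c K k t - δ k * zetaF A δ μ0 c K (k + 1) t ^ 2
  else 0

/-- **The derivative of `η_k` at `t`**: `ζ_{k-1}η_k` (`0` for `k = 0`). [cite: Palasek2026ElementaryModel, §3.1 Def. 3.1] -/
noncomputable def etaFDeriv (A δ : ℕ → ℝ) (μ0 c : ℝ) (K k : ℕ) (t : ℝ) : ℝ :=
  if k = 0 then 0 else zetaF A δ μ0 c K (k - 1) t * etaF A δ μ0 c K k t

/-- **Every `ζ_k` has the right derivative `zetaFDeriv` at every `t`** (incl. the kinks `t_k`).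
[cite: Palasek2026ElementaryModel, §3.1 Def. 3.1] -/
theorem hasDerivWithinAt_zetaF (hH : BarrierHypotheses A δ μ0 c) (hK : 1 ≤ K) (k : ℕ) (t : ℝ) :
    HasDerivWithinAt (zetaF A δ μ0 c K k) (zetaFDeriv A δ μ0 c K k t) (Ici t) t := by
  unfold zetaFDeriv
  by_cases hk : K ≤ k
  · rw [if_pos hk, zetaF_of_le hk]
    by_cases ht : tk A c K ≤ t
    · rw [if_pos ht]
      exact hasDerivWithinAt_zetaTop_Ici_of_le ht
    · rw [if_neg ht]
      exact hasDerivWithinAt_zetaTop_Ici_of_lt (not_le.mp ht)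
  rw [if_neg hk]
  by_cases hk0 : k = 0
  · subst hk0
    rw [if_pos rfl, zetaF_zero hK]
    exact (hasDerivAt_zetaZero_of_continuous _ _ _ (continuous_zetaF hH hK 1) t).hasDerivWithinAt
  rw [if_neg hk0, zetaF_of_pos_of_lt (Nat.pos_of_ne_zero hk0) (not_le.mp hk)]
  by_cases ht : tk A c k ≤ t
  · rw [if_pos ht]
    exact hasDerivWithinAt_zetaMid_Ici_of_le (continuous_zetaF hH hK (k + 1)) ht
  · rw [if_neg ht]
    exact hasDerivWithinAt_zetaMid_Ici_of_lt (not_le.mp ht)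

/-- **Every `η_k` has the derivative `etaFDeriv`.** [cite: Palasek2026ElementaryModel, §3.1 Def. 3.1] -/
theorem hasDerivWithinAt_etaF (hH : BarrierHypotheses A δ μ0 c) (hK : 1 ≤ K) (k : ℕ) (t : ℝ) :
    HasDerivWithinAt (etaF A δ μ0 c K k) (etaFDeriv A δ μ0 c K k t) (Ici t) t := by
  unfold etaFDeriv
  rcases Nat.eq_zero_or_pos k with rfl | hk0
  · rw [if_pos rfl]
    have heq : etaF A δ μ0 c K 0 = fun _ => A 0 := funext fun t => etaF_zero t
    rw [heq]
    exact (hasDerivAt_const t _).hasDerivWithinAt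
  · rw [if_neg (by omega)]
    have heq : etaF A δ μ0 c K k = eta (A k) (zetaF A δ μ0 c K (k - 1)) :=
      funext fun t => etaF_of_pos hk0 t
    rw [heq]
    exact (hasDerivAt_eta_of_continuous _ (continuous_zetaF hH hK _) t).hasDerivWithinAt

end Derivatives

/-! ### The truncated system (truncated_viscous) -/

/-- Extension by zero of a state vector on the modes `0, …, K` to all modes (the conventions
`x_{K+1} ≡ 0` of the truncation and, below, `x_{-1} ≡ 0`). [cite: Palasek2026ElementaryModel, §3.2 (truncated_inviscid), §3.3 (truncated_viscous)] -/
def extendFin (K : ℕ) (y : Fin (K + 1) → ℝ) (n : ℕ) : ℝ :=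
  if h : n < K + 1 then y ⟨n, h⟩ else 0

/-- Retained modes. [cite: Palasek2026ElementaryModel, §3.3 (truncated_viscous)] -/
theorem extendFin_of_lt {K : ℕ} (y : Fin (K + 1) → ℝ) {n : ℕ} (h : n < K + 1) :
    extendFin K y n = y ⟨n, h⟩ :=
  dif_pos h

/-- Dropped modes. [cite: Palasek2026ElementaryModel, §3.3 (truncated_viscous)] -/
theorem extendFin_of_gt {K : ℕ} (y : Fin (K + 1) → ℝ) {n : ℕ} (h : K < n) : extendFin K y n = 0 :=
  dif_neg (by omega)

/-- **The right-hand side of the truncated viscous system (truncated_viscous)** in the rescaled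
unknowns, at mode `n`, for an `ℕ`-indexed state `z` (`z_{-1} ≡ 0`):
`-visc_n(t) z_n + z_{n-1} z_n - δ_n z_{n+1}²`, where `visc_n(t) = ρ_n(t) ν N_n²`; on a truncated
state (`z_m = 0` for `m > K`) the last term vanishes at `n = K` as printed.
[cite: Palasek2026ElementaryModel, §3.3 (truncated_viscous)] -/
noncomputable def truncRHS (δ : ℕ → ℝ) (visc : ℕ → ℝ → ℝ) (t : ℝ) (z : ℕ → ℝ) (n : ℕ) : ℝ :=
  -(visc n t * z n) + (if n = 0 then 0 else z (n - 1) * z n) - δ n * z (n + 1) ^ 2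

/-- The truncated system as a vector field on `ℝ^{K+1}`. [cite: Palasek2026ElementaryModel, §3.3 (truncated_viscous)] -/
noncomputable def truncField (δ : ℕ → ℝ) (visc : ℕ → ℝ → ℝ) (K : ℕ) (t : ℝ)
    (y : Fin (K + 1) → ℝ) (i : Fin (K + 1)) : ℝ :=
  truncRHS δ visc t (extendFin K y) i

/-- Coordinates of the extension are smooth in the state. [folklore] -/
private theorem contDiff_extendFin_snd (K n : ℕ) {m : WithTop ℕ∞} :
    ContDiff ℝ m fun p : ℝ × (Fin (K + 1) → ℝ) => extendFin K p.2 n := by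
  by_cases h : n < K + 1
  · simp_rw [extendFin, dif_pos h]
    exact (ContinuousLinearMap.proj (R := ℝ) (φ := fun _ : Fin (K + 1) => ℝ) ⟨n, h⟩).contDiff.comp
      contDiff_snd
  · simp_rw [extendFin, dif_neg h]
    exact contDiff_const

/-- **The truncated field is `C¹` jointly in `(t, x)`** when the viscous coefficients are `C¹` in `t`
(it is polynomial in `x`). [cite: Palasek2026ElementaryModel, §3.3 ("standard ODE theory")] -/
theorem contDiff_truncField {δ : ℕ → ℝ} {visc : ℕ → ℝ → ℝ} (hvisc : ∀ n, ContDiff ℝ 1 (visc n))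
    (K : ℕ) : ContDiff ℝ 1 (Function.uncurry (truncField δ visc K)) := by
  rw [contDiff_pi]
  intro i
  have hv : ContDiff ℝ 1 fun p : ℝ × (Fin (K + 1) → ℝ) => visc i p.1 :=
    (hvisc i).comp contDiff_fst
  have he : ∀ n, ContDiff ℝ 1 fun p : ℝ × (Fin (K + 1) → ℝ) => extendFin K p.2 n :=
    fun n => contDiff_extendFin_snd K n
  have heq : (fun p : ℝ × (Fin (K + 1) → ℝ) => Function.uncurry (truncField δ visc K) p i) =
      fun p => -(visc i p.1 * extendFin K p.2 i) +
        (if (i : ℕ) = 0 then 0 else extendFin K p.2 (i - 1) * extendFin K p.2 i) -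
          δ i * extendFin K p.2 (i + 1) ^ 2 := rfl
  rw [heq]
  by_cases h0 : (i : ℕ) = 0
  · simp only [if_pos h0, add_zero]
    exact (hv.mul (he i)).neg.sub (contDiff_const.mul ((he (i + 1)).pow 2))
  · simp only [if_neg h0]
    exact ((hv.mul (he i)).neg.add ((he (i - 1)).mul (he i))).sub
      (contDiff_const.mul ((he (i + 1)).pow 2))

/-! ### The two face inequalities of the proof of Prop. 3.3 / 3.4 -/

section Faces

variable {A δ : ℕ → ℝ} {μ0 c : ℝ} {K : ℕ} {visc : ℕ → ℝ → ℝ}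

/-- **Upper faces: `x_k' ≥ ζ_k'` when `x ∈ ℛ_K(t)` and `x_k = ζ_k(t)`** (p. 9, second bullet, with
the viscous modification of p. 10: `η_{k-1} - ρ_kN_k² ≥ ¾A_{k-1} - ¼A_{k-1} = ½A_{k-1}` on `[t_k, 0)`;
below `t_k` (`k ≥ 3`) the viscosity is off and `x_{k-1}x_k ≥ δ_kx_{k+1}²` is condition S4).
[cite: Palasek2026ElementaryModel, §3.2 proof of Prop. 3.3; §3.3 proof of Prop. 3.4] -/
theorem zetaFDeriv_le_truncRHS (hH : BarrierHypotheses A δ μ0 c) (hK : 1 ≤ K)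
    (hv0 : ∀ t, visc 0 t = μ0) (hv_le : ∀ n, 1 ≤ n → ∀ t, visc n t ≤ A (n - 1) / 4)
    (hv_off : ∀ n, 3 ≤ n → ∀ t, t < tk A c n → visc n t = 0)
    {t : ℝ} (ht : t ∈ Ico (-blowupT A c) 0) {z : ℕ → ℝ}
    (hz : ∀ n ≤ K, etaF A δ μ0 c K n t ≤ z n ∧ z n ≤ zetaF A δ μ0 c K n t)
    (hz0 : ∀ n, K < n → z n = 0) {n : ℕ} (hn : n ≤ K) (hface : z n = zetaF A δ μ0 c K n t) :
    zetaFDeriv A δ μ0 c K n t ≤ truncRHS δ visc t z n := by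
  have ht' : t ∈ Icc (-blowupT A c) 0 := ⟨ht.1, ht.2.le⟩
  have hz_nn : ∀ m, 0 ≤ z m := fun m => by
    rcases le_or_gt m K with hm | hm
    · exact (etaF_pos hH m t).le.trans (hz m hm).1
    · rw [hz0 m hm]
  have hζn : 0 ≤ zetaF A δ μ0 c K n t := zetaF_nonneg hH hK n ht'
  unfold zetaFDeriv truncRHS
  rcases Nat.eq_zero_or_pos n with rfl | hn0
  · -- mode `0`: `ζ₀' = -μ₀ζ₀ - δ₀ζ₁² ≤ -μ₀ζ₀ - δ₀z₁²`
    rw [if_neg (by omega), if_pos rfl, if_pos rfl, hv0 t, hface]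
    have h1 : z 1 ^ 2 ≤ zetaF A δ μ0 c K 1 t ^ 2 := pow_le_pow_left₀ (hz_nn 1) (hz 1 hK).2 2
    have hδ := hH.δ_nonneg 0
    nlinarith
  rw [if_neg (show n ≠ 0 by omega), if_neg (show n ≠ 0 by omega)]
  -- `x_{n-1} ≥ η_{n-1} ≥ ¾A_{n-1}` on `[t_n, 0)`
  have hprev : tk A c n ≤ t → 3 / 4 * A (n - 1) ≤ z (n - 1) := fun htn =>
    (etaF_ge_three_quarters hH hK (k := n - 1) (by omega)
      ⟨by rw [show n - 1 + 1 = n by omega]; exact htn, ht.2.le⟩).trans (hz (n - 1) (by omega)).1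
  by_cases hKn : K ≤ n
  · -- the top mode `n = K`
    have hnK : n = K := le_antisymm hn hKn
    rw [if_pos hKn, hz0 (n + 1) (by omega), show K - 1 = n - 1 by omega,
      show tk A c K = tk A c n by rw [hnK]]
    by_cases htn : tk A c n ≤ t
    · rw [if_pos htn, hface]
      have h1 := mul_nonneg (sub_nonneg.2 (hprev htn)) hζn
      have h2 := mul_nonneg (sub_nonneg.2 (hv_le n hn0 t)) hζn
      nlinarith
    · rw [if_neg htn]
      have htn' : t < tk A c n := not_le.mp htn
      have hn3 : 3 ≤ n := by
        by_contra hlt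
        rw [not_le] at hlt
        have := tk_of_le_two (A := A) (c := c) (show n ≤ 2 by omega)
        rw [this] at htn'
        linarith [ht.1]
      rw [hv_off n hn3 t htn', hface]
      have := mul_nonneg (hz_nn (n - 1)) hζn
      nlinarith
  · -- the middle modes `1 ≤ n ≤ K - 1`
    rw [if_neg hKn]
    have hn1K : n + 1 ≤ K := by omega
    have hsq : z (n + 1) ^ 2 ≤ zetaF A δ μ0 c K (n + 1) t ^ 2 :=
      pow_le_pow_left₀ (hz_nn _) (hz (n + 1) hn1K).2 2
    by_cases htn : tk A c n ≤ t
    · rw [if_pos htn, hface]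
      have h1 := mul_nonneg (sub_nonneg.2 (hprev htn)) hζn
      have h2 := mul_nonneg (sub_nonneg.2 (hv_le n hn0 t)) hζn
      have h3 := mul_le_mul_of_nonneg_left hsq (hH.δ_nonneg n)
      nlinarith
    · rw [if_neg htn]
      have htn' : t < tk A c n := not_le.mp htn
      have hn3 : 3 ≤ n := by
        by_contra hlt
        rw [not_le] at hlt
        have := tk_of_le_two (A := A) (c := c) (show n ≤ 2 by omega)
        rw [this] at htn'
        linarith [ht.1]
      rw [hv_off n hn3 t htn', hface]
      -- lower bounds for `x_{n-1}` and `ζ_n`, upper bound for `x_{n+1}`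
      have hη : A (n - 1) * Real.exp (-(5 * (A (n - 1 - 1) / A (n - 1 - 2)))) ≤ z (n - 1) :=
        (etaF_ge_global hH (k := n - 1) (by omega) (by omega) ht').trans (hz (n - 1) (by omega)).1
      rw [show n - 1 - 1 = n - 2 by omega, show n - 1 - 2 = n - 3 by omega] at hη
      have hζ : A n * Real.exp (A (n - 1) / 2 * tk A c n) ≤ zetaF A δ μ0 c K n t := by
        have hb := (zetaF_bounds hH hn0 hn ht.2.le).1
        rwa [barrierProfile, max_eq_right htn'.le] at hb
      have hζ1 : zetaF A δ μ0 c K (n + 1) t ≤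
          2 * A (n + 1) * Real.exp (A n / 2 * tk A c (n + 1)) := by
        have hb := (zetaF_bounds hH (k := n + 1) (by omega) hn1K ht.2.le).2
        have hmax : max t (tk A c (n + 1)) = tk A c (n + 1) :=
          max_eq_right (htn'.le.trans (hH.tk_le_tk_succ n))
        rwa [barrierProfile, hmax, show n + 1 - 1 = n by omega] at hb
      have hz1sq : z (n + 1) ^ 2 ≤ 4 * A (n + 1) ^ 2 * Real.exp (A n * tk A c (n + 1)) := by
        have h1 : z (n + 1) ≤ 2 * A (n + 1) * Real.exp (A n / 2 * tk A c (n + 1)) :=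
          (hz (n + 1) hn1K).2.trans hζ1
        have h2 := pow_le_pow_left₀ (hz_nn (n + 1)) h1 2
        have h3 : (2 * A (n + 1) * Real.exp (A n / 2 * tk A c (n + 1))) ^ 2 =
            4 * A (n + 1) ^ 2 * Real.exp (A n * tk A c (n + 1)) := by
          rw [mul_pow, mul_pow, ← Real.exp_nat_mul]
          ring_nf
        rwa [h3] at h2
      have hexp : Real.exp (A (n - 1) / 2 * tk A c n - 5 * (A (n - 2) / A (n - 3))) =
          Real.exp (A (n - 1) / 2 * tk A c n) * Real.exp (-(5 * (A (n - 2) / A (n - 3)))) := by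
        rw [← Real.exp_add]
        ring_nf
      have hprod : A (n - 1) * A n *
          Real.exp (A (n - 1) / 2 * tk A c n - 5 * (A (n - 2) / A (n - 3))) ≤
            z (n - 1) * zetaF A δ μ0 c K n t := by
        rw [hexp]
        have hre : A (n - 1) * A n * (Real.exp (A (n - 1) / 2 * tk A c n) *
            Real.exp (-(5 * (A (n - 2) / A (n - 3))))) =
            (A (n - 1) * Real.exp (-(5 * (A (n - 2) / A (n - 3))))) *
              (A n * Real.exp (A (n - 1) / 2 * tk A c n)) := by ring
        rw [hre]
        exact mul_le_mul hη hζ (mul_pos (hH.A_pos n) (Real.exp_pos _)).le (hz_nn _)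
      have hS4 := hH.S4 n hn3
      have hδz : δ n * z (n + 1) ^ 2 ≤ δ n * (4 * A (n + 1) ^ 2 * Real.exp (A n * tk A c (n + 1))) :=
        mul_le_mul_of_nonneg_left hz1sq (hH.δ_nonneg n)
      nlinarith

/-- **Lower faces: `x_k' ≤ η_k'` when `x ∈ ℛ_K(t)` and `x_k = η_k(t)`** ("immediate from the
definition", p. 9: `x_k' ≤ x_{k-1}x_k ≤ ζ_{k-1}η_k = η_k'`). [cite: Palasek2026ElementaryModel, §3.2 proof of Prop. 3.3] -/
theorem truncRHS_le_etaFDeriv (hH : BarrierHypotheses A δ μ0 c) (hv0 : ∀ t, visc 0 t = μ0)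
    (hv_nn : ∀ n t, 0 ≤ visc n t) {t : ℝ} {z : ℕ → ℝ}
    (hz : ∀ n ≤ K, etaF A δ μ0 c K n t ≤ z n ∧ z n ≤ zetaF A δ μ0 c K n t)
    (hz0 : ∀ n, K < n → z n = 0) {n : ℕ} (hn : n ≤ K) (hface : z n = etaF A δ μ0 c K n t) :
    truncRHS δ visc t z n ≤ etaFDeriv A δ μ0 c K n t := by
  have hz_nn : ∀ m, 0 ≤ z m := fun m => by
    rcases le_or_gt m K with hm | hm
    · exact (etaF_pos hH m t).le.trans (hz m hm).1
    · rw [hz0 m hm]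
  unfold truncRHS etaFDeriv
  rcases Nat.eq_zero_or_pos n with rfl | hn0
  · rw [if_pos rfl, if_pos rfl, hv0 t, hface, etaF_zero]
    have h1 := hH.μ0_nonneg
    have h2 := hH.A_pos 0
    have h3 := hH.δ_nonneg 0
    nlinarith [sq_nonneg (z 1)]
  · rw [if_neg (by omega), if_neg (by omega), hface]
    have hη : 0 ≤ etaF A δ μ0 c K n t := (etaF_pos hH n t).le
    have h1 : z (n - 1) ≤ zetaF A δ μ0 c K (n - 1) t := (hz (n - 1) (by omega)).2
    have h2 := hv_nn n t
    have h3 := hH.δ_nonneg n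
    nlinarith [sq_nonneg (z (n + 1)), mul_le_mul_of_nonneg_right h1 hη, mul_nonneg h2 hη]

end Faces

/-! ### Proposition 3.4 (and 3.3): trapped solutions of the truncated system -/

section Trapping

variable {A δ : ℕ → ℝ} {μ0 c : ℝ} {K : ℕ} {visc : ℕ → ℝ → ℝ}

/-- **Palasek 2026, Proposition 3.4 (Prop. 3.3 for `visc ≡ 0`, `μ₀ = 0`): trapped truncated
solutions.** Under the parameter inequalities `BarrierHypotheses` and for viscous coefficients
`visc_k(t) = ρ_k(t)νN_k²` with `visc₀ ≡ μ₀`, `0 ≤ visc_k ≤ ¼A_{k-1}` (`β > 2b`, `N₀` large), switched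
off before `t_k` and `C¹` in `t`, the truncated system (truncated_viscous) with terminal data
`x_k(0) = A_k` (`k ≤ K`) has a solution on `[-T, 0]` (stated for the `ℕ`-indexed state extended by
zero beyond mode `K`) which stays in the rectangle `ℛ_K(t)`: `η_k(t) ≤ x_k(t) ≤ ζ_k(t)`
((stays_trapped_in_R)). [cite: Palasek2026ElementaryModel, §3.3 Prop. 3.4; §3.2 Prop. 3.3] -/
theorem exists_trapped_solution (hH : BarrierHypotheses A δ μ0 c)
    (hv0 : ∀ t, visc 0 t = μ0) (hv_nn : ∀ n t, 0 ≤ visc n t)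
    (hv_le : ∀ n, 1 ≤ n → ∀ t, visc n t ≤ A (n - 1) / 4)
    (hv_off : ∀ n, 3 ≤ n → ∀ t, t < tk A c n → visc n t = 0)
    (hv_smooth : ∀ n, ContDiff ℝ 1 (visc n)) (hK : 1 ≤ K) :
    ∃ x : ℝ → ℕ → ℝ,
      (∀ n, x 0 n = if n ≤ K then A n else 0) ∧
      (∀ t n, K < n → x t n = 0) ∧
      (∀ n ≤ K, ∀ t ∈ Icc (-blowupT A c) 0,
        HasDerivWithinAt (fun s => x s n) (truncRHS δ visc t (x t) n) (Icc (-blowupT A c) 0) t) ∧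
      ∀ n ≤ K, ∀ t ∈ Icc (-blowupT A c) 0,
        etaF A δ μ0 c K n t ≤ x t n ∧ x t n ≤ zetaF A δ μ0 c K n t := by
  have hT := hH.blowupT_pos
  -- box membership of the extended state
  have hzbox : ∀ t (y : Fin (K + 1) → ℝ),
      y ∈ Icc (fun i : Fin (K + 1) => etaF A δ μ0 c K i t) (fun i => zetaF A δ μ0 c K i t) →
        (∀ n ≤ K, etaF A δ μ0 c K n t ≤ extendFin K y n ∧ extendFin K y n ≤ zetaF A δ μ0 c K n t) ∧
          ∀ n, K < n → extendFin K y n = 0 := by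
    intro t y hy
    refine ⟨fun n hn => ?_, fun n hn => extendFin_of_gt y hn⟩
    have h : n < K + 1 := by omega
    rw [extendFin_of_lt y h]
    exact ⟨hy.1 ⟨n, h⟩, hy.2 ⟨n, h⟩⟩
  obtain ⟨x, hxb, hxd, hxm⟩ :=
    Literature.Analysis.ODE.exists_solution_mem_Icc_of_face_backward_of_contDiff
      (F := truncField δ visc K)
      (ℓ := fun t i => etaF A δ μ0 c K i t) (u := fun t i => zetaF A δ μ0 c K i t)
      (ℓ' := fun t i => etaFDeriv A δ μ0 c K i t) (u' := fun t i => zetaFDeriv A δ μ0 c K i t)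
      (a := -blowupT A c) (b := 0) (xb := fun i => A i)
      (contDiff_truncField hv_smooth K)
      ((continuous_pi fun i : Fin (K + 1) => continuous_etaF hH hK i).continuousOn)
      ((continuous_pi fun i : Fin (K + 1) => continuous_zetaF hH hK i).continuousOn)
      (fun t ht => Pi.le_def.mpr fun i => etaF_le_zetaF hH hK (Nat.lt_succ_iff.mp i.2) ht)
      (fun t _ => hasDerivWithinAt_pi.2 fun i => hasDerivWithinAt_etaF hH hK i t)
      (fun t _ => hasDerivWithinAt_pi.2 fun i => hasDerivWithinAt_zetaF hH hK i t)
      (fun t ht y hy i hi => by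
        obtain ⟨hz, hz0⟩ := hzbox t y hy
        have hface : extendFin K y i = zetaF A δ μ0 c K i t := by
          rw [extendFin_of_lt y i.2]
          exact hi
        exact zetaFDeriv_le_truncRHS hH hK hv0 hv_le hv_off ht hz hz0 (Nat.lt_succ_iff.mp i.2)
          hface)
      (fun t ht y hy i hi => by
        obtain ⟨hz, hz0⟩ := hzbox t y hy
        have hface : extendFin K y i = etaF A δ μ0 c K i t := by
          rw [extendFin_of_lt y i.2]
          exact hi
        exact truncRHS_le_etaFDeriv hH hv0 hv_nn hz hz0 (Nat.lt_succ_iff.mp i.2) hface)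
      (by linarith)
      ⟨Pi.le_def.mpr fun i => (etaF_at_zero (A := A) (δ := δ) (μ0 := μ0) (c := c) (K := K)
          (i : ℕ)).le,
        Pi.le_def.mpr fun i => (zetaF_at_zero hH hK (Nat.lt_succ_iff.mp i.2)).ge⟩
  refine ⟨fun t n => extendFin K (x t) n, fun n => ?_, fun t n hn => extendFin_of_gt _ hn,
    fun n hn t ht => ?_, fun n hn t ht => (hzbox t (x t) (hxm t ht)).1 n hn⟩
  · -- terminal data
    show extendFin K (x 0) n = if n ≤ K then A n else 0
    by_cases h : n < K + 1
    · rw [extendFin_of_lt _ h, hxb, if_pos (by omega)]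
    · rw [extendFin_of_gt _ (by omega), if_neg (by omega)]
  · -- the equation for mode `n ≤ K`
    show HasDerivWithinAt (fun s => extendFin K (x s) n) (truncRHS δ visc t (extendFin K (x t)) n)
      (Icc (-blowupT A c) 0) t
    have h : n < K + 1 := by omega
    have hd := (hasDerivWithinAt_pi.1 (hxd t ht)) ⟨n, h⟩
    have heq : (fun s => extendFin K (x s) n) = fun s => x s ⟨n, h⟩ :=
      funext fun s => extendFin_of_lt _ h
    rw [heq]
    exact hd

/-- **Proposition 3.4 with the bounds (uniform_truncated_bounds_viscous) and the lower bounds of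
Lemma 3.2**, uniform in the truncation order `K`: `A₀ ≤ x₀ ≤ 2A₀`;
`0 < x_k(t) ≤ 2A_k exp(½A_{k-1}max{t,t_k})`; `x_k ≥ ¾A_k` on `[t_{k+1}, 0]`;
`x_k ≥ A_k exp(-5A_{k-1}/A_{k-2})` (`k ≥ 2`). [cite: Palasek2026ElementaryModel, §3.3 Prop. 3.4 (uniform_truncated_bounds_viscous); §3.1 Lemma 3.2] -/
theorem exists_trapped_solution_bounds (hH : BarrierHypotheses A δ μ0 c)
    (hv0 : ∀ t, visc 0 t = μ0) (hv_nn : ∀ n t, 0 ≤ visc n t)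
    (hv_le : ∀ n, 1 ≤ n → ∀ t, visc n t ≤ A (n - 1) / 4)
    (hv_off : ∀ n, 3 ≤ n → ∀ t, t < tk A c n → visc n t = 0)
    (hv_smooth : ∀ n, ContDiff ℝ 1 (visc n)) (hK : 1 ≤ K) :
    ∃ x : ℝ → ℕ → ℝ,
      (∀ n, x 0 n = if n ≤ K then A n else 0) ∧
      (∀ t n, K < n → x t n = 0) ∧
      (∀ n ≤ K, ∀ t ∈ Icc (-blowupT A c) 0,
        HasDerivWithinAt (fun s => x s n) (truncRHS δ visc t (x t) n) (Icc (-blowupT A c) 0) t) ∧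
      (∀ t ∈ Icc (-blowupT A c) 0, A 0 ≤ x t 0 ∧ x t 0 ≤ 2 * A 0) ∧
      (∀ n, 1 ≤ n → n ≤ K → ∀ t ∈ Icc (-blowupT A c) 0,
        0 < x t n ∧ x t n ≤ 2 * A n * Real.exp (A (n - 1) / 2 * max t (tk A c n))) ∧
      (∀ n, 1 ≤ n → n ≤ K → ∀ t ∈ Icc (tk A c (n + 1)) 0, 3 / 4 * A n ≤ x t n) ∧
      ∀ n, 2 ≤ n → n ≤ K → ∀ t ∈ Icc (-blowupT A c) 0,
        A n * Real.exp (-(5 * (A (n - 1) / A (n - 2)))) ≤ x t n := by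
  obtain ⟨x, h0, hoff, hode, hbox⟩ :=
    exists_trapped_solution hH hv0 hv_nn hv_le hv_off hv_smooth hK
  refine ⟨x, h0, hoff, hode, fun t ht => ?_, fun n hn1 hnK t ht => ?_, fun n hn1 hnK t ht => ?_,
    fun n hn2 hnK t ht => ?_⟩
  · have hb := hbox 0 (by omega) t ht
    have hz := zetaF_zero_bounds hH hK ht
    rw [etaF_zero] at hb
    exact ⟨hb.1, hb.2.trans hz.2⟩
  · have hb := hbox n hnK t ht
    refine ⟨(etaF_pos hH n t).trans_le hb.1, hb.2.trans ?_⟩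
    exact (zetaF_bounds hH hn1 hnK ht.2).2
  · have htT : t ∈ Icc (-blowupT A c) 0 := ⟨(hH.neg_blowupT_le_tk _).trans ht.1, ht.2⟩
    exact (etaF_ge_three_quarters hH hK hnK ht).trans (hbox n hnK t htT).1
  · exact (etaF_ge_global hH hn2 (by omega) ht).trans (hbox n hnK t ht).1

end Trapping

end PalasekObukhov

end Literature.Analysis.FluidPDE

/-!
## Part 2 (Limit).
Palasek 2026, §3.2–§3.3: the limit `K → ∞` of the trapped truncations

S. Palasek, arXiv:2605.13827 (2026), §3, proof of Theorems 1.8/1.3, first paragraph (p. 10): "By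
diagonalization and Arzelà–Ascoli, one can pass to a subsequence that converges … for each `k`.
Because the system is local in `k` … the limit `x_k` obeys (x_system_nondimensionalized) with
`x_k(0) = A_k`", and it inherits the uniform bounds (uniform_truncated_bounds_viscous). This file is
the fourth block of the discharge of `Literature.Analysis.FluidPDE.Palasek2026_viscousBlowup`
(plan: cell `pub/ns-blowup`, `lit/PALASEK-FORMALISATION.md` §5): it feeds the trapped truncated
solutions of `PalasekObukhovTrapping` (`exists_trapped_solution_bounds`, Prop. 3.4) into the
abstract compactness theorem `Literature.Analysis.ODE.exists_subseq_tendsto_solution_of_truncations`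
(Deimling 1977, Thm 7.5). All statements are PROVED; there are no new named facts.

## Main results

* `continuous_truncRHS`: the right-hand side (truncated_viscous) is jointly continuous for the
  product topology on `ℝ × ℝ^ℕ` (it is local in `k`).
* `exists_limit_solution`: under `BarrierHypotheses` and the four hypotheses on the viscous
  coefficients, the full (untruncated, cut-off viscous) system
  `x_k' = -visc_k(t) x_k + x_{k-1}x_k - δ_k x_{k+1}²` (`k ≥ 0`, `x_{-1} ≡ 0`) has a solution on
  `[-T, 0]` with `x_k(0) = A_k` for every `k` and the bounds `A₀ ≤ x₀ ≤ 2A₀`,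
  `0 ≤ x_k(t) ≤ 2A_k exp(½A_{k-1}max{t,t_k})`, `x_k ≥ ¾A_k` on `[t_{k+1},0]`,
  `x_k ≥ A_k exp(-5A_{k-1}/A_{k-2})` (`k ≥ 2`).
-/

open Set Filter Topology

namespace Literature.Analysis.FluidPDE

namespace PalasekObukhov

variable {A δ : ℕ → ℝ} {μ0 c : ℝ} {visc : ℕ → ℝ → ℝ}

/-- **The field (truncated_viscous) is continuous for the product topology** (it depends on the
coordinates `k-1, k, k+1` only). [cite: Palasek2026ElementaryModel, §3.2 ("the system is local in k")] -/
theorem continuous_truncRHS (hvisc : ∀ n, Continuous (visc n)) (i : ℕ) :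
    Continuous fun p : ℝ × (ℕ → ℝ) => truncRHS δ visc p.1 p.2 i := by
  have hev : ∀ m, Continuous fun p : ℝ × (ℕ → ℝ) => p.2 m := fun m =>
    (continuous_apply m).comp continuous_snd
  have hv : Continuous fun p : ℝ × (ℕ → ℝ) => visc i p.1 := (hvisc i).comp continuous_fst
  have heq : (fun p : ℝ × (ℕ → ℝ) => truncRHS δ visc p.1 p.2 i) =
      fun p => -(visc i p.1 * p.2 i) + (if i = 0 then 0 else p.2 (i - 1) * p.2 i) -
        δ i * p.2 (i + 1) ^ 2 := rfl
  rw [heq]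
  by_cases h0 : i = 0
  · simp only [if_pos h0, add_zero]
    exact (hv.mul (hev i)).neg.sub (continuous_const.mul ((hev (i + 1)).pow 2))
  · simp only [if_neg h0]
    exact ((hv.mul (hev i)).neg.add ((hev (i - 1)).mul (hev i))).sub
      (continuous_const.mul ((hev (i + 1)).pow 2))

/-- **Palasek 2026, proof of Thm 1.3/1.8, the limit `K → ∞`** (p. 10, first paragraph, with the
viscous cut-offs of §3.3): the cut-off viscous system in the rescaled unknowns,
`x_k' = -visc_k(t) x_k + x_{k-1} x_k - δ_k x_{k+1}²` for ALL `k ≥ 0` (`x_{-1} ≡ 0`), has a solution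
on `[-T, 0]` with terminal values `x_k(0) = A_k` which obeys the bounds (sol_bounds)
`A₀ ≤ x₀ ≤ 2A₀`, `0 ≤ x_k(t) ≤ 2A_k exp(½A_{k-1}max{t,t_k})` and the lower bounds inherited from the
trapping region, `x_k ≥ ¾A_k` on `[t_{k+1}, 0]`, `x_k ≥ A_k exp(-5A_{k-1}/A_{k-2})` (`k ≥ 2`).
Obtained from Prop. 3.4 (`exists_trapped_solution_bounds`) by the diagonal compactness argument
(`Literature.Analysis.ODE.exists_subseq_tendsto_solution_of_truncations`).
[cite: Palasek2026ElementaryModel, §3.2 proof of Thm 1.8 (p. 10); §3.3 proof of Thm 1.3 (sol_bounds)] -/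
theorem exists_limit_solution (hH : BarrierHypotheses A δ μ0 c)
    (hv0 : ∀ t, visc 0 t = μ0) (hv_nn : ∀ n t, 0 ≤ visc n t)
    (hv_le : ∀ n, 1 ≤ n → ∀ t, visc n t ≤ A (n - 1) / 4)
    (hv_off : ∀ n, 3 ≤ n → ∀ t, t < tk A c n → visc n t = 0)
    (hv_smooth : ∀ n, ContDiff ℝ 1 (visc n)) :
    ∃ x : ℝ → ℕ → ℝ,
      (∀ n, x 0 n = A n) ∧
      (∀ n, ∀ t ∈ Icc (-blowupT A c) 0,
        HasDerivWithinAt (fun s => x s n) (truncRHS δ visc t (x t) n) (Icc (-blowupT A c) 0) t) ∧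
      (∀ t ∈ Icc (-blowupT A c) 0, A 0 ≤ x t 0 ∧ x t 0 ≤ 2 * A 0) ∧
      (∀ n, 1 ≤ n → ∀ t ∈ Icc (-blowupT A c) 0,
        0 ≤ x t n ∧ x t n ≤ 2 * A n * Real.exp (A (n - 1) / 2 * max t (tk A c n))) ∧
      (∀ n, 1 ≤ n → ∀ t ∈ Icc (tk A c (n + 1)) 0, 3 / 4 * A n ≤ x t n) ∧
      ∀ n, 2 ≤ n → ∀ t ∈ Icc (-blowupT A c) 0,
        A n * Real.exp (-(5 * (A (n - 1) / A (n - 2)))) ≤ x t n := by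
  have hT := hH.blowupT_pos
  -- the trapped truncated solutions, truncation order `K = N + 1`
  have hsol := fun N : ℕ =>
    exists_trapped_solution_bounds hH hv0 hv_nn hv_le hv_off hv_smooth (K := N + 1) (by omega)
  choose y hy0 hyoff hyode hy0b hybd hy34 hyglob using hsol
  -- crude bound `|y N t i| ≤ 2 A_i`
  have hexp_le : ∀ n, ∀ t ∈ Icc (-blowupT A c) 0,
      Real.exp (A (n - 1) / 2 * max t (tk A c n)) ≤ 1 := by
    intro n t ht
    rw [Real.exp_le_one_iff]
    have h1 : max t (tk A c n) ≤ 0 := max_le ht.2 (hH.tk_neg n).le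
    have h2 : 0 ≤ A (n - 1) / 2 := by linarith [hH.A_pos (n - 1)]
    nlinarith
  have hbound : ∀ N i, ∀ t ∈ Icc (-blowupT A c) 0, |y N t i| ≤ 2 * A i := by
    intro N i t ht
    rcases Nat.eq_zero_or_pos i with rfl | hi0
    · have h := hy0b N t ht
      rw [abs_of_nonneg ((hH.A_pos 0).le.trans h.1)]
      exact h.2
    rcases le_or_gt i (N + 1) with hi | hi
    · have h := hybd N i hi0 hi t ht
      rw [abs_of_nonneg h.1.le]
      have hA := (hH.A_pos i).le
      have := hexp_le i t ht
      nlinarith [h.2]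
    · rw [hyoff N t i hi, abs_zero]
      linarith [hH.A_pos i]
  have hcont : ∀ N i, ContinuousOn (fun t => y N t i) (Icc (-blowupT A c) 0) := by
    intro N i
    rcases le_or_gt i (N + 1) with hi | hi
    · exact fun t ht => (hyode N i hi t ht).continuousWithinAt
    · exact continuousOn_const.congr fun t _ => hyoff N t i hi
  have hsol' : ∀ i, ∀ᶠ N in atTop, ∀ t ∈ Icc (-blowupT A c) 0,
      HasDerivWithinAt (fun s => y N s i) (truncRHS δ visc t (y N t) i)
        (Icc (-blowupT A c) 0) t :=
    fun i => eventually_atTop.2 ⟨i, fun N hN => hyode N i (by omega)⟩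
  obtain ⟨φ, hφ, x, hlim, -, hode⟩ :=
    Literature.Analysis.ODE.exists_subseq_tendsto_solution_of_truncations
      (f := fun i t z => truncRHS δ visc t z i) (y := y) (R := fun i => 2 * A i)
      (a := -blowupT A c) (b := 0) (by linarith)
      (fun i => continuous_truncRHS (fun n => (hv_smooth n).continuous) i) hcont hbound hsol'
  -- along the subsequence every mode is eventually retained
  have hev : ∀ n, ∀ᶠ k in atTop, n ≤ φ k + 1 := fun n =>
    eventually_atTop.2 ⟨n, fun k hk => by have : k ≤ φ k := hφ.le_apply; omega⟩
  have h0mem : (0 : ℝ) ∈ Icc (-blowupT A c) 0 := ⟨by linarith, le_rfl⟩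
  refine ⟨x, fun n => ?_, hode, fun t ht => ?_, fun n hn1 t ht => ?_, fun n hn1 t ht => ?_,
    fun n hn2 t ht => ?_⟩
  · -- terminal values
    have h2 : Tendsto (fun k => y (φ k) 0 n) atTop (𝓝 (A n)) := by
      refine tendsto_const_nhds.congr' ?_
      filter_upwards [hev n] with k hk
      rw [hy0 (φ k) n, if_pos hk]
    exact tendsto_nhds_unique (hlim n 0 h0mem) h2
  · -- mode 0
    refine ⟨ge_of_tendsto (hlim 0 t ht) (Eventually.of_forall fun k => (hy0b (φ k) t ht).1),
      le_of_tendsto (hlim 0 t ht) (Eventually.of_forall fun k => (hy0b (φ k) t ht).2)⟩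
  · -- modes `n ≥ 1`, two-sided bound
    refine ⟨ge_of_tendsto (hlim n t ht) ?_, le_of_tendsto (hlim n t ht) ?_⟩
    · filter_upwards [hev n] with k hk
      exact (hybd (φ k) n hn1 hk t ht).1.le
    · filter_upwards [hev n] with k hk
      exact (hybd (φ k) n hn1 hk t ht).2
  · -- `¾ A_n` on `[t_{n+1}, 0]`
    have htT : t ∈ Icc (-blowupT A c) 0 := ⟨(hH.neg_blowupT_le_tk _).trans ht.1, ht.2⟩
    refine ge_of_tendsto (hlim n t htT) ?_
    filter_upwards [hev n] with k hk
    exact hy34 (φ k) n hn1 hk t ht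
  · -- the global lower bound
    refine ge_of_tendsto (hlim n t ht) ?_
    filter_upwards [hev n] with k hk
    exact hyglob (φ k) n hn2 hk t ht

end PalasekObukhov

end Literature.Analysis.FluidPDE

/-!
## Part 3 (Regularity).
Palasek 2026, §3.3: the cut-off viscosity, smoothness and derivative bounds of the solution

S. Palasek, arXiv:2605.13827 (2026), §3.3 (p. 10–11). Fifth block of the discharge of
`Literature.Analysis.FluidPDE.Palasek2026_viscousBlowup` (plan: cell `pub/ns-blowup`,
`lit/PALASEK-FORMALISATION.md` §6): the concrete cut-offs `ρ_k(t) = ρ(t/t_k)` ("fix a decreasing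
cutoff function `ρ ∈ C_c^∞([0,1))` with `ρ ≡ 1` on `[0,½]`"; here `ρ(s) = smoothTransition (2 - 2s)`),
the viscous coefficients `visc_k = ρ_k νN_k²`, the resulting solution of the cut-off viscous system on
`[-T, 0]` for ALL modes (`exists_limit_solution`), its smoothness in time (the nearest-neighbour
bootstrap `Literature.Analysis.ODE.contDiffOn_of_nearestNeighbourChain`) and the polynomial growth
of its time derivatives "in the local amplitudes and frequencies", with the small factor
`exp(-(c/4)A_{k-1}/A_{k-2})` on `t ≤ t_k/2`
(`Literature.Analysis.ODE.abs_iteratedDerivWithin_le_pow_of_quadraticChain`).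
All statements are PROVED; there are no new named facts.

## Main results

* `modeCutoff`, `viscCoeff`, `cutoffSlope`: `ρ_k`, `visc_k = νN_k²ρ_k`, `a_k = 2A_{k-2}/c = -2/t_k`.
* `modeCutoff_eq_zero_of_lt`, `modeCutoff_eq_one_of_le`: `ρ_k = 0` below `t_k`, `ρ_k = 1` on
  `[t_k/2, 0]` ((rho_k_properties)); `abs_iteratedDeriv_viscCoeff_le`:
  `|visc_k^{(j)}| ≤ νN_k² a_k^j K_j` ("`|∂_t^jρ_k| ≲_j |t_k|^{-j}`").
* `exists_regular_solution`: a solution of the cut-off system for all modes on `[-T, 0]`,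
  `x_k(0) = A_k`, with the bounds (sol_bounds), `C^∞` in `t` in every mode.
* `ampBound` (`Λ_j = 1 + νN_j² + 2A_j + 2A_j/c`), `smallFactor` (`θ_k = e^{-(c/4)A_{k-1}/A_{k-2}}`),
  `derivConst`, `abs_iteratedDerivWithin_solution_le`: `|x_j^{(n)}| ≤ (κ̄_M+2)^n (n!)² Λ_{j+n}^{3^n}`
  on `[-T,0]` (`n ≤ M`) and `|x_l^{(n)}(t)| ≤ θ_k (…)` for `l ≥ k ≥ 3`, `t ≤ t_k/2`.
-/

open Set Filter Topology Finset
open scoped ContDiff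

namespace Literature.Analysis.FluidPDE

namespace PalasekObukhov

/-! ### The cut-offs `ρ_k` and the viscous coefficients -/

/-- The slope `a_k = 2A_{k-2}/c = -2/t_k` of the rescaled time in `ρ_k(t) = ρ(t/t_k)`.
[cite: Palasek2026ElementaryModel, §3.3 (rho_k_properties)] -/
noncomputable def cutoffSlope (A : ℕ → ℝ) (c : ℝ) (k : ℕ) : ℝ :=
  2 * A (k - 2) / c

/-- **The cut-offs `ρ_k`** of §3.3: `ρ₀ ≡ 1` and, for `k ≥ 1`, `ρ_k(t) = ρ(t/t_k)` with
`ρ(s) = smoothTransition (2 - 2s)` (smooth, `≡ 1` on `s ≤ ½`, `≡ 0` on `s ≥ 1`), i.e.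
`ρ_k(t) = smoothTransition (2 + a_k t)`. [cite: Palasek2026ElementaryModel, §3.3 (rho_k_properties)] -/
noncomputable def modeCutoff (A : ℕ → ℝ) (c : ℝ) (k : ℕ) (t : ℝ) : ℝ :=
  if k = 0 then 1 else Real.smoothTransition (2 + cutoffSlope A c k * t)

/-- **The cut-off viscous coefficients `visc_k(t) = ρ_k(t) ν N_k²`** of (truncated_viscous).
[cite: Palasek2026ElementaryModel, §3.3 (truncated_viscous)] -/
noncomputable def viscCoeff (ν : ℝ) (N A : ℕ → ℝ) (c : ℝ) (k : ℕ) (t : ℝ) : ℝ :=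
  ν * N k ^ 2 * modeCutoff A c k t

section Cutoff

variable {ν : ℝ} {N A δ : ℕ → ℝ} {μ0 c : ℝ} {k : ℕ} {t : ℝ}

/-- `ρ₀ ≡ 1`. [cite: Palasek2026ElementaryModel, §3.3 (rho_k_properties)] -/
@[simp] theorem modeCutoff_zero (A : ℕ → ℝ) (c t : ℝ) : modeCutoff A c 0 t = 1 := by
  simp [modeCutoff]

/-- The formula for `k ≥ 1`. [cite: Palasek2026ElementaryModel, §3.3 (rho_k_properties)] -/
theorem modeCutoff_of_pos (hk : 1 ≤ k) (t : ℝ) :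
    modeCutoff A c k t = Real.smoothTransition (2 + cutoffSlope A c k * t) := by
  rw [modeCutoff, if_neg (by omega)]

/-- `0 ≤ ρ_k`. [cite: Palasek2026ElementaryModel, §3.3 (rho_k_properties)] -/
theorem modeCutoff_nonneg (A : ℕ → ℝ) (c : ℝ) (k : ℕ) (t : ℝ) : 0 ≤ modeCutoff A c k t := by
  unfold modeCutoff
  split_ifs
  · exact zero_le_one
  · exact Real.smoothTransition.nonneg _

/-- `ρ_k ≤ 1`. [cite: Palasek2026ElementaryModel, §3.3 (rho_k_properties)] -/
theorem modeCutoff_le_one (A : ℕ → ℝ) (c : ℝ) (k : ℕ) (t : ℝ) : modeCutoff A c k t ≤ 1 := by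
  unfold modeCutoff
  split_ifs
  · exact le_rfl
  · exact Real.smoothTransition.le_one _

/-- The slope is positive. [cite: Palasek2026ElementaryModel, §3.3 (rho_k_properties)] -/
theorem cutoffSlope_pos (hH : BarrierHypotheses A δ μ0 c) (k : ℕ) : 0 < cutoffSlope A c k :=
  div_pos (mul_pos two_pos (hH.A_pos _)) hH.c_pos

/-- `A_{k-2} t` versus the slope: `a_k t = 2(A_{k-2}t)/c`. [cite: Palasek2026ElementaryModel, §3.3 (rho_k_properties)] -/
theorem cutoffSlope_mul (A : ℕ → ℝ) (c : ℝ) (k : ℕ) (t : ℝ) :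
    cutoffSlope A c k * t = 2 * (A (k - 2) * t) / c := by
  unfold cutoffSlope
  ring

/-- **`supp ρ_k ⊂ [t_k, 0]`: `ρ_k(t) = 0` for `t < t_k`** (`k ≥ 1`). [cite: Palasek2026ElementaryModel, §3.3 (rho_k_properties)] -/
theorem modeCutoff_eq_zero_of_lt (hH : BarrierHypotheses A δ μ0 c) (hk : 1 ≤ k)
    (ht : t < tk A c k) : modeCutoff A c k t = 0 := by
  rw [modeCutoff_of_pos hk]
  apply Real.smoothTransition.zero_of_nonpos
  have hA := hH.A_pos (k - 2)
  have hc := hH.c_pos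
  have h1 : A (k - 2) * t < -c := by
    have h := mul_lt_mul_of_pos_left ht hA
    have h' : A (k - 2) * tk A c k = -c := hH.A_mul_tk k
    linarith
  have h2 : 2 * (A (k - 2) * t) / c ≤ -2 := by
    rw [div_le_iff₀ hc]
    linarith
  rw [cutoffSlope_mul]
  linarith

/-- **`ρ_k ≡ 1` on `[t_k/2, 0]`** (indeed on `t ≥ t_k/2`; `k ≥ 1`). [cite: Palasek2026ElementaryModel, §3.3 (rho_k_properties)] -/
theorem modeCutoff_eq_one_of_le (hH : BarrierHypotheses A δ μ0 c) (hk : 1 ≤ k)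
    (ht : tk A c k / 2 ≤ t) : modeCutoff A c k t = 1 := by
  rw [modeCutoff_of_pos hk]
  apply Real.smoothTransition.one_of_one_le
  have hA := hH.A_pos (k - 2)
  have hc := hH.c_pos
  have h1 : -c / 2 ≤ A (k - 2) * t := by
    have h := mul_le_mul_of_nonneg_left ht hA.le
    have h' : A (k - 2) * tk A c k = -c := hH.A_mul_tk k
    linarith
  have h2 : -1 ≤ 2 * (A (k - 2) * t) / c := by
    rw [le_div_iff₀ hc]
    linarith
  rw [cutoffSlope_mul]
  linarith

/-- `ρ_k` is smooth. [cite: Palasek2026ElementaryModel, §3.3 (rho_k_properties)] -/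
theorem contDiff_modeCutoff (A : ℕ → ℝ) (c : ℝ) (k : ℕ) : ContDiff ℝ ∞ (modeCutoff A c k) := by
  rcases Nat.eq_zero_or_pos k with rfl | hk
  · have h : modeCutoff A c 0 = fun _ => (1 : ℝ) := funext fun s => modeCutoff_zero A c s
    rw [h]
    exact contDiff_const
  · have h : modeCutoff A c k = fun s => Real.smoothTransition (2 + cutoffSlope A c k * s) :=
      funext fun s => modeCutoff_of_pos hk s
    rw [h]
    exact Real.smoothTransition.contDiff.comp (contDiff_const.add (contDiff_const.mul contDiff_id))

/-- **The derivatives of `ρ_k`**: `ρ_k^{(j)}(t) = a_k^j ρ^{(j)}`-type chain rule,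
`(d/dt)^j smoothTransition(2 + a_k t) = a_k^j smoothTransition^{(j)}(2 + a_k t)`.
[cite: Palasek2026ElementaryModel, §3.3 ("`|∂_t^j ρ_k(t)| ≲_j |t_k|^{-j}`")] -/
theorem iteratedDeriv_modeCutoff (hk : 1 ≤ k) (j : ℕ) (t : ℝ) :
    iteratedDeriv j (modeCutoff A c k) t =
      cutoffSlope A c k ^ j * iteratedDeriv j Real.smoothTransition (2 + cutoffSlope A c k * t) := by
  have heq : modeCutoff A c k =
      fun s => (fun u => Real.smoothTransition (2 + u)) (cutoffSlope A c k * s) := by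
    funext s
    exact modeCutoff_of_pos hk s
  have hsm : ContDiff ℝ j (fun u => Real.smoothTransition (2 + u)) :=
    (Real.smoothTransition.contDiff.comp (contDiff_const.add contDiff_id)).of_le
      (by exact_mod_cast le_top)
  rw [heq, iteratedDeriv_comp_const_mul hsm]
  simp only [iteratedDeriv_comp_const_add]

/-- Sup bounds `K_j ≥ 1` for the derivatives of the profile `smoothTransition` (all orders).
[cite: Palasek2026ElementaryModel, §3.3 ("`|∂_t^j ρ_k(t)| ≲_j |t_k|^{-j}`")] -/
theorem exists_cutoffConst : ∃ K : ℕ → ℝ, (∀ j, 1 ≤ K j) ∧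
    ∀ j x, |iteratedDeriv j Real.smoothTransition x| ≤ K j := by
  choose M _hM0 hM using Literature.Analysis.Distribution.exists_bound_iteratedDeriv_smoothTransition
  exact ⟨fun j => max 1 (M j), fun j => le_max_left _ _, fun j x => (hM j x).trans (le_max_right _ _)⟩

/-- The constants `K_j` of `exists_cutoffConst`. [cite: Palasek2026ElementaryModel, §3.3] -/
noncomputable def cutoffConst : ℕ → ℝ :=
  Classical.choose exists_cutoffConst

/-- `K_j ≥ 1`. [cite: Palasek2026ElementaryModel, §3.3] -/
theorem one_le_cutoffConst (j : ℕ) : 1 ≤ cutoffConst j :=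
  (Classical.choose_spec exists_cutoffConst).1 j

/-- `|smoothTransition^{(j)}| ≤ K_j`. [cite: Palasek2026ElementaryModel, §3.3] -/
theorem abs_iteratedDeriv_smoothTransition_le (j : ℕ) (x : ℝ) :
    |iteratedDeriv j Real.smoothTransition x| ≤ cutoffConst j :=
  (Classical.choose_spec exists_cutoffConst).2 j x

/-- `visc₀ ≡ νN₀²` (no cut-off on the lowest mode). [cite: Palasek2026ElementaryModel, §3.3 (rho_k_properties)] -/
@[simp] theorem viscCoeff_mode_zero (ν : ℝ) (N A : ℕ → ℝ) (c t : ℝ) :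
    viscCoeff ν N A c 0 t = ν * N 0 ^ 2 := by
  simp [viscCoeff]

/-- `visc_k ≥ 0` (`ν ≥ 0`). [cite: Palasek2026ElementaryModel, §3.3 (truncated_viscous)] -/
theorem viscCoeff_nonneg (hν : 0 ≤ ν) (N A : ℕ → ℝ) (c : ℝ) (k : ℕ) (t : ℝ) :
    0 ≤ viscCoeff ν N A c k t :=
  mul_nonneg (mul_nonneg hν (sq_nonneg _)) (modeCutoff_nonneg _ _ _ _)

/-- `visc_k ≤ νN_k²`. [cite: Palasek2026ElementaryModel, §3.3 (truncated_viscous)] -/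
theorem viscCoeff_le (hν : 0 ≤ ν) (N A : ℕ → ℝ) (c : ℝ) (k : ℕ) (t : ℝ) :
    viscCoeff ν N A c k t ≤ ν * N k ^ 2 :=
  mul_le_of_le_one_right (mul_nonneg hν (sq_nonneg _)) (modeCutoff_le_one _ _ _ _)

/-- `visc_k(t) = 0` for `t < t_k` (`k ≥ 1`). [cite: Palasek2026ElementaryModel, §3.3 (rho_k_properties)] -/
theorem viscCoeff_eq_zero_of_lt (hH : BarrierHypotheses A δ μ0 c) (hk : 1 ≤ k)
    (ht : t < tk A c k) : viscCoeff ν N A c k t = 0 := by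
  rw [viscCoeff, modeCutoff_eq_zero_of_lt hH hk ht, mul_zero]

/-- `visc_k(t) = νN_k²` on `[t_k/2, 0]` (`k ≥ 1`): no force near the blow-up time.
[cite: Palasek2026ElementaryModel, §3.3 (rho_k_properties)] -/
theorem viscCoeff_eq_of_le (hH : BarrierHypotheses A δ μ0 c) (hk : 1 ≤ k)
    (ht : tk A c k / 2 ≤ t) : viscCoeff ν N A c k t = ν * N k ^ 2 := by
  rw [viscCoeff, modeCutoff_eq_one_of_le hH hk ht, mul_one]

/-- `visc_k` is smooth. [cite: Palasek2026ElementaryModel, §3.3 (rho_k_properties)] -/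
theorem contDiff_viscCoeff (ν : ℝ) (N A : ℕ → ℝ) (c : ℝ) (k : ℕ) :
    ContDiff ℝ ∞ (viscCoeff ν N A c k) :=
  contDiff_const.mul (contDiff_modeCutoff A c k)

/-- **`|visc_k^{(j)}(t)| ≤ νN_k² a_k^j K_j`** — the source's "`|∂_t^j ρ_k(t)| ≲_j |t_k|^{-j} ∼ A_{k-2}^j`"
with explicit constants. [cite: Palasek2026ElementaryModel, §3.3 proof of Thm 1.3 (higher derivatives of the force)] -/
theorem abs_iteratedDeriv_viscCoeff_le (hν : 0 ≤ ν) (hslope : 0 ≤ cutoffSlope A c k) (j : ℕ)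
    (t : ℝ) :
    |iteratedDeriv j (viscCoeff ν N A c k) t| ≤
      ν * N k ^ 2 * cutoffSlope A c k ^ j * cutoffConst j := by
  have hνN : 0 ≤ ν * N k ^ 2 := mul_nonneg hν (sq_nonneg _)
  have hK := one_le_cutoffConst j
  have heq : viscCoeff ν N A c k = fun s => ν * N k ^ 2 * modeCutoff A c k s := rfl
  rw [heq, iteratedDeriv_const_mul_field, abs_mul, abs_of_nonneg hνN]
  rcases Nat.eq_zero_or_pos k with rfl | hk
  · have h1 : modeCutoff A c 0 = fun _ => (1 : ℝ) := funext fun s => modeCutoff_zero A c s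
    rw [h1, iteratedDeriv_const]
    split_ifs with hj
    · subst hj
      rw [pow_zero, mul_one, abs_one]
      nlinarith
    · rw [abs_zero, mul_zero]
      have := pow_nonneg hslope j
      positivity
  · rw [iteratedDeriv_modeCutoff hk, abs_mul, abs_pow, abs_of_nonneg hslope]
    calc ν * N k ^ 2 * (cutoffSlope A c k ^ j *
          |iteratedDeriv j Real.smoothTransition (2 + cutoffSlope A c k * t)|)
        ≤ ν * N k ^ 2 * (cutoffSlope A c k ^ j * cutoffConst j) :=
          mul_le_mul_of_nonneg_left (mul_le_mul_of_nonneg_left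
            (abs_iteratedDeriv_smoothTransition_le j _) (pow_nonneg hslope j)) hνN
      _ = ν * N k ^ 2 * cutoffSlope A c k ^ j * cutoffConst j := by ring

end Cutoff

/-! ### The regular solution on `[-T, 0]` -/

section Regular

variable {ν : ℝ} {N A δ : ℕ → ℝ} {μ0 c : ℝ}

/-- The right-hand side with the cut-off viscosity is smooth jointly in
`(t, x_{k-1}, x_k, x_{k+1})`. [cite: Palasek2026ElementaryModel, §3.3 (truncated_viscous)] -/
theorem contDiff_truncRHS_mode (ν : ℝ) (N A δ : ℕ → ℝ) (c : ℝ) (i : ℕ) :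
    ContDiff ℝ ∞ fun p : ℝ × ℝ × ℝ × ℝ =>
      -(viscCoeff ν N A c i p.1 * p.2.2.1) + (if i = 0 then 0 else p.2.1 * p.2.2.1) -
        δ i * p.2.2.2 ^ 2 := by
  have hv : ContDiff ℝ ∞ fun p : ℝ × ℝ × ℝ × ℝ => viscCoeff ν N A c i p.1 :=
    (contDiff_viscCoeff ν N A c i).comp contDiff_fst
  have h2 : ContDiff ℝ ∞ fun p : ℝ × ℝ × ℝ × ℝ => p.2.1 := contDiff_fst.comp contDiff_snd
  have h3 : ContDiff ℝ ∞ fun p : ℝ × ℝ × ℝ × ℝ => p.2.2.1 :=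
    contDiff_fst.comp (contDiff_snd.comp contDiff_snd)
  have h4 : ContDiff ℝ ∞ fun p : ℝ × ℝ × ℝ × ℝ => p.2.2.2 :=
    contDiff_snd.comp (contDiff_snd.comp contDiff_snd)
  by_cases h0 : i = 0
  · simp only [if_pos h0, add_zero]
    exact (hv.mul h3).neg.sub (contDiff_const.mul (h4.pow 2))
  · simp only [if_neg h0]
    exact ((hv.mul h3).neg.add (h2.mul h3)).sub (contDiff_const.mul (h4.pow 2))

/-- **Palasek 2026, §3.3: the regular solution of the cut-off viscous system on `[-T, 0]`.**
For `ν ≥ 0`, `μ₀ = νN₀²` and `νN_k² ≤ ¼A_{k-1}` (`k ≥ 1`; "`β > 2b`, taking `N₀` large") the system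
`x_k' = -ρ_k(t)νN_k² x_k + x_{k-1}x_k - δ_k x_{k+1}²` (all `k ≥ 0`, `x_{-1} ≡ 0`) has a solution on
`[-T, 0]` with `x_k(0) = A_k`, the bounds (sol_bounds) and the trapping lower bounds, and every mode
is `C^∞` in `t` on `[-T, 0]`. [cite: Palasek2026ElementaryModel, §3.3 Prop. 3.4 and proof of Thm 1.3 (sol_bounds)] -/
theorem exists_regular_solution (hH : BarrierHypotheses A δ μ0 c) (hν : 0 ≤ ν)
    (hμ0 : μ0 = ν * N 0 ^ 2) (hvisc : ∀ k, 1 ≤ k → ν * N k ^ 2 ≤ A (k - 1) / 4) :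
    ∃ x : ℝ → ℕ → ℝ,
      (∀ n, x 0 n = A n) ∧
      (∀ n, ∀ t ∈ Icc (-blowupT A c) 0,
        HasDerivWithinAt (fun s => x s n) (truncRHS δ (viscCoeff ν N A c) t (x t) n)
          (Icc (-blowupT A c) 0) t) ∧
      (∀ t ∈ Icc (-blowupT A c) 0, A 0 ≤ x t 0 ∧ x t 0 ≤ 2 * A 0) ∧
      (∀ n, 1 ≤ n → ∀ t ∈ Icc (-blowupT A c) 0,
        0 ≤ x t n ∧ x t n ≤ 2 * A n * Real.exp (A (n - 1) / 2 * max t (tk A c n))) ∧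
      (∀ n, 1 ≤ n → ∀ t ∈ Icc (tk A c (n + 1)) 0, 3 / 4 * A n ≤ x t n) ∧
      (∀ n, 2 ≤ n → ∀ t ∈ Icc (-blowupT A c) 0,
        A n * Real.exp (-(5 * (A (n - 1) / A (n - 2)))) ≤ x t n) ∧
      ∀ n, ContDiffOn ℝ ∞ (fun s => x s n) (Icc (-blowupT A c) 0) := by
  obtain ⟨x, h0, hode, hb0, hbd, h34, hglob⟩ :=
    exists_limit_solution hH (visc := viscCoeff ν N A c)
      (fun t => by rw [viscCoeff_mode_zero, hμ0]) (fun n t => viscCoeff_nonneg hν N A c n t)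
      (fun n hn t => (viscCoeff_le hν N A c n t).trans (hvisc n hn))
      (fun n hn t ht => viscCoeff_eq_zero_of_lt hH (by omega) ht)
      (fun n => (contDiff_viscCoeff ν N A c n).of_le (by exact_mod_cast le_top))
  refine ⟨x, h0, hode, hb0, hbd, h34, hglob, fun n => ?_⟩
  have hT := hH.blowupT_pos
  exact Literature.Analysis.ODE.contDiffOn_of_nearestNeighbourChain (x := fun i s => x s i)
    (Φ := fun i t u v w =>
      -(viscCoeff ν N A c i t * v) + (if i = 0 then 0 else u * v) - δ i * w ^ 2)
    (a := -blowupT A c) (b := 0) (by linarith) (fun i => contDiff_truncRHS_mode ν N A δ c i)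
    (fun i t ht => hode i t ht) n

end Regular

/-! ### Polynomial derivative bounds with the small factor -/

/-- The amplitude scale `Λ_j = 1 + νN_j² + 2A_j + 2A_j/c` dominating `|x_j|`, the viscous rate and
the cut-off slope at mode `j` ("local amplitudes and frequencies"). [cite: Palasek2026ElementaryModel, §3.3 proof of Thm 1.3] -/
noncomputable def ampBound (ν : ℝ) (N A : ℕ → ℝ) (c : ℝ) (j : ℕ) : ℝ :=
  1 + ν * N j ^ 2 + 2 * A j + 2 * A j / c

/-- The small factor `θ_k = exp(-(c/4)A_{k-1}/A_{k-2})` carried by the modes `l ≥ k` on `t ≤ t_k/2`.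
[cite: Palasek2026ElementaryModel, §3.3 proof of Thm 1.3 ("the small factor exp(-(c/4)A_{k-1}/A_{k-2})")] -/
noncomputable def smallFactor (A : ℕ → ℝ) (c : ℝ) (k : ℕ) : ℝ :=
  Real.exp (-(c / 4 * (A (k - 1) / A (k - 2))))

/-- The constant `κ̄_M = Σ_{i<M} K_i` dominating the profile constants below order `M`.
[cite: Palasek2026ElementaryModel, §3.3 proof of Thm 1.3] -/
noncomputable def derivConst (M : ℕ) : ℝ :=
  ∑ i ∈ Finset.range M, cutoffConst i

section Bounds

variable {ν : ℝ} {N A δ : ℕ → ℝ} {μ0 c : ℝ}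

/-- `κ̄_M ≥ 0`. [cite: Palasek2026ElementaryModel, §3.3] -/
theorem derivConst_nonneg (M : ℕ) : 0 ≤ derivConst M :=
  sum_nonneg fun i _ => zero_le_one.trans (one_le_cutoffConst i)

/-- `K_i ≤ κ̄_M` for `i < M`. [cite: Palasek2026ElementaryModel, §3.3] -/
theorem cutoffConst_le_derivConst {i M : ℕ} (hi : i < M) : cutoffConst i ≤ derivConst M :=
  single_le_sum (f := cutoffConst) (fun j _ => zero_le_one.trans (one_le_cutoffConst j))
    (mem_range.2 hi)

/-- `Λ_j ≥ 1`. [cite: Palasek2026ElementaryModel, §3.3] -/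
theorem one_le_ampBound (hH : BarrierHypotheses A δ μ0 c) (hν : 0 ≤ ν) (j : ℕ) :
    1 ≤ ampBound ν N A c j := by
  unfold ampBound
  have h1 : 0 ≤ ν * N j ^ 2 := mul_nonneg hν (sq_nonneg _)
  have h2 : 0 ≤ 2 * A j := by linarith [hH.A_pos j]
  have h3 : 0 ≤ 2 * A j / c := div_nonneg h2 hH.c_pos.le
  linarith

/-- `Λ` is non-decreasing (`N`, `A` non-decreasing, `N ≥ 0`). [cite: Palasek2026ElementaryModel, §3.3] -/
theorem monotone_ampBound (hH : BarrierHypotheses A δ μ0 c) (hν : 0 ≤ ν) (hN0 : ∀ k, 0 ≤ N k)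
    (hN : Monotone N) : Monotone (ampBound ν N A c) := by
  refine monotone_nat_of_le_succ fun j => ?_
  unfold ampBound
  have h1 : N j ^ 2 ≤ N (j + 1) ^ 2 := pow_le_pow_left₀ (hN0 j) (hN (Nat.le_succ j)) 2
  have h2 : A j ≤ A (j + 1) := hH.A_mono (Nat.le_succ j)
  have h3 : 2 * A j / c ≤ 2 * A (j + 1) / c := div_le_div_of_nonneg_right (by linarith) hH.c_pos.le
  have h4 : ν * N j ^ 2 ≤ ν * N (j + 1) ^ 2 := mul_le_mul_of_nonneg_left h1 hν
  linarith

/-- The three quantities dominated by `Λ_j`. [cite: Palasek2026ElementaryModel, §3.3] -/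
theorem le_ampBound (hH : BarrierHypotheses A δ μ0 c) (hν : 0 ≤ ν) (j : ℕ) :
    ν * N j ^ 2 ≤ ampBound ν N A c j ∧ 2 * A j ≤ ampBound ν N A c j ∧
      cutoffSlope A c j ≤ ampBound ν N A c j := by
  unfold ampBound cutoffSlope
  have h1 : 0 ≤ ν * N j ^ 2 := mul_nonneg hν (sq_nonneg _)
  have h2 : 0 ≤ 2 * A j := by linarith [hH.A_pos j]
  have h3 : 0 ≤ 2 * A j / c := div_nonneg h2 hH.c_pos.le
  have h4 : 2 * A (j - 2) / c ≤ 2 * A j / c :=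
    div_le_div_of_nonneg_right (by linarith [hH.A_mono (Nat.sub_le j 2)]) hH.c_pos.le
  exact ⟨by linarith, by linarith, by linarith⟩

/-- Monotonicity of the amplitude ratios `A_m/A_{m-1}` ("since `(N_k)` grows faster than
exponentially"), from the one-step hypothesis. [cite: Palasek2026ElementaryModel, §3.1 (ratios)] -/
theorem ratio_mono (hratio : ∀ k, A (k + 1) / A k ≤ A (k + 2) / A (k + 1)) {m n : ℕ} (hm : 1 ≤ m)
    (hmn : m ≤ n) : A m / A (m - 1) ≤ A n / A (n - 1) := by
  induction n, hmn using Nat.le_induction with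
  | base => exact le_rfl
  | succ n hn ih =>
    refine ih.trans ?_
    have h := hratio (n - 1)
    rw [show n - 1 + 1 = n by omega, show n - 1 + 2 = n + 1 by omega] at h
    simpa using h

/-- **Palasek 2026, §3.3: "time derivatives of `x_k` grow at most polynomially in the local
amplitudes and frequencies, … weighted by the small factor `exp(-(c/4)A_{k-1}/A_{k-2})` on
`t ≤ t_k/2`".** For a smooth solution of the cut-off system with the bounds (sol_bounds): for every
order `n ≤ M`, `|x_j^{(n)}(t)| ≤ (κ̄_M + 2)^n (n!)² Λ_{j+n}^{3^n}` on `[-T, 0]`, and for `3 ≤ k ≤ l`,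
`t ≤ t_k/2`: `|x_l^{(n)}(t)| ≤ θ_k (κ̄_M + 2)^n (n!)² Λ_{l+n}^{3^n}`. (Derivatives within `[-T,0]`.)
[cite: Palasek2026ElementaryModel, §3.3 proof of Thm 1.3 (higher derivatives of the force)] -/
theorem abs_iteratedDerivWithin_solution_le (hH : BarrierHypotheses A δ μ0 c) (hν : 0 ≤ ν)
    (hN0 : ∀ k, 0 ≤ N k) (hN : Monotone N) (hδ1 : ∀ k, δ k ≤ 1)
    (hratio : ∀ k, A (k + 1) / A k ≤ A (k + 2) / A (k + 1)) {x : ℝ → ℕ → ℝ}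
    (hsm : ∀ j, ContDiffOn ℝ ∞ (fun s => x s j) (Icc (-blowupT A c) 0))
    (hode : ∀ j, ∀ t ∈ Icc (-blowupT A c) 0,
      HasDerivWithinAt (fun s => x s j) (truncRHS δ (viscCoeff ν N A c) t (x t) j)
        (Icc (-blowupT A c) 0) t)
    (hb0 : ∀ t ∈ Icc (-blowupT A c) 0, A 0 ≤ x t 0 ∧ x t 0 ≤ 2 * A 0)
    (hbd : ∀ j, 1 ≤ j → ∀ t ∈ Icc (-blowupT A c) 0,
      0 ≤ x t j ∧ x t j ≤ 2 * A j * Real.exp (A (j - 1) / 2 * max t (tk A c j)))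
    (M : ℕ) :
    (∀ n ≤ M, ∀ j, ∀ t ∈ Icc (-blowupT A c) 0,
      |iteratedDerivWithin n (fun s => x s j) (Icc (-blowupT A c) 0) t| ≤
        (derivConst M + 2) ^ n * (n.factorial : ℝ) ^ 2 * ampBound ν N A c (j + n) ^ 3 ^ n) ∧
    ∀ n ≤ M, ∀ k, 3 ≤ k → ∀ l, k ≤ l → ∀ t ∈ Icc (-blowupT A c) 0, t ≤ tk A c k / 2 →
      |iteratedDerivWithin n (fun s => x s l) (Icc (-blowupT A c) 0) t| ≤
        smallFactor A c k *
          ((derivConst M + 2) ^ n * (n.factorial : ℝ) ^ 2 * ampBound ν N A c (l + n) ^ 3 ^ n) := by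
  have hT := hH.blowupT_pos
  have hT0 : -blowupT A c < 0 := by linarith
  set Λ := ampBound ν N A c with hΛdef
  -- the data of the abstract chain theorem
  have hx' : ∀ j, ContDiffOn ℝ ∞ ((fun j s => x s j) j) (Icc (-blowupT A c) 0) := hsm
  have ha' : ∀ j, ContDiffOn ℝ ∞ (viscCoeff ν N A c j) (Icc (-blowupT A c) 0) :=
    fun j => (contDiff_viscCoeff ν N A c j).contDiffOn
  have hode' : ∀ j, ∀ t ∈ Icc (-blowupT A c) 0,
      derivWithin ((fun j s => x s j) j) (Icc (-blowupT A c) 0) t =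
        -viscCoeff ν N A c j t * (fun j s => x s j) j t +
          (if j = 0 then (0 : ℝ) else 1) * (fun j s => x s j) (j - 1) t * (fun j s => x s j) j t -
            δ j * (fun j s => x s j) (j + 1) t ^ 2 := by
    intro j t ht
    rw [(hode j t ht).derivWithin (uniqueDiffOn_Icc hT0 t ht)]
    unfold truncRHS
    split_ifs <;> ring
  have hΛ1 : ∀ j, 1 ≤ Λ j := one_le_ampBound hH hν
  have hΛm : Monotone Λ := monotone_ampBound hH hν hN0 hN
  have hκ : ∀ i, i < M → cutoffConst i ≤ derivConst M := fun i hi => cutoffConst_le_derivConst hi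
  have hα : ∀ j i, ∀ t ∈ Icc (-blowupT A c) 0,
      |iteratedDerivWithin i (viscCoeff ν N A c j) (Icc (-blowupT A c) 0) t| ≤
        cutoffConst i * Λ j ^ (i + 1) := by
    intro j i t ht
    rw [iteratedDerivWithin_eq_iteratedDeriv (uniqueDiffOn_Icc hT0)
      ((contDiff_viscCoeff ν N A c j).contDiffAt.of_le (by exact_mod_cast le_top)) ht]
    have hs0 : 0 ≤ cutoffSlope A c j := (cutoffSlope_pos hH j).le
    refine (abs_iteratedDeriv_viscCoeff_le hν hs0 i t).trans ?_
    obtain ⟨h1, -, h3⟩ := le_ampBound hH hν j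
    have hK : 0 ≤ cutoffConst i := zero_le_one.trans (one_le_cutoffConst i)
    have hνN : 0 ≤ ν * N j ^ 2 := mul_nonneg hν (sq_nonneg _)
    have hpow : cutoffSlope A c j ^ i ≤ Λ j ^ i := pow_le_pow_left₀ hs0 h3 i
    calc ν * N j ^ 2 * cutoffSlope A c j ^ i * cutoffConst i
        ≤ Λ j * Λ j ^ i * cutoffConst i := by
          refine mul_le_mul_of_nonneg_right ?_ hK
          exact mul_le_mul h1 hpow (pow_nonneg hs0 i) (zero_le_one.trans (hΛ1 j))
      _ = cutoffConst i * Λ j ^ (i + 1) := by ring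
  have hε : ∀ j : ℕ, |(if j = 0 then (0 : ℝ) else 1)| ≤ 1 := by
    intro j
    split_ifs <;> simp
  have hδ : ∀ j, |δ j| ≤ 1 := fun j => by
    rw [abs_of_nonneg (hH.δ_nonneg j)]
    exact hδ1 j
  have hexp1 : ∀ j, ∀ t ∈ Icc (-blowupT A c) 0, Real.exp (A (j - 1) / 2 * max t (tk A c j)) ≤ 1 := by
    intro j t ht
    rw [Real.exp_le_one_iff]
    have h1 : max t (tk A c j) ≤ 0 := max_le ht.2 (hH.tk_neg j).le
    have h2 : 0 ≤ A (j - 1) / 2 := by linarith [hH.A_pos (j - 1)]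
    nlinarith
  have hB : ∀ j, ∀ t ∈ Icc (-blowupT A c) 0, |(fun j s => x s j) j t| ≤ Λ j := by
    intro j t ht
    obtain ⟨-, h2, -⟩ := le_ampBound hH hν j
    rcases Nat.eq_zero_or_pos j with rfl | hj
    · have h := hb0 t ht
      show |x t 0| ≤ Λ 0
      rw [abs_of_nonneg ((hH.A_pos 0).le.trans h.1)]
      linarith [h.2]
    · have h := hbd j hj t ht
      show |x t j| ≤ Λ j
      rw [abs_of_nonneg h.1]
      have hA := (hH.A_pos j).le
      have := hexp1 j t ht
      nlinarith [h.2]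
  constructor
  · -- global bounds: the chain theorem with the trivial small factor `θ = 1`
    intro n hn j t ht
    have H := Literature.Analysis.ODE.abs_iteratedDerivWithin_le_pow_of_quadraticChain
      (x := fun j s => x s j) (a := viscCoeff ν N A c) (ε := fun j => if j = 0 then (0 : ℝ) else 1)
      (δ := δ) hT0 hx' ha' hode' hΛ1 hΛm hκ (derivConst_nonneg M) hα hε hδ hB
      (k := 0) (s := 0) (θ := 1) zero_le_one
      (fun l _ t ht _ => by rw [one_mul]; exact hB l t ht) hn
    exact H.1 j t ht
  · -- the small factor on `t ≤ t_k/2` for the modes `l ≥ k ≥ 3`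
    intro n hn k hk l hkl t ht hts
    have hθ : 0 ≤ smallFactor A c k := (Real.exp_pos _).le
    have hsmall : ∀ l, k ≤ l → ∀ t ∈ Icc (-blowupT A c) 0, t ≤ tk A c k / 2 →
        |(fun j s => x s j) l t| ≤ smallFactor A c k * Λ l := by
      intro l hl t ht hts
      have hl1 : 1 ≤ l := by omega
      obtain ⟨-, h2, -⟩ := le_ampBound hH hν l
      have h := hbd l hl1 t ht
      show |x t l| ≤ smallFactor A c k * Λ l
      rw [abs_of_nonneg h.1]
      -- the exponent is at most `-(c/4) A_{k-1}/A_{k-2}`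
      have hexp : Real.exp (A (l - 1) / 2 * max t (tk A c l)) ≤ smallFactor A c k := by
        unfold smallFactor
        refine Real.exp_le_exp.2 ?_
        have hAl := hH.A_pos (l - 1)
        have hAk2 := hH.A_pos (k - 2)
        have hAl2 := hH.A_pos (l - 2)
        have hc := hH.c_pos
        have hmono : A (k - 1) ≤ A (l - 1) := hH.A_mono (by omega)
        have hrat : A (k - 1) / A (k - 2) ≤ A (l - 1) / A (l - 2) := by
          have := ratio_mono hratio (m := k - 1) (n := l - 1) (by omega) (by omega)
          rwa [show k - 1 - 1 = k - 2 by omega, show l - 1 - 1 = l - 2 by omega] at this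
        rcases le_or_gt (tk A c l) t with hcase | hcase
        · -- `max = t ≤ t_k/2 = -c/(2A_{k-2})`
          rw [max_eq_left hcase]
          have htk : tk A c k = -(c / A (k - 2)) := rfl
          have h1 : A (l - 1) / 2 * t ≤ A (l - 1) / 2 * (tk A c k / 2) :=
            mul_le_mul_of_nonneg_left hts (by linarith)
          have h2 : A (l - 1) / 2 * (tk A c k / 2) = -(c / 4 * (A (l - 1) / A (k - 2))) := by
            rw [htk]
            ring
          have h3 : A (k - 1) / A (k - 2) ≤ A (l - 1) / A (k - 2) :=
            div_le_div_of_nonneg_right hmono hAk2.le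
          nlinarith
        · -- `max = t_l`: `½A_{l-1}t_l = -(c/2)A_{l-1}/A_{l-2}`
          rw [max_eq_right hcase.le]
          have htl : tk A c l = -(c / A (l - 2)) := rfl
          have h2 : A (l - 1) / 2 * tk A c l = -(c / 2 * (A (l - 1) / A (l - 2))) := by
            rw [htl]
            ring
          have h4 : 0 ≤ A (l - 1) / A (l - 2) := (div_pos hAl hAl2).le
          nlinarith
      have hA := (hH.A_pos l).le
      calc x t l ≤ 2 * A l * Real.exp (A (l - 1) / 2 * max t (tk A c l)) := h.2
        _ ≤ 2 * A l * smallFactor A c k := mul_le_mul_of_nonneg_left hexp (by linarith)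
        _ ≤ smallFactor A c k * Λ l := by nlinarith
    have H := Literature.Analysis.ODE.abs_iteratedDerivWithin_le_pow_of_quadraticChain
      (x := fun j s => x s j) (a := viscCoeff ν N A c) (ε := fun j => if j = 0 then (0 : ℝ) else 1)
      (δ := δ) hT0 hx' ha' hode' hΛ1 hΛm hκ (derivConst_nonneg M) hα hε hδ hB
      (k := k) (s := tk A c k / 2) (θ := smallFactor A c k) hθ hsmall hn
    exact H.2 l hkl t ht hts

end Bounds

end PalasekObukhov

end Literature.Analysis.FluidPDE

/-!
## Part 4 (Force).
Palasek 2026, §3.3: the force `g_k = (1 - ρ_k) νN_k² x_k` and its derivative bounds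

S. Palasek, arXiv:2605.13827 (2026), §3.3, proof of Theorem 1.3 (p. 10–11): "Clearly, `x(t)` satisfies the
desired system (x_system_nondimensionalized) with force `g₀(t) = 0`, `g_k(t) = (1-ρ_k(t))N_k²x_k` for
`k ≥ 1`. … Observe that `1-ρ_k` is supported in `(-∞, t_k/2]`. … For the higher derivatives, we apply
the Leibniz rule to `g_k(t) = (1-ρ_k(t))N_k²x_k(t)` … all bounded terms are weighted by the small
factor `exp(-(c/4)A_{k-1}/A_{k-2})`, which once again defeats the polynomial factors." Sixth block of
the discharge of `Literature.Analysis.FluidPDE.Palasek2026_viscousBlowup` (plan: cell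
`pub/ns-blowup`, `lit/PALASEK-FORMALISATION.md` §6 (iii)–(iv)). All statements are PROVED; there
are no new named facts. The remaining step (that the explicit polynomial-times-`θ_k` bounds below
are summable / tend to `0` in every weighted norm) is the parameter asymptotics (exp_small).

## Main results

* `forceTerm`: `g_k(t) = (νN_k² - visc_k(t)) x_k(t) = (1-ρ_k(t)) νN_k² x_k(t)`;
  `truncRHS_viscCoeff_eq`: the cut-off system IS Palasek's rescaled system
  (x_system_nondimensionalized) with this force.
* `forceTerm_mode_zero`, `forceTerm_eq_zero_of_le`: `g₀ ≡ 0`, `g_k ≡ 0` on `[t_k/2, 0]`;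
  `forceTerm_nonneg`, `forceTerm_le`: `0 ≤ g_k ≤ νN_k² x_k`; `contDiffOn_forceTerm`.
* `iteratedDerivWithin_forceTerm_eq_zero`: all time derivatives of `g_k` vanish on `(t_k/2, 0]`.
* `forceBound`, `abs_iteratedDerivWithin_forceTerm_le_of_three_le` (`k ≥ 3`, with the small factor
  `θ_k`), `abs_iteratedDerivWithin_forceTerm_le` (all `k ≥ 1`): the Leibniz bounds
  `|g_k^{(m)}(t)| ≤ θ_k · νN_k² K̄ (2Λ_k)^m (κ̄+2)^m (m!)² Λ_{k+m}^{3^m}`.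
-/

open Set Filter Topology Finset
open scoped ContDiff

namespace Literature.Analysis.FluidPDE

namespace PalasekObukhov

/-- **The force `g_k(t) = (νN_k² - visc_k(t)) x_k(t) = (1 - ρ_k(t)) νN_k² x_k(t)`** of §3.3.
[cite: Palasek2026ElementaryModel, §3.3 proof of Thm 1.3 ("g_k(t) = (1-ρ_k(t))N_k²x_k")] -/
noncomputable def forceTerm (ν : ℝ) (N A : ℕ → ℝ) (c : ℝ) (x : ℝ → ℕ → ℝ) (k : ℕ) (t : ℝ) : ℝ :=
  (ν * N k ^ 2 - viscCoeff ν N A c k t) * x t k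

/-- The explicit polynomial bound `νN_k² K̄_{M+1} (2Λ_k)^m (κ̄_M+2)^m (m!)² Λ_{k+m}^{3^m}` for the
`m`-th derivative of `g_k` (before the small factor). [cite: Palasek2026ElementaryModel, §3.3 proof of Thm 1.3 (higher derivatives of the force)] -/
noncomputable def forceBound (ν : ℝ) (N A : ℕ → ℝ) (c : ℝ) (M k m : ℕ) : ℝ :=
  ν * N k ^ 2 * derivConst (M + 1) * (2 * ampBound ν N A c k) ^ m *
    ((derivConst M + 2) ^ m * (m.factorial : ℝ) ^ 2 * ampBound ν N A c (k + m) ^ 3 ^ m)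

section Force

variable {ν : ℝ} {N A δ : ℕ → ℝ} {μ0 c : ℝ} {x : ℝ → ℕ → ℝ} {k : ℕ} {t : ℝ}

/-- **The cut-off system is (x_system_nondimensionalized) with the force `g`**:
`-visc_k z_k + z_{k-1}z_k - δ_k z_{k+1}² = -νN_k² z_k + z_{k-1}z_k - δ_k z_{k+1}² + (νN_k² - visc_k) z_k`.
[cite: Palasek2026ElementaryModel, §3.3 proof of Thm 1.3] -/
theorem truncRHS_viscCoeff_eq (δ : ℕ → ℝ) (ν : ℝ) (N A : ℕ → ℝ) (c t : ℝ) (z : ℕ → ℝ) (k : ℕ) :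
    truncRHS δ (viscCoeff ν N A c) t z k =
      -(ν * N k ^ 2) * z k + (if k = 0 then 0 else z (k - 1) * z k) - δ k * z (k + 1) ^ 2 +
        (ν * N k ^ 2 - viscCoeff ν N A c k t) * z k := by
  unfold truncRHS
  ring

/-- `g₀ ≡ 0`. [cite: Palasek2026ElementaryModel, §3.3 proof of Thm 1.3 ("g₀(t) = 0")] -/
@[simp] theorem forceTerm_mode_zero (ν : ℝ) (N A : ℕ → ℝ) (c : ℝ) (x : ℝ → ℕ → ℝ) (t : ℝ) :
    forceTerm ν N A c x 0 t = 0 := by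
  simp [forceTerm]

/-- **`g_k ≡ 0` on `[t_k/2, 0]`** ("`1-ρ_k` is supported in `(-∞, t_k/2]`"). [cite: Palasek2026ElementaryModel, §3.3 proof of Thm 1.3] -/
theorem forceTerm_eq_zero_of_le (hH : BarrierHypotheses A δ μ0 c) (hk : 1 ≤ k)
    (ht : tk A c k / 2 ≤ t) : forceTerm ν N A c x k t = 0 := by
  rw [forceTerm, viscCoeff_eq_of_le hH hk ht, sub_self, zero_mul]

/-- `g_k ≥ 0` where `x_k ≥ 0`. [cite: Palasek2026ElementaryModel, §3.3 proof of Thm 1.3] -/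
theorem forceTerm_nonneg (hν : 0 ≤ ν) (hx : 0 ≤ x t k) : 0 ≤ forceTerm ν N A c x k t :=
  mul_nonneg (sub_nonneg.2 (viscCoeff_le hν N A c k t)) hx

/-- `g_k ≤ νN_k² x_k` where `x_k ≥ 0`. [cite: Palasek2026ElementaryModel, §3.3 proof of Thm 1.3 (first display)] -/
theorem forceTerm_le (hν : 0 ≤ ν) (hx : 0 ≤ x t k) : forceTerm ν N A c x k t ≤ ν * N k ^ 2 * x t k :=
  mul_le_mul_of_nonneg_right (sub_le_self _ (viscCoeff_nonneg hν N A c k t)) hx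

/-- `g_k` is `C^∞` on an interval where `x_k` is. [cite: Palasek2026ElementaryModel, §3.3 proof of Thm 1.3] -/
theorem contDiffOn_forceTerm {s : Set ℝ} (hsm : ContDiffOn ℝ ∞ (fun r => x r k) s) :
    ContDiffOn ℝ ∞ (forceTerm ν N A c x k) s :=
  (contDiff_const.sub (contDiff_viscCoeff ν N A c k)).contDiffOn.mul hsm

/-- **All time derivatives of `g_k` vanish on `(t_k/2, 0]`** (within `[-T, 0]`).
[cite: Palasek2026ElementaryModel, §3.3 proof of Thm 1.3 ("each f_k vanishes in a neighborhood of t = 0")] -/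
theorem iteratedDerivWithin_forceTerm_eq_zero (hH : BarrierHypotheses A δ μ0 c) (hk : 1 ≤ k)
    (hts : tk A c k / 2 < t) (m : ℕ) :
    iteratedDerivWithin m (forceTerm ν N A c x k) (Icc (-blowupT A c) 0) t = 0 := by
  have hev : forceTerm ν N A c x k =ᶠ[𝓝[Icc (-blowupT A c) 0] t] fun _ => (0 : ℝ) := by
    filter_upwards [mem_nhdsWithin_of_mem_nhds (Ioi_mem_nhds hts)] with s hs
    exact forceTerm_eq_zero_of_le hH hk (le_of_lt hs)
  rw [hev.iteratedDerivWithin_eq (forceTerm_eq_zero_of_le hH hk hts.le), iteratedDerivWithin_const]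
  simp

/-- Triangle/Leibniz bookkeeping. [folklore] -/
private theorem abs_sum_range_choose_le {m : ℕ} {u v : ℕ → ℝ} {U V : ℕ → ℝ}
    (hu : ∀ i ≤ m, |u i| ≤ U i) (hv : ∀ i ≤ m, |v i| ≤ V i) :
    |∑ i ∈ range (m + 1), (m.choose i : ℝ) * u i * v (m - i)| ≤
      ∑ i ∈ range (m + 1), (m.choose i : ℝ) * U i * V (m - i) := by
  refine (abs_sum_le_sum_abs _ _).trans (sum_le_sum fun i hi => ?_)
  have hi' : i ≤ m := Nat.lt_succ_iff.1 (mem_range.1 hi)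
  rw [abs_mul, abs_mul, Nat.abs_cast]
  have hU : 0 ≤ U i := (abs_nonneg _).trans (hu i hi')
  exact mul_le_mul (mul_le_mul_of_nonneg_left (hu i hi') (Nat.cast_nonneg _)) (hv _ (Nat.sub_le _ _))
    (abs_nonneg _) (mul_nonneg (Nat.cast_nonneg _) hU)

/-- Derivatives of the coefficient `νN_k² - visc_k`: `|(νN_k² - visc_k)^{(i)}| ≤ νN_k² a_k^i K_i`.
[cite: Palasek2026ElementaryModel, §3.3 proof of Thm 1.3 ("`|∂_t^jρ_k| ≲_j |t_k|^{-j}`")] -/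
theorem abs_iteratedDeriv_coeff_le (hH : BarrierHypotheses A δ μ0 c) (hν : 0 ≤ ν) (k i : ℕ)
    (t : ℝ) :
    |iteratedDeriv i (fun s => ν * N k ^ 2 - viscCoeff ν N A c k s) t| ≤
      ν * N k ^ 2 * cutoffSlope A c k ^ i * cutoffConst i := by
  have hs0 : 0 ≤ cutoffSlope A c k := (cutoffSlope_pos hH k).le
  rcases Nat.eq_zero_or_pos i with rfl | hi
  · rw [iteratedDeriv_zero, pow_zero, mul_one]
    have h1 : 0 ≤ ν * N k ^ 2 - viscCoeff ν N A c k t := sub_nonneg.2 (viscCoeff_le hν N A c k t)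
    have h2 : ν * N k ^ 2 - viscCoeff ν N A c k t ≤ ν * N k ^ 2 :=
      sub_le_self _ (viscCoeff_nonneg hν N A c k t)
    rw [abs_of_nonneg h1]
    have hK := one_le_cutoffConst 0
    have hνN : 0 ≤ ν * N k ^ 2 := mul_nonneg hν (sq_nonneg _)
    nlinarith
  · rw [iteratedDeriv_const_sub hi, iteratedDeriv_neg, abs_neg]
    exact abs_iteratedDeriv_viscCoeff_le hν hs0 i t

/-- The polynomial factor `G_{k,i} = (κ̄+2)^i (i!)² Λ_{k+i}^{3^i}` is non-decreasing in `i`.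
[cite: Palasek2026ElementaryModel, §3.3 proof of Thm 1.3] -/
theorem derivPoly_mono (hH : BarrierHypotheses A δ μ0 c) (hν : 0 ≤ ν) (hN0 : ∀ k, 0 ≤ N k)
    (hN : Monotone N) (M k : ℕ) {i m : ℕ} (him : i ≤ m) :
    (derivConst M + 2) ^ i * (i.factorial : ℝ) ^ 2 * ampBound ν N A c (k + i) ^ 3 ^ i ≤
      (derivConst M + 2) ^ m * (m.factorial : ℝ) ^ 2 * ampBound ν N A c (k + m) ^ 3 ^ m := by
  have hP : 1 ≤ derivConst M + 2 := by linarith [derivConst_nonneg M]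
  have hΛ1 := one_le_ampBound hH hν (N := N)
  have hΛm := monotone_ampBound hH hν hN0 hN
  have h1 : (derivConst M + 2) ^ i ≤ (derivConst M + 2) ^ m := pow_le_pow_right₀ hP him
  have h2 : (i.factorial : ℝ) ^ 2 ≤ (m.factorial : ℝ) ^ 2 :=
    pow_le_pow_left₀ (Nat.cast_nonneg _) (by exact_mod_cast Nat.factorial_le him) 2
  have h3 : ampBound ν N A c (k + i) ^ 3 ^ i ≤ ampBound ν N A c (k + m) ^ 3 ^ m :=
    (pow_le_pow_left₀ (zero_le_one.trans (hΛ1 _)) (hΛm (by omega)) _).trans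
      (pow_le_pow_right₀ (hΛ1 _) (Nat.pow_le_pow_right (by norm_num) him))
  have h4 : 0 ≤ (derivConst M + 2) ^ m := pow_nonneg (by linarith) m
  have h5 : 0 ≤ (i.factorial : ℝ) ^ 2 := pow_nonneg (Nat.cast_nonneg _) 2
  have h6 : 0 ≤ ampBound ν N A c (k + i) ^ 3 ^ i := pow_nonneg (zero_le_one.trans (hΛ1 _)) _
  calc (derivConst M + 2) ^ i * (i.factorial : ℝ) ^ 2 * ampBound ν N A c (k + i) ^ 3 ^ i
      ≤ (derivConst M + 2) ^ m * (i.factorial : ℝ) ^ 2 * ampBound ν N A c (k + i) ^ 3 ^ i := by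
        gcongr
    _ ≤ (derivConst M + 2) ^ m * (m.factorial : ℝ) ^ 2 * ampBound ν N A c (k + m) ^ 3 ^ m := by
        gcongr

/-- The Leibniz estimate with a small factor `θ` on the derivatives of `x_k` at the point `t`.
[cite: Palasek2026ElementaryModel, §3.3 proof of Thm 1.3 (Leibniz rule for g_k)] -/
private theorem abs_iteratedDerivWithin_forceTerm_le_aux (hH : BarrierHypotheses A δ μ0 c)
    (hν : 0 ≤ ν) (hN0 : ∀ k, 0 ≤ N k) (hN : Monotone N)
    (hsm : ContDiffOn ℝ ∞ (fun r => x r k) (Icc (-blowupT A c) 0)) (ht : t ∈ Icc (-blowupT A c) 0)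
    {M m : ℕ} (hm : m ≤ M) {θ : ℝ} (hθ : 0 ≤ θ)
    (hder : ∀ i ≤ M, |iteratedDerivWithin i (fun r => x r k) (Icc (-blowupT A c) 0) t| ≤
      θ * ((derivConst M + 2) ^ i * (i.factorial : ℝ) ^ 2 * ampBound ν N A c (k + i) ^ 3 ^ i)) :
    |iteratedDerivWithin m (forceTerm ν N A c x k) (Icc (-blowupT A c) 0) t| ≤
      θ * forceBound ν N A c M k m := by
  have hT := hH.blowupT_pos
  have hI : UniqueDiffOn ℝ (Icc (-blowupT A c) 0) := uniqueDiffOn_Icc (by linarith)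
  set f : ℝ → ℝ := fun s => ν * N k ^ 2 - viscCoeff ν N A c k s with hfdef
  set g : ℝ → ℝ := fun r => x r k with hgdef
  have hfs : ContDiff ℝ ∞ f := contDiff_const.sub (contDiff_viscCoeff ν N A c k)
  have hfm : ContDiffWithinAt ℝ m f (Icc (-blowupT A c) 0) t :=
    (hfs.contDiffAt.of_le (by exact_mod_cast le_top)).contDiffWithinAt
  have hgm : ContDiffWithinAt ℝ m g (Icc (-blowupT A c) 0) t :=
    (hsm.of_le (by exact_mod_cast le_top)) t ht
  have hprod : forceTerm ν N A c x k = f * g := by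
    funext s
    rfl
  rw [hprod, iteratedDerivWithin_mul ht hI hfm hgm]
  -- bounds for the factors
  set a := cutoffSlope A c k with hadef
  have ha0 : 0 ≤ a := (cutoffSlope_pos hH k).le
  set Kbar := derivConst (M + 1) with hKbar
  set Gm := (derivConst M + 2) ^ m * (m.factorial : ℝ) ^ 2 * ampBound ν N A c (k + m) ^ 3 ^ m
    with hGm
  have hνN : 0 ≤ ν * N k ^ 2 := mul_nonneg hν (sq_nonneg _)
  have hKbar0 : 0 ≤ Kbar := derivConst_nonneg _
  have hGm0 : 0 ≤ Gm := by
    have h1 : 0 ≤ derivConst M + 2 := by linarith [derivConst_nonneg M]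
    have h2 := one_le_ampBound hH hν (N := N) (k + m)
    positivity
  have hF : ∀ i ≤ m, |iteratedDerivWithin i f (Icc (-blowupT A c) 0) t| ≤
      ν * N k ^ 2 * a ^ i * Kbar := by
    intro i hi
    rw [iteratedDerivWithin_eq_iteratedDeriv hI (hfs.contDiffAt.of_le (by exact_mod_cast le_top)) ht]
    refine (abs_iteratedDeriv_coeff_le hH hν k i t).trans ?_
    exact mul_le_mul_of_nonneg_left (cutoffConst_le_derivConst (by omega))
      (mul_nonneg hνN (pow_nonneg ha0 i))
  have hG : ∀ i ≤ m, |iteratedDerivWithin i g (Icc (-blowupT A c) 0) t| ≤ θ * Gm := by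
    intro i hi
    refine (hder i (hi.trans hm)).trans ?_
    exact mul_le_mul_of_nonneg_left (derivPoly_mono hH hν hN0 hN M k hi) hθ
  -- sum up
  obtain ⟨-, -, haΛ⟩ := le_ampBound hH hν (N := N) k
  have hΛ1 := one_le_ampBound hH hν (N := N) (c := c) k
  calc |∑ i ∈ range (m + 1), (m.choose i : ℝ) * iteratedDerivWithin i f (Icc (-blowupT A c) 0) t *
          iteratedDerivWithin (m - i) g (Icc (-blowupT A c) 0) t|
      ≤ ∑ i ∈ range (m + 1), (m.choose i : ℝ) * (ν * N k ^ 2 * a ^ i * Kbar) * (θ * Gm) :=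
        abs_sum_range_choose_le (u := fun i => iteratedDerivWithin i f (Icc (-blowupT A c) 0) t)
          (v := fun i => iteratedDerivWithin i g (Icc (-blowupT A c) 0) t)
          (U := fun i => ν * N k ^ 2 * a ^ i * Kbar) (V := fun _ => θ * Gm) hF hG
    _ = ν * N k ^ 2 * Kbar * (θ * Gm) *
          ∑ i ∈ range (m + 1), a ^ i * 1 ^ (m - i) * (m.choose i : ℝ) := by
        rw [mul_sum]
        exact sum_congr rfl fun i _ => by ring
    _ = ν * N k ^ 2 * Kbar * (θ * Gm) * (a + 1) ^ m := by
        rw [← add_pow]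
    _ ≤ ν * N k ^ 2 * Kbar * (θ * Gm) * (2 * ampBound ν N A c k) ^ m := by
        refine mul_le_mul_of_nonneg_left (pow_le_pow_left₀ (by linarith) (by linarith) m) ?_
        exact mul_nonneg (mul_nonneg hνN hKbar0) (mul_nonneg hθ hGm0)
    _ = θ * forceBound ν N A c M k m := by
        rw [forceBound, ← hGm]
        ring

/-- **Palasek 2026, §3.3: Leibniz bounds for the force with the small factor** — for `k ≥ 3`, every
`m ≤ M` and `t ∈ [-T, 0]`:
`|g_k^{(m)}(t)| ≤ exp(-(c/4)A_{k-1}/A_{k-2}) · νN_k² K̄_{M+1} (2Λ_k)^m (κ̄_M+2)^m (m!)² Λ_{k+m}^{3^m}`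
(on `(t_k/2, 0]` the left side is `0`; on `t ≤ t_k/2` the derivatives of `x_k` carry the small
factor). [cite: Palasek2026ElementaryModel, §3.3 proof of Thm 1.3 (higher derivatives of the force)] -/
theorem abs_iteratedDerivWithin_forceTerm_le_of_three_le (hH : BarrierHypotheses A δ μ0 c)
    (hν : 0 ≤ ν) (hN0 : ∀ k, 0 ≤ N k) (hN : Monotone N) (hδ1 : ∀ k, δ k ≤ 1)
    (hratio : ∀ k, A (k + 1) / A k ≤ A (k + 2) / A (k + 1))
    (hsm : ∀ j, ContDiffOn ℝ ∞ (fun s => x s j) (Icc (-blowupT A c) 0))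
    (hode : ∀ j, ∀ t ∈ Icc (-blowupT A c) 0,
      HasDerivWithinAt (fun s => x s j) (truncRHS δ (viscCoeff ν N A c) t (x t) j)
        (Icc (-blowupT A c) 0) t)
    (hb0 : ∀ t ∈ Icc (-blowupT A c) 0, A 0 ≤ x t 0 ∧ x t 0 ≤ 2 * A 0)
    (hbd : ∀ j, 1 ≤ j → ∀ t ∈ Icc (-blowupT A c) 0,
      0 ≤ x t j ∧ x t j ≤ 2 * A j * Real.exp (A (j - 1) / 2 * max t (tk A c j)))
    (M : ℕ) {m : ℕ} (hm : m ≤ M) (hk : 3 ≤ k) (ht : t ∈ Icc (-blowupT A c) 0) :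
    |iteratedDerivWithin m (forceTerm ν N A c x k) (Icc (-blowupT A c) 0) t| ≤
      smallFactor A c k * forceBound ν N A c M k m := by
  rcases le_or_gt t (tk A c k / 2) with hts | hts
  · obtain ⟨-, H⟩ := abs_iteratedDerivWithin_solution_le hH hν hN0 hN hδ1 hratio hsm hode hb0 hbd M
    exact abs_iteratedDerivWithin_forceTerm_le_aux hH hν hN0 hN (hsm k) ht hm (Real.exp_pos _).le
      fun i hi => H i hi k hk k le_rfl t ht hts
  · rw [iteratedDerivWithin_forceTerm_eq_zero hH (by omega) hts, abs_zero]
    refine mul_nonneg (Real.exp_pos _).le ?_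
    unfold forceBound
    have h1 : 0 ≤ derivConst M + 2 := by linarith [derivConst_nonneg M]
    have h2 := one_le_ampBound hH hν (N := N) (c := c) (k + m)
    have h3 := one_le_ampBound hH hν (N := N) (c := c) k
    have h4 := derivConst_nonneg (M + 1)
    positivity

/-- **Leibniz bounds for the force, all modes `k ≥ 1`** (no small factor; used for the two modes
`k = 1, 2` whose cut-off acts on `[-T, -T/2]`): `|g_k^{(m)}(t)| ≤ νN_k² K̄ (2Λ_k)^m (κ̄+2)^m (m!)² Λ_{k+m}^{3^m}`.
[cite: Palasek2026ElementaryModel, §3.3 proof of Thm 1.3 (higher derivatives of the force)] -/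
theorem abs_iteratedDerivWithin_forceTerm_le (hH : BarrierHypotheses A δ μ0 c)
    (hν : 0 ≤ ν) (hN0 : ∀ k, 0 ≤ N k) (hN : Monotone N) (hδ1 : ∀ k, δ k ≤ 1)
    (hratio : ∀ k, A (k + 1) / A k ≤ A (k + 2) / A (k + 1))
    (hsm : ∀ j, ContDiffOn ℝ ∞ (fun s => x s j) (Icc (-blowupT A c) 0))
    (hode : ∀ j, ∀ t ∈ Icc (-blowupT A c) 0,
      HasDerivWithinAt (fun s => x s j) (truncRHS δ (viscCoeff ν N A c) t (x t) j)
        (Icc (-blowupT A c) 0) t)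
    (hb0 : ∀ t ∈ Icc (-blowupT A c) 0, A 0 ≤ x t 0 ∧ x t 0 ≤ 2 * A 0)
    (hbd : ∀ j, 1 ≤ j → ∀ t ∈ Icc (-blowupT A c) 0,
      0 ≤ x t j ∧ x t j ≤ 2 * A j * Real.exp (A (j - 1) / 2 * max t (tk A c j)))
    (M : ℕ) {m : ℕ} (hm : m ≤ M) (k : ℕ) (ht : t ∈ Icc (-blowupT A c) 0) :
    |iteratedDerivWithin m (forceTerm ν N A c x k) (Icc (-blowupT A c) 0) t| ≤
      forceBound ν N A c M k m := by
  obtain ⟨H, -⟩ := abs_iteratedDerivWithin_solution_le hH hν hN0 hN hδ1 hratio hsm hode hb0 hbd M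
  have h := abs_iteratedDerivWithin_forceTerm_le_aux hH hν hN0 hN (hsm k) ht hm zero_le_one
    fun i hi => by rw [one_mul]; exact H i hi k t ht
  rwa [one_mul] at h

end Force

end PalasekObukhov

end Literature.Analysis.FluidPDE

/-!
## Part 5 (Rescaling).
Palasek 2026, §3: back to the physical variables — `X_k = N_k^{-α} x_k`, time shift, zero extension

S. Palasek, arXiv:2605.13827 (2026), §3 (p. 8: "consider the rescaled unknown `X_k = N_k^{-α}x_k` …
`g_k ≔ N_k^α f_k` … By translation, we construct a blow-up at `t = 0` from data at `t = -T`";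
p. 11: "Since each `f_k` vanishes in a neighborhood of `t = 0`, we may extend it by `0`"). Seventh
block of the discharge of `Literature.Analysis.FluidPDE.Palasek2026_viscousBlowup` (plan: cell
`pub/ns-blowup`, `lit/PALASEK-FORMALISATION.md` §6 (v)): from a regular solution `x` of the cut-off
system on `[-T, 0]` (`PalasekObukhovRegularity`, `PalasekObukhovForce`) it builds the physical
amplitudes `X_k(t) = N_k^{-α} x_k(t - T)`, the datum `X⁰_k = N_k^{-α} x_k(-T)` and the force
`f_k(t) = N_k^{-α} g_k(t - T)` (`t ≤ T`), `0` (`t > T`), and proves the NON-asymptotic clauses of the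
target statement: the equation (l2_obukhov) on `[0, T)` in the tree's vocabulary
(`PalasekObukhov.obukhovRHS`), positivity of the datum, smoothness of every `f_k` on `[0, ∞)`, the
vanishing of `f_k` near and after `T`, the pointwise bounds, the derivative formula for `f_k`, and
the blow-up witness `N_k^s X_k(t) ≥ ¾ N_k^{β-α+s}`-type inequality on `[T + t_{k+1}, T)`. What is
left for `Palasek2026_viscousBlowup_holds` after this file is parameter asymptotics only
((exp_small)/(ratios): the weighted norms of the explicit bounds are finite and tend to `0`).
All statements are PROVED; there are no new named facts.

## Main results

* `physAmp`, `physData`, `physForce`: `X`, `X⁰`, `f`.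
* `obukhovRHS_rescale`: the algebra `N_{k-1}^α X_{k-1} X_k = N_k^{-α} x_{k-1} x_k`,
  `N_k^α X_{k+1}² = N_k^{-α} δ_k x_{k+1}²` (`δ_k = (N_k/N_{k+1})^{2α}`).
* `hasDerivWithinAt_physAmp`: (l2_obukhov) holds on `[0, T)` with the force `f`.
* `physData_pos`, `physAmp_zero_eq`; `contDiffOn_physForce_Ici`; `physForce_eq_zero_of_le`,
  `physForce_mode_zero`; `abs_physAmp_le`, `abs_physForce_le_of_three_le`;
  `iteratedDerivWithin_physForce_of_lt`, `iteratedDerivWithin_physForce_eq_zero`,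
  `abs_iteratedDerivWithin_physForce_le_of_three_le`; `blowup_witness`.
-/

open Set Filter Topology
open scoped ContDiff Pointwise

namespace Literature.Analysis.FluidPDE

namespace PalasekObukhov

/-- **The physical amplitudes `X_k(t) = N_k^{-α} x_k(t - T)`** (rescaling (X_rescaling) and the
time shift of §3). [cite: Palasek2026ElementaryModel, §3 (X_rescaling) and "By translation"] -/
noncomputable def physAmp (α : ℝ) (N A : ℕ → ℝ) (c : ℝ) (x : ℝ → ℕ → ℝ) (k : ℕ) (t : ℝ) : ℝ :=
  N k ^ (-α) * x (t - blowupT A c) k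

/-- **The datum `X⁰_k = N_k^{-α} x_k(-T)`.** [cite: Palasek2026ElementaryModel, §3 ("data at t = -T")] -/
noncomputable def physData (α : ℝ) (N A : ℕ → ℝ) (c : ℝ) (x : ℝ → ℕ → ℝ) (k : ℕ) : ℝ :=
  N k ^ (-α) * x (-blowupT A c) k

/-- **The force `f_k(t) = N_k^{-α} g_k(t - T)` for `t ≤ T`, extended by `0` beyond the blow-up time.**
[cite: Palasek2026ElementaryModel, §3 ("g_k ≔ N_k^α f_k"), §3.3 end of proof of Thm 1.3 ("extend it by 0")] -/
noncomputable def physForce (ν α : ℝ) (N A : ℕ → ℝ) (c : ℝ) (x : ℝ → ℕ → ℝ) (k : ℕ) (t : ℝ) : ℝ :=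
  if t ≤ blowupT A c then N k ^ (-α) * forceTerm ν N A c x k (t - blowupT A c) else 0

section Rescaling

variable {ν α : ℝ} {N A δ : ℕ → ℝ} {μ0 c : ℝ} {x : ℝ → ℕ → ℝ} {k : ℕ} {t : ℝ}

/-- **The rescaling algebra**: with `X_j = N_j^{-α} z_j`, `δ_k = (N_k/N_{k+1})^{2α}` and a force
`N_k^{-α} g`, the right-hand side (l2_obukhov) equals `N_k^{-α}` times the rescaled one
(x_system_nondimensionalized). [cite: Palasek2026ElementaryModel, §3 (X_rescaling)–(delta_def)] -/
theorem obukhovRHS_rescale (hN : ∀ j, 0 < N j) (hδ : δ k = (N k / N (k + 1)) ^ (2 * α))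
    (z : ℕ → ℝ) (g : ℝ) :
    obukhovRHS ν α N (fun j => N j ^ (-α) * z j) (N k ^ (-α) * g) k =
      N k ^ (-α) * (-(ν * N k ^ 2) * z k + (if k = 0 then 0 else z (k - 1) * z k) -
        δ k * z (k + 1) ^ 2 + g) := by
  have h1 : N (k - 1) ^ α * N (k - 1) ^ (-α) = 1 := by
    rw [Real.rpow_neg (hN _).le, mul_inv_cancel₀ (Real.rpow_pos_of_pos (hN _) α).ne']
  have h2 : N k ^ α * (N (k + 1) ^ (-α)) ^ 2 = N k ^ (-α) * δ k := by
    have e1 : (N (k + 1) ^ (-α)) ^ 2 = N (k + 1) ^ (-(2 * α)) := by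
      rw [← Real.rpow_two, ← Real.rpow_mul (hN _).le]
      ring_nf
    have e2 : δ k = N k ^ (2 * α) * N (k + 1) ^ (-(2 * α)) := by
      rw [hδ, Real.div_rpow (hN _).le (hN _).le, Real.rpow_neg (hN _).le, div_eq_mul_inv]
    have e3 : N k ^ (-α) * N k ^ (2 * α) = N k ^ α := by
      rw [← Real.rpow_add (hN k)]
      ring_nf
    rw [e1, e2, ← mul_assoc, e3]
  unfold obukhovRHS
  split_ifs with hk
  · linear_combination -(z (k + 1) ^ 2) * h2
  · linear_combination (z (k - 1) * (N k ^ (-α) * z k)) * h1 - z (k + 1) ^ 2 * h2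

/-- `X_k(0) = X⁰_k`. [cite: Palasek2026ElementaryModel, §3 ("data at t = -T")] -/
theorem physAmp_zero_eq (α : ℝ) (N A : ℕ → ℝ) (c : ℝ) (x : ℝ → ℕ → ℝ) (k : ℕ) :
    physAmp α N A c x k 0 = physData α N A c x k := by
  simp [physAmp, physData]

/-- Below the blow-up time the force is the rescaled, shifted `g_k`. [cite: Palasek2026ElementaryModel, §3 ("g_k ≔ N_k^α f_k")] -/
theorem physForce_of_le (ht : t ≤ blowupT A c) :
    physForce ν α N A c x k t = N k ^ (-α) * forceTerm ν N A c x k (t - blowupT A c) := by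
  rw [physForce, if_pos ht]

/-- After the blow-up time the force is `0`. [cite: Palasek2026ElementaryModel, §3.3 ("extend it by 0")] -/
theorem physForce_of_gt (ht : blowupT A c < t) : physForce ν α N A c x k t = 0 := by
  rw [physForce, if_neg (not_le.2 ht)]

/-- `f₀ ≡ 0`. [cite: Palasek2026ElementaryModel, §3.3 proof of Thm 1.3 ("g₀(t) = 0")] -/
@[simp] theorem physForce_mode_zero (ν α : ℝ) (N A : ℕ → ℝ) (c : ℝ) (x : ℝ → ℕ → ℝ) (t : ℝ) :
    physForce ν α N A c x 0 t = 0 := by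
  unfold physForce
  split_ifs <;> simp

/-- **`f_k` vanishes on `[T + t_k/2, ∞)`** ("each `f_k` vanishes in a neighborhood of" the blow-up
time; `k ≥ 1`). [cite: Palasek2026ElementaryModel, §3.3 end of proof of Thm 1.3] -/
theorem physForce_eq_zero_of_le (hH : BarrierHypotheses A δ μ0 c) (hk : 1 ≤ k)
    (ht : blowupT A c + tk A c k / 2 ≤ t) : physForce ν α N A c x k t = 0 := by
  unfold physForce
  split_ifs with h
  · rw [forceTerm_eq_zero_of_le hH hk (by linarith), mul_zero]
  · rfl

/-- **(l2_obukhov) holds on `[0, T)`**: `X_k' = -νN_k²X_k + N_{k-1}^αX_{k-1}X_k - N_k^αX_{k+1}² + f_k`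
(derivative within `[0, T)`), for the rescaled, shifted regular solution.
[cite: Palasek2026ElementaryModel, §3 (x_system_nondimensionalized) ⇔ (l2_obukhov); §3.3 proof of Thm 1.3] -/
theorem hasDerivWithinAt_physAmp (hN : ∀ j, 0 < N j) (hδ : ∀ k, δ k = (N k / N (k + 1)) ^ (2 * α))
    (hode : ∀ j, ∀ s ∈ Icc (-blowupT A c) 0,
      HasDerivWithinAt (fun r => x r j) (truncRHS δ (viscCoeff ν N A c) s (x s) j)
        (Icc (-blowupT A c) 0) s)
    (k : ℕ) (ht : t ∈ Ico 0 (blowupT A c)) :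
    HasDerivWithinAt (physAmp α N A c x k)
      (obukhovRHS ν α N (fun j => physAmp α N A c x j t) (physForce ν α N A c x k t) k)
      (Ico 0 (blowupT A c)) t := by
  set T := blowupT A c with hT
  have hs : t - T ∈ Icc (-T) 0 := ⟨by linarith [ht.1], by linarith [ht.2]⟩
  have hshift : HasDerivWithinAt (fun r : ℝ => r - T) 1 (Ico 0 T) t :=
    (hasDerivWithinAt_id t _).sub_const T
  have hmaps : MapsTo (fun r : ℝ => r - T) (Ico 0 T) (Icc (-T) 0) := fun r hr =>
    ⟨by linarith [hr.1], by linarith [hr.2]⟩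
  have hcomp := ((hode k (t - T) hs).comp t hshift hmaps).const_mul (N k ^ (-α))
  rw [mul_one] at hcomp
  have heq : (fun r => N k ^ (-α) * ((fun r => x r k) ∘ fun r : ℝ => r - T) r) =
      physAmp α N A c x k := by
    funext r
    simp [physAmp, hT]
  rw [heq] at hcomp
  refine hcomp.congr_deriv ?_
  rw [physForce_of_le ht.2.le, truncRHS_viscCoeff_eq]
  unfold physAmp forceTerm
  rw [obukhovRHS_rescale hN (hδ k)]

/-- **The datum is positive**: `X⁰_k = N_k^{-α}x_k(-T) > 0` (from `x₀ ≥ A₀`, `x₁ ≥ ¾A₁` on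
`[t₂, 0] = [-T, 0]`, `x_k ≥ A_k e^{-5A_{k-1}/A_{k-2}}`). [cite: Palasek2026ElementaryModel, §1.2 Thm 1.3 ("X⁰ with positive components"), §3.1 Lemma 3.2] -/
theorem physData_pos (hH : BarrierHypotheses A δ μ0 c) (hN : ∀ j, 0 < N j)
    (hb0 : ∀ s ∈ Icc (-blowupT A c) 0, A 0 ≤ x s 0 ∧ x s 0 ≤ 2 * A 0)
    (h34 : ∀ n, 1 ≤ n → ∀ s ∈ Icc (tk A c (n + 1)) 0, 3 / 4 * A n ≤ x s n)
    (hglob : ∀ n, 2 ≤ n → ∀ s ∈ Icc (-blowupT A c) 0,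
      A n * Real.exp (-(5 * (A (n - 1) / A (n - 2)))) ≤ x s n) (k : ℕ) :
    0 < physData α N A c x k := by
  unfold physData
  refine mul_pos (Real.rpow_pos_of_pos (hN k) _) ?_
  have hT := hH.blowupT_pos
  have hmem : -blowupT A c ∈ Icc (-blowupT A c) 0 := ⟨le_rfl, by linarith⟩
  rcases Nat.eq_zero_or_pos k with rfl | hk
  · exact (hH.A_pos 0).trans_le (hb0 _ hmem).1
  rcases Nat.lt_or_ge k 2 with hk2 | hk2
  · have hk1 : k = 1 := by omega
    subst hk1
    have h := h34 1 le_rfl (-blowupT A c) ⟨by rw [tk_of_le_two (by norm_num)], by linarith⟩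
    linarith [hH.A_pos 1]
  · exact (mul_pos (hH.A_pos k) (Real.exp_pos _)).trans_le (hglob k hk2 _ hmem)

/-- **Every `f_k` is `C^∞` on `[0, ∞)`** (smooth on `[0, T]`, vanishing on `[T + t_k/2, T]`, zero
beyond). [cite: Palasek2026ElementaryModel, §3.3 end of proof of Thm 1.3 ("extend it by 0 to obtain f ∈ C_t^∞([-T,∞); 𝒞^∞)")] -/
theorem contDiffOn_physForce_Ici (hH : BarrierHypotheses A δ μ0 c)
    (hsm : ∀ j, ContDiffOn ℝ ∞ (fun s => x s j) (Icc (-blowupT A c) 0)) (k : ℕ) :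
    ContDiffOn ℝ ∞ (physForce ν α N A c x k) (Ici 0) := by
  set T := blowupT A c with hT
  have hTpos : 0 < T := hH.blowupT_pos
  set g : ℝ → ℝ := fun t => N k ^ (-α) * forceTerm ν N A c x k (t - T) with hg
  have heq : physForce ν α N A c x k = fun t => if t ≤ T then g t else 0 := by
    funext t
    rfl
  rw [heq]
  have hmaps : MapsTo (fun r : ℝ => r - T) (Icc 0 T) (Icc (-T) 0) := fun r hr =>
    ⟨by linarith [hr.1], by linarith [hr.2]⟩
  have hgs : ContDiffOn ℝ ∞ g (Icc 0 T) :=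
    contDiffOn_const.mul (((contDiffOn_forceTerm (hsm k)).comp
      (contDiffOn_id.sub contDiffOn_const) hmaps))
  rcases Nat.eq_zero_or_pos k with rfl | hk
  · refine Literature.Analysis.ODE.contDiffOn_Ici_zeroExtension (τ := T) hTpos hgs fun s _ => ?_
    simp [hg]
  · have hτ : 0 < -(tk A c k / 2) := by linarith [hH.tk_neg k]
    refine Literature.Analysis.ODE.contDiffOn_Ici_zeroExtension hτ hgs fun s hs => ?_
    simp only [hg]
    rw [forceTerm_eq_zero_of_le hH hk (by linarith [hs.1]), mul_zero]

/-- **Pointwise bounds for the amplitudes** on `[0, T]`: `0 ≤ X_k(t) ≤ 2A_kN_k^{-α}exp(½A_{k-1}max{t-T,t_k})`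
(`k ≥ 1`), `A₀N₀^{-α} ≤ X₀ ≤ 2A₀N₀^{-α}`. [cite: Palasek2026ElementaryModel, §3.3 proof of Thm 1.3 (sol_bounds), (final_bounds)] -/
theorem physAmp_bounds (hN : ∀ j, 0 < N j)
    (hb0 : ∀ s ∈ Icc (-blowupT A c) 0, A 0 ≤ x s 0 ∧ x s 0 ≤ 2 * A 0)
    (hbd : ∀ j, 1 ≤ j → ∀ s ∈ Icc (-blowupT A c) 0,
      0 ≤ x s j ∧ x s j ≤ 2 * A j * Real.exp (A (j - 1) / 2 * max s (tk A c j)))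
    (ht : t ∈ Icc 0 (blowupT A c)) :
    (A 0 * N 0 ^ (-α) ≤ physAmp α N A c x 0 t ∧ physAmp α N A c x 0 t ≤ 2 * A 0 * N 0 ^ (-α)) ∧
      ∀ k, 1 ≤ k → 0 ≤ physAmp α N A c x k t ∧ physAmp α N A c x k t ≤
        2 * A k * N k ^ (-α) * Real.exp (A (k - 1) / 2 * max (t - blowupT A c) (tk A c k)) := by
  have hs : t - blowupT A c ∈ Icc (-blowupT A c) 0 := ⟨by linarith [ht.1], by linarith [ht.2]⟩
  unfold physAmp
  refine ⟨?_, fun k hk => ?_⟩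
  · have h := hb0 _ hs
    have hp := Real.rpow_pos_of_pos (hN 0) (-α)
    constructor <;> nlinarith [h.1, h.2]
  · have h := hbd k hk _ hs
    have hp := Real.rpow_pos_of_pos (hN k) (-α)
    constructor
    · exact mul_nonneg hp.le h.1
    · nlinarith [h.2]

/-- **Pointwise bound for the force with the small factor** (`k ≥ 3`, all `t`):
`|f_k(t)| ≤ N_k^{-α} νN_k² 2A_k exp(-(c/4)A_{k-1}/A_{k-2})` (on its support `t - T ≤ t_k/2` one has
`max{t-T, t_k} ≤ t_k/2`). [cite: Palasek2026ElementaryModel, §3.3 proof of Thm 1.3 (first display: "sup_{t ≤ t_k/2} N_k²x_k(t) ≤ 2N_k²A_k exp(-(c/4)A_{k-1}/A_{k-2})")] -/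
theorem abs_physForce_le_of_three_le (hH : BarrierHypotheses A δ μ0 c) (hν : 0 ≤ ν)
    (hN : ∀ j, 0 < N j)
    (hbd : ∀ j, 1 ≤ j → ∀ s ∈ Icc (-blowupT A c) 0,
      0 ≤ x s j ∧ x s j ≤ 2 * A j * Real.exp (A (j - 1) / 2 * max s (tk A c j)))
    (hk : 3 ≤ k) (ht : 0 ≤ t) :
    |physForce ν α N A c x k t| ≤
      N k ^ (-α) * (ν * N k ^ 2) * (2 * A k) * smallFactor A c k := by
  have hp := Real.rpow_pos_of_pos (hN k) (-α)
  have hνN : 0 ≤ ν * N k ^ 2 := mul_nonneg hν (sq_nonneg _)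
  have hA := (hH.A_pos k).le
  have hrhs : 0 ≤ N k ^ (-α) * (ν * N k ^ 2) * (2 * A k) * smallFactor A c k :=
    mul_nonneg (mul_nonneg (mul_nonneg hp.le hνN) (by linarith)) (Real.exp_pos _).le
  by_cases hle : t ≤ blowupT A c
  · rcases le_or_gt (blowupT A c + tk A c k / 2) t with hsupp | hsupp
    · rw [physForce_eq_zero_of_le hH (by omega) hsupp, abs_zero]
      exact hrhs
    · rw [physForce_of_le hle]
      have hs : t - blowupT A c ∈ Icc (-blowupT A c) 0 := ⟨by linarith, by linarith⟩
      have hx := hbd k (by omega) _ hs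
      have hg0 : 0 ≤ forceTerm ν N A c x k (t - blowupT A c) := forceTerm_nonneg hν hx.1
      rw [abs_of_nonneg (mul_nonneg hp.le hg0),
        show N k ^ (-α) * (ν * N k ^ 2) * (2 * A k) * smallFactor A c k =
          N k ^ (-α) * (ν * N k ^ 2 * (2 * A k) * smallFactor A c k) by ring]
      refine mul_le_mul_of_nonneg_left ?_ hp.le
      refine (forceTerm_le hν hx.1).trans ?_
      -- `x_k(t-T) ≤ 2A_k θ_k` since `max{t-T, t_k} ≤ t_k/2`
      have hmax : max (t - blowupT A c) (tk A c k) ≤ tk A c k / 2 :=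
        max_le (by linarith) (by linarith [hH.tk_neg k])
      have hexp : Real.exp (A (k - 1) / 2 * max (t - blowupT A c) (tk A c k)) ≤ smallFactor A c k := by
        unfold smallFactor
        refine Real.exp_le_exp.2 ?_
        have hA1 : 0 ≤ A (k - 1) / 2 := by linarith [hH.A_pos (k - 1)]
        have h1 := mul_le_mul_of_nonneg_left hmax hA1
        have htk : tk A c k = -(c / A (k - 2)) := rfl
        have h2 : A (k - 1) / 2 * (tk A c k / 2) = -(c / 4 * (A (k - 1) / A (k - 2))) := by
          rw [htk]
          ring
        linarith
      calc ν * N k ^ 2 * x (t - blowupT A c) k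
          ≤ ν * N k ^ 2 * (2 * A k * Real.exp (A (k - 1) / 2 * max (t - blowupT A c) (tk A c k))) :=
            mul_le_mul_of_nonneg_left hx.2 hνN
        _ ≤ ν * N k ^ 2 * (2 * A k * smallFactor A c k) :=
            mul_le_mul_of_nonneg_left (mul_le_mul_of_nonneg_left hexp (by linarith)) hνN
        _ = ν * N k ^ 2 * (2 * A k) * smallFactor A c k := by ring
  · rw [physForce_of_gt (not_le.1 hle), abs_zero]
    exact hrhs

/-- **Derivatives of `f_k` below `T`**: `f_k^{(m)}(t) = N_k^{-α} g_k^{(m)}(t - T)` (derivatives of `f_k`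
within `[0, ∞)`, of `g_k` within `[-T, 0]`). [cite: Palasek2026ElementaryModel, §3.3 end of proof of Thm 1.3] -/
theorem iteratedDerivWithin_physForce_of_lt (ht : t < blowupT A c) (m : ℕ) :
    iteratedDerivWithin m (physForce ν α N A c x k) (Ici 0) t =
      N k ^ (-α) * iteratedDerivWithin m (forceTerm ν N A c x k) (Icc (-blowupT A c) 0)
        (t - blowupT A c) := by
  set T := blowupT A c with hT
  have heq : physForce ν α N A c x k =
      fun s => if s ≤ T then (fun r => N k ^ (-α) * forceTerm ν N A c x k (r - T)) s else 0 := by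
    funext s
    rfl
  have hset : -T +ᵥ Icc (0 : ℝ) T = Icc (-T) 0 := by
    simp [Set.vadd_Icc]
  rw [heq, Literature.Analysis.ODE.iteratedDerivWithin_zeroExtension_of_lt ht,
    iteratedDerivWithin_const_mul_field,
    iteratedDerivWithin_comp_sub_const (f := forceTerm ν N A c x k) (n := m) (s := Icc 0 T) T, hset]

/-- **Derivatives of `f_k` vanish on `(T + t_k/2, ∞)`** (`k ≥ 1`; within `[0, ∞)`).
[cite: Palasek2026ElementaryModel, §3.3 end of proof of Thm 1.3] -/
theorem iteratedDerivWithin_physForce_eq_zero (hH : BarrierHypotheses A δ μ0 c) (hk : 1 ≤ k)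
    (ht : blowupT A c + tk A c k / 2 < t) (m : ℕ) :
    iteratedDerivWithin m (physForce ν α N A c x k) (Ici 0) t = 0 := by
  set T := blowupT A c with hT
  have heq : physForce ν α N A c x k =
      fun s => if s ≤ T then (fun r => N k ^ (-α) * forceTerm ν N A c x k (r - T)) s else 0 := by
    funext s
    rfl
  rw [heq]
  refine Literature.Analysis.ODE.iteratedDerivWithin_zeroExtension_eq_zero (τ := -(tk A c k / 2))
    (fun s hs => ?_) (by linarith) m
  rw [forceTerm_eq_zero_of_le hH hk (by linarith [hs.1]), mul_zero]

/-- **Derivative bounds for `f_k` on `[0, ∞)` with the small factor** (`k ≥ 3`, `m ≤ M`):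
`|f_k^{(m)}(t)| ≤ N_k^{-α} θ_k · forceBound`. [cite: Palasek2026ElementaryModel, §3.3 proof of Thm 1.3 (higher derivatives of the force)] -/
theorem abs_iteratedDerivWithin_physForce_le_of_three_le (hH : BarrierHypotheses A δ μ0 c)
    (hν : 0 ≤ ν) (hN : ∀ j, 0 < N j) (hNm : Monotone N) (hδ1 : ∀ k, δ k ≤ 1)
    (hratio : ∀ k, A (k + 1) / A k ≤ A (k + 2) / A (k + 1))
    (hsm : ∀ j, ContDiffOn ℝ ∞ (fun s => x s j) (Icc (-blowupT A c) 0))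
    (hode : ∀ j, ∀ s ∈ Icc (-blowupT A c) 0,
      HasDerivWithinAt (fun r => x r j) (truncRHS δ (viscCoeff ν N A c) s (x s) j)
        (Icc (-blowupT A c) 0) s)
    (hb0 : ∀ s ∈ Icc (-blowupT A c) 0, A 0 ≤ x s 0 ∧ x s 0 ≤ 2 * A 0)
    (hbd : ∀ j, 1 ≤ j → ∀ s ∈ Icc (-blowupT A c) 0,
      0 ≤ x s j ∧ x s j ≤ 2 * A j * Real.exp (A (j - 1) / 2 * max s (tk A c j)))
    (M : ℕ) {m : ℕ} (hm : m ≤ M) (hk : 3 ≤ k) (ht : 0 ≤ t) :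
    |iteratedDerivWithin m (physForce ν α N A c x k) (Ici 0) t| ≤
      N k ^ (-α) * (smallFactor A c k * forceBound ν N A c M k m) := by
  have hp := Real.rpow_pos_of_pos (hN k) (-α)
  rcases lt_or_ge t (blowupT A c) with hlt | hge
  · rw [iteratedDerivWithin_physForce_of_lt hlt, abs_mul, abs_of_pos hp]
    refine mul_le_mul_of_nonneg_left ?_ hp.le
    exact abs_iteratedDerivWithin_forceTerm_le_of_three_le hH hν (fun j => (hN j).le) hNm hδ1 hratio
      hsm hode hb0 hbd M hm hk ⟨by linarith, by linarith⟩
  · rw [iteratedDerivWithin_physForce_eq_zero hH (by omega) (by linarith [hH.tk_neg k]) m, abs_zero]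
    refine mul_nonneg hp.le (mul_nonneg (Real.exp_pos _).le ?_)
    unfold forceBound
    have h1 : 0 ≤ derivConst M + 2 := by linarith [derivConst_nonneg M]
    have h2 := one_le_ampBound hH hν (N := N) (c := c) (k + m)
    have h3 := one_le_ampBound hH hν (N := N) (c := c) k
    have h4 := derivConst_nonneg (M + 1)
    positivity

/-- **The blow-up witness**: for `k ≥ 1` and `T + t_{k+1} ≤ t ≤ T`,
`N_k^s X_k(t) ≥ ¾ A_k N_k^{s-α}` (so `‖X(t)‖_s → ∞` as `t ↑ T` once `A_k N_k^{s-α} = N_k^{β-α+s} → ∞`).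
[cite: Palasek2026ElementaryModel, §3.2 proof of Thm 1.8 ("‖X(0)‖_{𝒞^s} = sup_k N_k^{β-α+s} = ∞"), §3.1 Lemma 3.2 (eta_quarter_bound)] -/
theorem blowup_witness (hH : BarrierHypotheses A δ μ0 c) (hN : ∀ j, 0 < N j)
    (h34 : ∀ n, 1 ≤ n → ∀ s ∈ Icc (tk A c (n + 1)) 0, 3 / 4 * A n ≤ x s n)
    (hk : 1 ≤ k) (s : ℝ) (ht : t ∈ Icc (blowupT A c + tk A c (k + 1)) (blowupT A c)) :
    3 / 4 * A k * N k ^ (s - α) ≤ N k ^ s * |physAmp α N A c x k t| := by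
  have hp := Real.rpow_pos_of_pos (hN k) (-α)
  have hps := Real.rpow_pos_of_pos (hN k) s
  have hx := h34 k hk (t - blowupT A c) ⟨by linarith [ht.1], by linarith [ht.2]⟩
  have hA := hH.A_pos k
  have hx0 : 0 ≤ x (t - blowupT A c) k := by linarith
  have he : N k ^ (s - α) = N k ^ s * N k ^ (-α) := by
    rw [← Real.rpow_add (hN k)]
    ring_nf
  unfold physAmp
  rw [abs_of_nonneg (mul_nonneg hp.le hx0), he]
  nlinarith [mul_le_mul_of_nonneg_left hx (mul_pos hps hp).le]

end Rescaling

end PalasekObukhov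

end Literature.Analysis.FluidPDE

/-!
## Part 6 (Assembly).
Palasek 2026, Theorem 1.3: the assembly modulo the parameter asymptotics

S. Palasek, arXiv:2605.13827 (2026), §3.3, proof of Theorem 1.3 with Remark 1.4. Eighth block of the discharge
of `Literature.Analysis.FluidPDE.Palasek2026_viscousBlowup` (plan: cell `pub/ns-blowup`,
`lit/PALASEK-FORMALISATION.md` §6–§7): for scales `N_k = N₀^{b^k}` and ANY amplitude/parameter data
`(A_k, δ_k, c, μ₀)` satisfying the standing inequalities `BarrierHypotheses` (+ the viscous bound,
`δ_k = (N_k/N_{k+1})^{2α} ≤ 1`, non-decreasing ratios `A_{k+1}/A_k`) and the four ASYMPTOTIC facts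
which the source obtains from (exp_small) — boundedness of the weighted amplitude bounds, of the
weighted force-derivative bounds, decay of the weighted force bound, and unboundedness of
`A_k N_k^{s-α}` — the conclusion of Theorem 1.3 / Remark 1.4 holds for `(N₀, b)`: there are a
positive datum `X⁰ ∈ 𝒞^∞`, a force `f ∈ C_t^∞([0,∞); 𝒞^∞)` and a solution on `[0, T)` which blows up
in `𝒞^s` at `T` while `‖f(t)‖_σ → 0`. The remaining step of the discharge is thus the choice of
`b, β, c, N₀` and the verification of these finitely many asymptotic facts for `A_k = N_k^β`.
All statements are PROVED; there are no new named facts.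

## Main results

* `abs_iteratedDerivWithin_physForce_le`: derivative bounds for `f_k`, all `k ≥ 1` (no small factor).
* `viscousBlowup_of_hypotheses`: Theorem 1.3 + Remark 1.4 for given `(N₀, b)` from the standing and
  asymptotic hypotheses.
-/

open Set Filter Topology
open scoped ContDiff ENNReal

namespace Literature.Analysis.FluidPDE

namespace PalasekObukhov

section Assembly

variable {ν α : ℝ} {N A δ : ℕ → ℝ} {μ0 c : ℝ} {x : ℝ → ℕ → ℝ} {k : ℕ} {t : ℝ}

/-- **Derivative bounds for `f_k` on `[0, ∞)`, all modes `k ≥ 1`** (no small factor; used for the two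
modes `k = 1, 2`). [cite: Palasek2026ElementaryModel, §3.3 proof of Thm 1.3 (higher derivatives of the force)] -/
theorem abs_iteratedDerivWithin_physForce_le (hH : BarrierHypotheses A δ μ0 c)
    (hν : 0 ≤ ν) (hN : ∀ j, 0 < N j) (hNm : Monotone N) (hδ1 : ∀ k, δ k ≤ 1)
    (hratio : ∀ k, A (k + 1) / A k ≤ A (k + 2) / A (k + 1))
    (hsm : ∀ j, ContDiffOn ℝ ∞ (fun s => x s j) (Icc (-blowupT A c) 0))
    (hode : ∀ j, ∀ s ∈ Icc (-blowupT A c) 0,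
      HasDerivWithinAt (fun r => x r j) (truncRHS δ (viscCoeff ν N A c) s (x s) j)
        (Icc (-blowupT A c) 0) s)
    (hb0 : ∀ s ∈ Icc (-blowupT A c) 0, A 0 ≤ x s 0 ∧ x s 0 ≤ 2 * A 0)
    (hbd : ∀ j, 1 ≤ j → ∀ s ∈ Icc (-blowupT A c) 0,
      0 ≤ x s j ∧ x s j ≤ 2 * A j * Real.exp (A (j - 1) / 2 * max s (tk A c j)))
    (M : ℕ) {m : ℕ} (hm : m ≤ M) (hk : 1 ≤ k) (ht : 0 ≤ t) :
    |iteratedDerivWithin m (physForce ν α N A c x k) (Ici 0) t| ≤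
      N k ^ (-α) * forceBound ν N A c M k m := by
  have hp := Real.rpow_pos_of_pos (hN k) (-α)
  rcases lt_or_ge t (blowupT A c) with hlt | hge
  · rw [iteratedDerivWithin_physForce_of_lt hlt, abs_mul, abs_of_pos hp]
    refine mul_le_mul_of_nonneg_left ?_ hp.le
    exact abs_iteratedDerivWithin_forceTerm_le hH hν (fun j => (hN j).le) hNm hδ1 hratio
      hsm hode hb0 hbd M hm k ⟨by linarith, by linarith⟩
  · rw [iteratedDerivWithin_physForce_eq_zero hH hk (by linarith [hH.tk_neg k]) m, abs_zero]
    refine mul_nonneg hp.le ?_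
    unfold forceBound
    have h1 : 0 ≤ derivConst M + 2 := by linarith [derivConst_nonneg M]
    have h2 := one_le_ampBound hH hν (N := N) (c := c) (k + m)
    have h3 := one_le_ampBound hH hν (N := N) (c := c) k
    have h4 := derivConst_nonneg (M + 1)
    positivity

end Assembly

section Main

variable {ν α s N₀ b c μ0 : ℝ} {A δ : ℕ → ℝ}

/-- **Palasek 2026, Theorem 1.3 with Remark 1.4, assembled modulo the parameter asymptotics.**
For scales `N_k = N₀^{b^k}` (`N₀, b > 1`), `ν > 0`, and amplitude data satisfying the standing
inequalities of §3.1 (`BarrierHypotheses`, the viscous bound `νN_k² ≤ ¼A_{k-1}`,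
`δ_k = (N_k/N_{k+1})^{2α} ≤ 1`, non-decreasing `A_{k+1}/A_k`) together with the four consequences of
(exp_small) used on p. 10–11 — (hX) the weighted amplitude bounds `N_k^{σ-α}·2A_k e^{½A_{k-1}max{-d,t_k}}`
are bounded in `k` for every `σ` and `d > 0`; (hF) the weighted force-derivative bounds
`N_k^{σ-α} θ_k · forceBound` are bounded in `k ≥ 3`; (hF0) `N_k^{σ-α} νN_k² 2A_k θ_k → 0`; (hblow)
`A_k N_k^{s-α}` is unbounded — there exist a positive datum `X⁰ ∈ 𝒞^∞`, a force
`f ∈ C_t^∞([0,∞); 𝒞^∞)`, `T > 0` and a solution of (l2_obukhov) on `[0, T)` in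
`⋂_σ C_t([0,T); 𝒞^σ)` with `sup_{t<T} ‖X(t)‖_s = ∞` and `‖f(t)‖_σ → 0` as `t ↑ T` for every `σ`.
[cite: Palasek2026ElementaryModel, §1.2 Thm 1.3, Rem 1.4; §3.3 proof of Thm 1.3] -/
theorem viscousBlowup_of_hypotheses (hν : 0 < ν) (hN₀ : 1 < N₀) (hb : 1 < b)
    (hH : BarrierHypotheses A δ μ0 c) (hμ0 : μ0 = ν * scale N₀ b 0 ^ 2)
    (hvisc : ∀ k, 1 ≤ k → ν * scale N₀ b k ^ 2 ≤ A (k - 1) / 4)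
    (hδ : ∀ k, δ k = (scale N₀ b k / scale N₀ b (k + 1)) ^ (2 * α)) (hδ1 : ∀ k, δ k ≤ 1)
    (hratio : ∀ k, A (k + 1) / A k ≤ A (k + 2) / A (k + 1))
    (hX : ∀ σ d : ℝ, 0 < d → ∃ C, ∀ k, 1 ≤ k →
      scale N₀ b k ^ (σ - α) * (2 * A k) * Real.exp (A (k - 1) / 2 * max (-d) (tk A c k)) ≤ C)
    (hF : ∀ (σ : ℝ) (M m : ℕ), m ≤ M → ∃ C, ∀ k, 3 ≤ k →
      scale N₀ b k ^ (σ - α) * (smallFactor A c k * forceBound ν (scale N₀ b) A c M k m) ≤ C)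
    (hF0 : ∀ σ : ℝ, Tendsto (fun k => scale N₀ b k ^ (σ - α) * (ν * scale N₀ b k ^ 2) *
      (2 * A k) * smallFactor A c k) atTop (𝓝 0))
    (hblow : ∀ M : ℝ, ∃ k, 1 ≤ k ∧ M < 3 / 4 * A k * scale N₀ b k ^ (s - α)) :
    ∃ (X0 : ℕ → ℝ) (f X : ℕ → ℝ → ℝ) (T : ℝ), 0 < T ∧
      (∀ k, 0 < X0 k) ∧ MemSmooth (scale N₀ b) X0 ∧
      IsSmoothForce (scale N₀ b) f ∧
      IsSolutionOn ν α (scale N₀ b) f X0 X T ∧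
      (∀ M : ℝ, ∃ t ∈ Ico 0 T, ∃ k : ℕ, M < scale N₀ b k ^ s * |X k t|) ∧
      ∀ σ : ℝ, Tendsto (fun t => ⨆ k : ℕ, ENNReal.ofReal (scale N₀ b k ^ σ * |f k t|))
        (𝓝[<] T) (𝓝 0) := by
  set N : ℕ → ℝ := scale N₀ b with hNdef
  have hN : ∀ j, 0 < N j := fun j => scale_pos (by linarith) b j
  have hNm : Monotone N := monotone_nat_of_le_succ fun j => (scale_lt_scale_succ hN₀ hb j).le
  have hT := hH.blowupT_pos
  set T := blowupT A c with hTdef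
  -- the regular solution and the physical variables
  obtain ⟨x, hx0, hode, hb0, hbd, h34, hglob, hsm⟩ :=
    exists_regular_solution (N := N) hH hν.le hμ0 hvisc
  refine ⟨physData α N A c x, physForce ν α N A c x, physAmp α N A c x, T, hT,
    physData_pos hH hN hb0 h34 hglob, ?_, ?_, ?_, ?_, ?_⟩
  · -- `X⁰ ∈ 𝒞^∞`
    intro σ _
    obtain ⟨C, hC⟩ := hX σ T hT
    refine ⟨max C (N 0 ^ (σ - α) * (2 * A 0)), fun k => ?_⟩
    have h0T : (0 : ℝ) ∈ Icc 0 T := ⟨le_rfl, hT.le⟩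
    obtain ⟨hz, hpos⟩ := physAmp_bounds (α := α) (x := x) hN hb0 hbd h0T
    rw [← physAmp_zero_eq]
    have hsp : N k ^ σ * N k ^ (-α) = N k ^ (σ - α) := by
      rw [← Real.rpow_add (hN k)]
      ring_nf
    rcases Nat.eq_zero_or_pos k with rfl | hk
    · rw [abs_of_nonneg ((mul_pos (hH.A_pos 0) (Real.rpow_pos_of_pos (hN 0) _)).le.trans hz.1)]
      refine le_trans ?_ (le_max_right _ _)
      have := mul_le_mul_of_nonneg_left hz.2 (Real.rpow_pos_of_pos (hN 0) σ).le
      calc N 0 ^ σ * physAmp α N A c x 0 0 ≤ N 0 ^ σ * (2 * A 0 * N 0 ^ (-α)) := this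
        _ = N 0 ^ (σ - α) * (2 * A 0) := by rw [← hsp]; ring
    · obtain ⟨h1, h2⟩ := hpos k hk
      rw [abs_of_nonneg h1]
      refine le_trans ?_ (le_max_left _ _)
      refine le_trans ?_ (hC k hk)
      have := mul_le_mul_of_nonneg_left h2 (Real.rpow_pos_of_pos (hN k) σ).le
      refine this.trans (le_of_eq ?_)
      rw [zero_sub, ← hsp]
      ring
  · -- `f ∈ C_t^∞([0,∞); 𝒞^∞)`
    refine ⟨contDiffOn_physForce_Ici hH hsm, fun m σ T' => ?_⟩
    obtain ⟨C, hC⟩ := hF σ m m le_rfl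
    set B : ℕ → ℝ := fun k => N k ^ (σ - α) * forceBound ν N A c m k m with hB
    refine ⟨max (max C 0) (max (B 1) (B 2)), fun t ht k => ?_⟩
    have hsp : N k ^ σ * N k ^ (-α) = N k ^ (σ - α) := by
      rw [← Real.rpow_add (hN k)]
      ring_nf
    have hσ := (Real.rpow_pos_of_pos (hN k) σ).le
    rcases Nat.eq_zero_or_pos k with rfl | hk
    · have h0 : physForce ν α N A c x 0 = fun _ => (0 : ℝ) := funext fun s => physForce_mode_zero ..
      rw [h0, iteratedDerivWithin_const]
      simp
    rcases Nat.lt_or_ge k 3 with hk3 | hk3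
    · have h := abs_iteratedDerivWithin_physForce_le (α := α) hH hν.le hN hNm hδ1 hratio hsm hode
        hb0 hbd m le_rfl hk ht.1
      have h' : N k ^ σ * |iteratedDerivWithin m (physForce ν α N A c x k) (Ici 0) t| ≤ B k := by
        refine (mul_le_mul_of_nonneg_left h hσ).trans (le_of_eq ?_)
        show N k ^ σ * (N k ^ (-α) * forceBound ν N A c m k m) = N k ^ (σ - α) * forceBound ν N A c m k m
        rw [← hsp]
        ring
      refine h'.trans (le_trans ?_ (le_max_right _ _))
      interval_cases k
      · exact le_max_left _ _
      · exact le_max_right _ _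
    · have h := abs_iteratedDerivWithin_physForce_le_of_three_le (α := α) hH hν.le hN hNm hδ1 hratio
        hsm hode hb0 hbd m le_rfl hk3 ht.1
      have h' : N k ^ σ * |iteratedDerivWithin m (physForce ν α N A c x k) (Ici 0) t| ≤ C := by
        refine (mul_le_mul_of_nonneg_left h hσ).trans (le_trans (le_of_eq ?_) (hC k hk3))
        rw [← hsp]
        ring
      exact h'.trans ((le_max_left _ _).trans (le_max_left _ _))
  · -- the solution on `[0, T)`
    refine ⟨fun k => physAmp_zero_eq α N A c x k,
      fun k t ht => hasDerivWithinAt_physAmp hN hδ hode k ht, fun σ T' _ hT'T => ?_⟩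
    have hd : 0 < T - T' := by linarith
    obtain ⟨C, hC⟩ := hX σ (T - T') hd
    refine ⟨max C (N 0 ^ (σ - α) * (2 * A 0)), fun t ht k => ?_⟩
    have htT : t ∈ Icc 0 T := ⟨ht.1, by linarith [ht.2]⟩
    obtain ⟨hz, hpos⟩ := physAmp_bounds (α := α) (x := x) hN hb0 hbd htT
    have hsp : N k ^ σ * N k ^ (-α) = N k ^ (σ - α) := by
      rw [← Real.rpow_add (hN k)]
      ring_nf
    have hσ := (Real.rpow_pos_of_pos (hN k) σ).le
    rcases Nat.eq_zero_or_pos k with rfl | hk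
    · rw [abs_of_nonneg ((mul_pos (hH.A_pos 0) (Real.rpow_pos_of_pos (hN 0) _)).le.trans hz.1)]
      refine le_trans ?_ (le_max_right _ _)
      calc N 0 ^ σ * physAmp α N A c x 0 t ≤ N 0 ^ σ * (2 * A 0 * N 0 ^ (-α)) :=
            mul_le_mul_of_nonneg_left hz.2 hσ
        _ = N 0 ^ (σ - α) * (2 * A 0) := by rw [← hsp]; ring
    · obtain ⟨h1, h2⟩ := hpos k hk
      rw [abs_of_nonneg h1]
      refine le_trans ?_ ((hC k hk).trans (le_max_left _ _))
      have hmax : max (t - T) (tk A c k) ≤ max (-(T - T')) (tk A c k) :=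
        max_le_max (by linarith [ht.2]) le_rfl
      have hexp : Real.exp (A (k - 1) / 2 * max (t - T) (tk A c k)) ≤
          Real.exp (A (k - 1) / 2 * max (-(T - T')) (tk A c k)) :=
        Real.exp_le_exp.2 (mul_le_mul_of_nonneg_left hmax (by linarith [hH.A_pos (k - 1)]))
      have hA := (hH.A_pos k).le
      have hp := (Real.rpow_pos_of_pos (hN k) (-α)).le
      calc N k ^ σ * physAmp α N A c x k t
          ≤ N k ^ σ * (2 * A k * N k ^ (-α) * Real.exp (A (k - 1) / 2 * max (t - T) (tk A c k))) :=
            mul_le_mul_of_nonneg_left h2 hσ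
        _ ≤ N k ^ σ * (2 * A k * N k ^ (-α) *
              Real.exp (A (k - 1) / 2 * max (-(T - T')) (tk A c k))) := by
            refine mul_le_mul_of_nonneg_left (mul_le_mul_of_nonneg_left hexp ?_) hσ
            positivity
        _ = N k ^ (σ - α) * (2 * A k) * Real.exp (A (k - 1) / 2 * max (-(T - T')) (tk A c k)) := by
            rw [← hsp]; ring
  · -- blow-up at `T`
    intro M
    obtain ⟨k, hk, hM⟩ := hblow M
    have htk := hH.tk_neg (k + 1)
    have htkT := hH.neg_blowupT_le_tk (k + 1)
    refine ⟨T + tk A c (k + 1) / 2, ⟨by linarith, by linarith⟩, k, hM.trans_le ?_⟩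
    exact blowup_witness hH hN h34 hk s ⟨by linarith, by linarith⟩
  · -- the force has no role at the blow-up time
    intro σ
    -- clamp the time at `0` from below (the target only sees `t ∈ (0, T)`)
    set g : ℕ → ℝ → ℝ := fun k t => N k ^ σ * |physForce ν α N A c x k (max t 0)| with hg
    set b₀ : ℕ → ℝ := fun k => N k ^ (σ - α) * (ν * N k ^ 2) * (2 * A k) with hb₀
    set bseq : ℕ → ℝ := fun k =>
      if k < 3 then b₀ k else N k ^ (σ - α) * (ν * N k ^ 2) * (2 * A k) * smallFactor A c k
      with hbseq
    have hsp : ∀ k, N k ^ σ * N k ^ (-α) = N k ^ (σ - α) := fun k => by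
      rw [← Real.rpow_add (hN k)]
      ring_nf
    have hbt : Tendsto bseq atTop (𝓝 0) := by
      refine (hF0 σ).congr' ?_
      filter_upwards [eventually_ge_atTop 3] with k hk
      rw [hbseq]
      simp only [if_neg (not_lt.2 hk)]
    -- crude bound valid for all modes: `N^σ |f_k| ≤ N^{σ-α} νN² 2A_k`
    have hcrude : ∀ k (t : ℝ), 0 ≤ t → N k ^ σ * |physForce ν α N A c x k t| ≤ b₀ k := by
      intro k t ht0
      have hσ := (Real.rpow_pos_of_pos (hN k) σ).le
      have hp := Real.rpow_pos_of_pos (hN k) (-α)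
      have hνN : 0 ≤ ν * N k ^ 2 := mul_nonneg hν.le (sq_nonneg _)
      have hb₀k : 0 ≤ b₀ k := by
        have := (hH.A_pos k).le
        have := (Real.rpow_pos_of_pos (hN k) (σ - α)).le
        positivity
      rcases Nat.eq_zero_or_pos k with rfl | hk
      · simpa using hb₀k
      by_cases hle : t ≤ T
      · rw [physForce_of_le hle]
        have hs : t - T ∈ Icc (-T) 0 := ⟨by linarith, by linarith⟩
        have hxk := hbd k hk _ hs
        have hexp1 : Real.exp (A (k - 1) / 2 * max (t - T) (tk A c k)) ≤ 1 := by
          rw [Real.exp_le_one_iff]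
          have h1 : max (t - T) (tk A c k) ≤ 0 := max_le (by linarith) (hH.tk_neg k).le
          have h2 : 0 ≤ A (k - 1) / 2 := by linarith [hH.A_pos (k - 1)]
          nlinarith
        have hx2 : x (t - T) k ≤ 2 * A k := by
          have hA := (hH.A_pos k).le
          nlinarith [hxk.2]
        have hg0 := forceTerm_nonneg (N := N) (A := A) (c := c) hν.le hxk.1 (k := k)
        rw [abs_of_nonneg (mul_nonneg hp.le hg0)]
        calc N k ^ σ * (N k ^ (-α) * forceTerm ν N A c x k (t - T))
            ≤ N k ^ σ * (N k ^ (-α) * (ν * N k ^ 2 * (2 * A k))) := by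
              refine mul_le_mul_of_nonneg_left (mul_le_mul_of_nonneg_left ?_ hp.le) hσ
              exact (forceTerm_le hν.le hxk.1).trans (mul_le_mul_of_nonneg_left hx2 hνN)
          _ = b₀ k := by rw [hb₀]; simp only; rw [← hsp]; ring
      · rw [physForce_of_gt (not_le.1 hle), abs_zero, mul_zero]
        exact hb₀k
    have hmain : Tendsto (fun t => ⨆ k, ENNReal.ofReal (g k t)) (𝓝[<] T) (𝓝 0) := by
      refine Literature.Analysis.ODE.tendsto_iSup_ofReal_nhdsLT (b := bseq)
        (τ := fun k => if k = 0 then 1 else -(tk A c k / 2)) hbt (fun k t _ => ?_) (fun k => ?_)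
        (fun k t h1 h2 => ?_)
      · -- `g k t ≤ bseq k`
        have ht0 : 0 ≤ max t 0 := le_max_right _ _
        rw [hg, hbseq]
        simp only
        split_ifs with hk3
        · exact hcrude k _ ht0
        · have hk : 3 ≤ k := not_lt.1 hk3
          have h := abs_physForce_le_of_three_le (α := α) (x := x) hH hν.le hN hbd hk ht0
          refine (mul_le_mul_of_nonneg_left h (Real.rpow_pos_of_pos (hN k) σ).le).trans (le_of_eq ?_)
          rw [← hsp]
          ring
      · -- `0 < τ k`
        split_ifs with hk
        · exact one_pos
        · linarith [hH.tk_neg k]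
      · -- `g k t ≤ 0` on `(T - τ_k, T)`
        rw [hg]
        simp only
        rcases Nat.eq_zero_or_pos k with rfl | hk
        · simp
        · rw [if_neg (by omega)] at h1
          rw [physForce_eq_zero_of_le hH hk (le_max_of_le_left (by linarith)), abs_zero, mul_zero]
    refine hmain.congr' ?_
    have hmem : Ioo 0 T ∈ 𝓝[<] T := Ioo_mem_nhdsLT hT
    filter_upwards [hmem] with t ht
    simp only [hg, max_eq_left ht.1.le]

end Main

end PalasekObukhov

end Literature.Analysis.FluidPDE

/-!
## Part 7 (BlowupHolds).
Palasek 2026, Theorem 1.3: the parameter choice ((exp_small)/(ratios) made explicit) and the discharge `Palasek2026_viscousBlowup_holds`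

S. Palasek, arXiv:2605.13827 (2026), §3.1 (p. 8): "for any choice of parameters … we may take `N₀ > 1` large to
arrange that `(N_{k+i₁}/N_{k+i₂})^{c₁}(A_{k+i₃}/A_{k+i₄})^{c₂}exp(-c₃(A_{k+1}/A_k)^{c₄})` is arbitrarily
small, uniformly in `k ≥ 0`. Second, we can arrange that `A_k/A_{k-1} ≤ (c/100)A_{k+1}/A_k`. … these
statements make essential use of the fact that `(N_k)` grows faster than exponentially." Ninth and
last block of the discharge of `Literature.Analysis.FluidPDE.Palasek2026_viscousBlowup` (plan: cell
`pub/ns-blowup`, `lit/PALASEK-FORMALISATION.md` §1): with `N₀ = e^L`, `N_k = N₀^{b^k} = e^{b^kL}`,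
`A_k = N_k^β = e^{βb^kL}`, `δ_k = (N_k/N_{k+1})^{2α} = e^{-2α(b-1)b^kL}`, `c = 1/10`, every standing
inequality of `BarrierHypotheses`, the viscous bound, and the four asymptotic hypotheses of
`viscousBlowup_of_hypotheses` reduce to instances of ONE elementary fact: an affine function of `y`
is eventually below `κ e^{Qy}` (`exists_affine_le_mul_exp`), resp. `P y - κe^{Qy}` is bounded above
on `y ≥ 0` and tends to `-∞`. The file ends with the discharge `Palasek2026_viscousBlowup_holds`.
All statements are PROVED; there are no new named facts.

## Main results

* `exists_affine_le_mul_exp`, `exists_bound_affine_sub_mul_exp`: the (exp_small) mechanism.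
* `expAmp`, `expDelta`: `A_k = e^{βb^kL}`, `δ_k`; `scale_exp`: `N_k = e^{b^kL}` for `N₀ = e^L`.
* `barrierHypotheses_exp`: the standing inequalities for `L` large.
* `Palasek2026_viscousBlowup_holds`: **the discharge of the named fact.**
-/

open Set Filter Topology
open scoped ContDiff

namespace Literature.Analysis.FluidPDE

namespace PalasekObukhov

/-! ### The (exp_small) mechanism -/

/-- **An affine function is eventually dominated by `κ e^{Qy}`** (`κ, Q > 0`): there is `y₀ ≥ 0` with
`P y + C ≤ κ exp(Q y)` for `y ≥ y₀`. This is the mechanism behind (exp_small): a power of `N₀^{b^k}`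
against `exp` of a power of `N₀^{b^k}`. [cite: Palasek2026ElementaryModel, §3.1 (exp_small)] -/
theorem exists_affine_le_mul_exp (P C : ℝ) {κ Q : ℝ} (hκ : 0 < κ) (hQ : 0 < Q) :
    ∃ y₀ : ℝ, 0 ≤ y₀ ∧ ∀ y, y₀ ≤ y → P * y + C ≤ κ * Real.exp (Q * y) := by
  set D := |P| + |C| with hD
  have hD0 : 0 ≤ D := by positivity
  refine ⟨max 1 (4 * D / (κ * Q ^ 2)), le_max_of_le_left zero_le_one, fun y hy => ?_⟩
  have hy1 : 1 ≤ y := (le_max_left _ _).trans hy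
  have hy0 : 0 ≤ y := zero_le_one.trans hy1
  have hy2 : 4 * D / (κ * Q ^ 2) ≤ y := (le_max_right _ _).trans hy
  -- `exp(Qy) ≥ (1 + Qy/2)² ≥ Q²y²/4`
  have hexp : Q ^ 2 * y ^ 2 / 4 ≤ Real.exp (Q * y) := by
    have h1 : 1 + Q * y / 2 ≤ Real.exp (Q * y / 2) := by
      have := Real.add_one_le_exp (Q * y / 2)
      linarith
    have h2 : 0 ≤ 1 + Q * y / 2 := by positivity
    have h3 : (1 + Q * y / 2) ^ 2 ≤ Real.exp (Q * y / 2) ^ 2 := pow_le_pow_left₀ h2 h1 2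
    have h4 : Real.exp (Q * y / 2) ^ 2 = Real.exp (Q * y) := by
      rw [← Real.exp_nat_mul]
      ring_nf
    nlinarith
  have hκQ : 0 < κ * Q ^ 2 := by positivity
  have h5 : D ≤ κ * Q ^ 2 * y / 4 := by
    rw [div_le_iff₀ hκQ] at hy2
    linarith
  calc P * y + C ≤ |P| * y + |C| := by
        nlinarith [le_abs_self P, le_abs_self C, abs_nonneg P]
    _ ≤ D * y := by
        rw [hD]
        nlinarith [abs_nonneg C, abs_nonneg P]
    _ ≤ κ * Q ^ 2 * y / 4 * y := mul_le_mul_of_nonneg_right h5 hy0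
    _ = κ * (Q ^ 2 * y ^ 2 / 4) := by ring
    _ ≤ κ * Real.exp (Q * y) := mul_le_mul_of_nonneg_left hexp hκ.le

/-- Multiplicative form: `K e^{Py} ≤ exp(κ e^{Qy})` for `y ≥ y₀` (`K, κ, Q > 0`).
[cite: Palasek2026ElementaryModel, §3.1 (exp_small)] -/
theorem exists_mul_exp_le_exp_exp {K : ℝ} (hK : 0 < K) (P : ℝ) {κ Q : ℝ} (hκ : 0 < κ)
    (hQ : 0 < Q) :
    ∃ y₀ : ℝ, 0 ≤ y₀ ∧ ∀ y, y₀ ≤ y → K * Real.exp (P * y) ≤ Real.exp (κ * Real.exp (Q * y)) := by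
  obtain ⟨y₀, hy₀, h⟩ := exists_affine_le_mul_exp P (Real.log K) hκ hQ
  refine ⟨y₀, hy₀, fun y hy => ?_⟩
  have h1 := h y hy
  calc K * Real.exp (P * y) = Real.exp (Real.log K + P * y) := by
        rw [Real.exp_add, Real.exp_log hK]
    _ ≤ Real.exp (κ * Real.exp (Q * y)) := Real.exp_le_exp.2 (by linarith)

/-- **`P y + C - κ e^{Qy}` is bounded above on `y ≥ 0`** (`κ, Q > 0`). [cite: Palasek2026ElementaryModel, §3.1 (exp_small)] -/
theorem exists_bound_affine_sub_mul_exp (P C : ℝ) {κ Q : ℝ} (hκ : 0 < κ) (hQ : 0 < Q) :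
    ∃ B : ℝ, ∀ y, 0 ≤ y → P * y + C - κ * Real.exp (Q * y) ≤ B := by
  obtain ⟨y₀, hy₀, h⟩ := exists_affine_le_mul_exp P C hκ hQ
  refine ⟨|P| * y₀ + |C|, fun y hy => ?_⟩
  rcases le_or_gt y₀ y with hc | hc
  · have h1 := h y hc
    have : 0 ≤ |P| * y₀ + |C| := by positivity
    linarith
  · have h2 : P * y ≤ |P| * y₀ := by
      calc P * y ≤ |P| * y := by nlinarith [le_abs_self P, abs_nonneg P]
        _ ≤ |P| * y₀ := mul_le_mul_of_nonneg_left hc.le (abs_nonneg P)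
    have h3 := Real.exp_pos (Q * y)
    nlinarith [le_abs_self C]

/-- **`P y + C - κ e^{Qy} → -∞`.** [cite: Palasek2026ElementaryModel, §3.1 (exp_small)] -/
theorem tendsto_affine_sub_mul_exp_atBot (P C : ℝ) {κ Q : ℝ} (hκ : 0 < κ) (hQ : 0 < Q) :
    Tendsto (fun y => P * y + C - κ * Real.exp (Q * y)) atTop atBot := by
  rw [tendsto_atBot]
  intro M
  obtain ⟨y₀, _, h⟩ := exists_affine_le_mul_exp (P + 1) (C - M) hκ hQ
  filter_upwards [eventually_ge_atTop (max y₀ 0)] with y hy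
  have h1 := h y ((le_max_left _ _).trans hy)
  have h2 : 0 ≤ y := (le_max_right _ _).trans hy
  linarith

/-! ### The exponential parametrisation -/

/-- `A_k = e^{β b^k L}` (`= N_k^β` for `N_k = e^{b^kL}`). [cite: Palasek2026ElementaryModel, §3.1 ("A_k = N_k^β")] -/
noncomputable def expAmp (b β L : ℝ) (k : ℕ) : ℝ :=
  Real.exp (β * b ^ k * L)

/-- `δ_k = (N_k/N_{k+1})^{2α}` for `N_k = N₀^{b^k}`, `N₀ = e^L`. [cite: Palasek2026ElementaryModel, §3 (delta_def)] -/
noncomputable def expDelta (b α L : ℝ) (k : ℕ) : ℝ :=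
  (scale (Real.exp L) b k / scale (Real.exp L) b (k + 1)) ^ (2 * α)

section Param

variable {b β α L ν : ℝ}

/-- `N_k = N₀^{b^k} = e^{b^k L}` for `N₀ = e^L`. [cite: Palasek2026ElementaryModel, §1.2 (nk_choice)] -/
theorem scale_exp (L b : ℝ) (k : ℕ) : scale (Real.exp L) b k = Real.exp (b ^ k * L) := by
  rw [scale, ← Real.exp_mul, mul_comm]

/-- `δ_k = e^{-2α(b-1)b^kL}`. [cite: Palasek2026ElementaryModel, §3 (delta_def)] -/
theorem expDelta_eq (b α L : ℝ) (k : ℕ) :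
    expDelta b α L k = Real.exp (-(2 * α * (b - 1) * b ^ k * L)) := by
  rw [expDelta, scale_exp, scale_exp, ← Real.exp_sub, ← Real.exp_mul]
  ring_nf

/-- `A_k > 0`. [cite: Palasek2026ElementaryModel, §3.1] -/
theorem expAmp_pos (b β L : ℝ) (k : ℕ) : 0 < expAmp b β L k := Real.exp_pos _

/-- Ratios of amplitudes: `A_i/A_j = e^{β(b^i - b^j)L}`. [cite: Palasek2026ElementaryModel, §3.1 (ratios)] -/
theorem expAmp_div (b β L : ℝ) (i j : ℕ) :
    expAmp b β L i / expAmp b β L j = Real.exp (β * (b ^ i - b ^ j) * L) := by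
  rw [expAmp, expAmp, ← Real.exp_sub]
  ring_nf

/-- Products of amplitudes. [cite: Palasek2026ElementaryModel, §3.1] -/
theorem expAmp_mul (b β L : ℝ) (i j : ℕ) :
    expAmp b β L i * expAmp b β L j = Real.exp (β * (b ^ i + b ^ j) * L) := by
  rw [expAmp, expAmp, ← Real.exp_add]
  ring_nf

/-- `A` is non-decreasing (`b ≥ 1`, `β, L ≥ 0`). [cite: Palasek2026ElementaryModel, §3.1 ("A_k increasing")] -/
theorem expAmp_mono (hb : 1 ≤ b) (hβ : 0 ≤ β) (hL : 0 ≤ L) : Monotone (expAmp b β L) := by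
  intro i j hij
  unfold expAmp
  refine Real.exp_le_exp.2 ?_
  have : b ^ i ≤ b ^ j := pow_le_pow_right₀ hb hij
  have : β * b ^ i ≤ β * b ^ j := mul_le_mul_of_nonneg_left this hβ
  nlinarith

/-- `b^k L ≥ L` and `b^k ≥ 1`. [cite: Palasek2026ElementaryModel, §3.1] -/
theorem le_pow_mul (hb : 1 ≤ b) (hL : 0 ≤ L) (k : ℕ) : L ≤ b ^ k * L := by
  have : 1 ≤ b ^ k := one_le_pow₀ hb
  nlinarith

/-- `(e^z)² = e^{2z}`. [folklore] -/
private theorem exp_sq (z : ℝ) : Real.exp z ^ 2 = Real.exp (2 * z) := by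
  rw [← Real.exp_nat_mul]
  norm_num

/-- `K e^u ≤ e^v` once `K ≤ e^{v-u}`. [folklore] -/
private theorem mul_exp_le_exp {K u v : ℝ} (h : K ≤ Real.exp (v - u)) : K * Real.exp u ≤ Real.exp v := by
  have hu := Real.exp_pos u
  calc K * Real.exp u ≤ Real.exp (v - u) * Real.exp u := mul_le_mul_of_nonneg_right h hu.le
    _ = Real.exp v := by rw [← Real.exp_add, sub_add_cancel]

/-- `e^{1/3} ≤ 3/2` (from `e < 2.72`). [folklore] -/
private theorem exp_one_third_le : Real.exp (1 / 3) ≤ 3 / 2 := by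
  by_contra h
  rw [not_le] at h
  have h3 : Real.exp (1 / 3) ^ 3 = Real.exp 1 := by
    rw [← Real.exp_nat_mul]
    norm_num
  have h4 : (3 / 2 : ℝ) ^ 3 < Real.exp (1 / 3) ^ 3 := pow_lt_pow_left₀ h (by norm_num) (by norm_num)
  have h5 := Real.exp_one_lt_d9
  rw [h3] at h4
  norm_num at h4 h5
  linarith

/-- `b^k = b^(k-1) b` for `k ≥ 1`. [folklore] -/
private theorem pow_eq_pow_pred_mul (b : ℝ) {k : ℕ} (hk : 1 ≤ k) : b ^ k = b ^ (k - 1) * b := by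
  rw [← pow_succ]
  congr 1
  omega

/-- The consecutive ratios `A_k/A_{k-1}` are non-decreasing in `k` (with the truncated convention
`A_{0-1} = A₀`). [cite: Palasek2026ElementaryModel, §3.1 (ratios)] -/
theorem expAmp_ratio_step (hb : 1 ≤ b) (hβ : 0 ≤ β) (hL : 0 ≤ L) (k : ℕ) (hk : 1 ≤ k) :
    expAmp b β L (k - 1) / expAmp b β L (k - 2) ≤ expAmp b β L k / expAmp b β L (k - 1) := by
  rw [expAmp_div, expAmp_div]
  refine Real.exp_le_exp.2 ?_
  have hbk : ∀ n : ℕ, 0 ≤ b ^ n := fun n => pow_nonneg (zero_le_one.trans hb) n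
  have key : b ^ (k - 1) - b ^ (k - 2) ≤ b ^ k - b ^ (k - 1) := by
    rcases Nat.lt_or_ge k 2 with h2 | h2
    · have hk1 : k = 1 := by omega
      subst hk1
      norm_num
      exact hb
    · have e1 : b ^ k = b ^ (k - 2) * b ^ 2 := by rw [← pow_add]; congr 1; omega
      have e2 : b ^ (k - 1) = b ^ (k - 2) * b := by rw [← pow_succ]; congr 1; omega
      rw [e1, e2]
      have h3 : 0 ≤ b ^ (k - 2) * (b - 1) ^ 2 := mul_nonneg (hbk _) (sq_nonneg _)
      nlinarith
  have := mul_le_mul_of_nonneg_left key hβ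
  nlinarith

/-- `A_k/A_{k-1} = exp(β(b-1)b^{k-1}L)` (`k ≥ 1`). [cite: Palasek2026ElementaryModel, §3.1 (ratios)] -/
theorem expAmp_ratio_eq (b β L : ℝ) {k : ℕ} (hk : 1 ≤ k) :
    expAmp b β L k / expAmp b β L (k - 1) = Real.exp (β * (b - 1) * (b ^ (k - 1) * L)) := by
  rw [expAmp_div, pow_eq_pow_pred_mul b hk]
  ring_nf

/-- The key estimate behind S1 and S4: `4 δ_k A_{k+1}² / (A_i A_k) ≤ exp((c/2) A_k/A_{k-1})`
(`i ≤ k`, `c = 1/10`), given the largeness condition at `y = b^{k-1}L`.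
[cite: Palasek2026ElementaryModel, §3.1 (exp_small), Cases 1–2 of the proof of Lemma 3.2] -/
theorem key_exp (hb : 1 ≤ b) (hβ : 0 ≤ β) (hα : 0 ≤ α) (hL : 0 ≤ L) {k : ℕ} (i : ℕ)
    (hk : 1 ≤ k)
    (h4 : 4 * Real.exp (2 * β * b ^ 2 * (b ^ (k - 1) * L)) ≤
      Real.exp (1 / 20 * Real.exp (β * (b - 1) * (b ^ (k - 1) * L)))) :
    4 * (expDelta b α L k * expAmp b β L (k + 1) ^ 2 / (expAmp b β L i * expAmp b β L k)) ≤
      Real.exp (1 / 20 * (expAmp b β L k / expAmp b β L (k - 1))) := by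
  rw [expAmp_ratio_eq b β L hk]
  refine le_trans (mul_le_mul_of_nonneg_left ?_ (by norm_num)) h4
  rw [expDelta_eq, expAmp, expAmp, expAmp, exp_sq, ← Real.exp_add, ← Real.exp_add, ← Real.exp_sub]
  refine Real.exp_le_exp.2 ?_
  have hbk : ∀ n : ℕ, 1 ≤ b ^ n := fun n => one_le_pow₀ hb
  have e1 : b ^ (k + 1) = b ^ (k - 1) * b ^ 2 := by rw [← pow_add]; congr 1; omega
  have t1 : 0 ≤ 2 * α * (b - 1) * b ^ k * L := by
    have := hbk k
    have : 0 ≤ b - 1 := by linarith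
    positivity
  have t2 : 0 ≤ β * b ^ i * L := by have := hbk i; positivity
  have t3 : 0 ≤ β * b ^ k * L := by have := hbk k; positivity
  rw [e1]
  linarith

section Fields

/-- S1 for the exponential data (`c = 1/10`). [cite: Palasek2026ElementaryModel, §3.1 Lemma 3.2 (z_bound) Case 1] -/
theorem S1_exp (hb : 1 ≤ b) (hβ : 0 ≤ β) (hL : 0 < L) (hα : 0 ≤ α) {k : ℕ} (hk : 1 ≤ k)
    (h4 : 4 * Real.exp (2 * β * b ^ 2 * (b ^ (k - 1) * L)) ≤
      Real.exp (1 / 20 * Real.exp (β * (b - 1) * (b ^ (k - 1) * L)))) :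
    4 * expDelta b α L k * expAmp b β L (k + 1) ^ 2 * (-tk (expAmp b β L) (1 / 10) k) *
        Real.exp (expAmp b β L k * tk (expAmp b β L) (1 / 10) (k + 1)) ≤
      1 / 2 * expAmp b β L k *
        Real.exp (expAmp b β L (k - 1) / 2 * tk (expAmp b β L) (1 / 10) k) := by
  set A := expAmp b β L with hA
  set δ := expDelta b α L with hδ
  have hApos : ∀ k, 0 < A k := expAmp_pos b β L
  have htk1 : A k * tk A (1 / 10) (k + 1) = -(1 / 10 * (A k / A (k - 1))) := by
    show A k * -(1 / 10 / A (k + 1 - 2)) = _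
    rw [show k + 1 - 2 = k - 1 by omega]
    ring
  have htk : A (k - 1) / 2 * tk A (1 / 10) k = -(1 / 20 * (A (k - 1) / A (k - 2))) := by
    show A (k - 1) / 2 * -(1 / 10 / A (k - 2)) = _
    ring
  have htk0 : -tk A (1 / 10) k = 1 / 10 / A (k - 2) := by
    show -(-(1 / 10 / A (k - 2))) = _
    ring
  rw [htk1, htk, htk0]
  have hK := key_exp hb hβ hα hL.le (k - 2) hk h4
  have hAi := hApos (k - 2)
  have hAk := hApos k
  have hδ0 : 0 ≤ δ k := by rw [hδ, expDelta_eq]; exact (Real.exp_pos _).le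
  have hprod : 0 ≤ δ k * A (k + 1) ^ 2 := by positivity
  have h2 : 8 * (1 / 10) * (δ k * A (k + 1) ^ 2) ≤
      A (k - 2) * A k * Real.exp (1 / 20 * (A k / A (k - 1))) := by
    have h3 : δ k * A (k + 1) ^ 2 / (A (k - 2) * A k) * (A (k - 2) * A k) = δ k * A (k + 1) ^ 2 := by
      field_simp
    have h5 := mul_le_mul_of_nonneg_right hK (mul_pos hAi hAk).le
    rw [mul_assoc, h3] at h5
    linarith
  have hr1 : A (k - 1) / A (k - 2) ≤ A k / A (k - 1) := expAmp_ratio_step hb hβ hL.le k hk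
  have hE : Real.exp (1 / 20 * (A k / A (k - 1))) * Real.exp (-(1 / 10 * (A k / A (k - 1)))) =
      Real.exp (-(1 / 20 * (A k / A (k - 1)))) := by
    rw [← Real.exp_add]
    ring_nf
  have hexp_le : Real.exp (-(1 / 20 * (A k / A (k - 1)))) ≤
      Real.exp (-(1 / 20 * (A (k - 1) / A (k - 2)))) := Real.exp_le_exp.2 (by linarith)
  have hpos1 := Real.exp_pos (-(1 / 10 * (A k / A (k - 1))))
  calc 4 * δ k * A (k + 1) ^ 2 * (1 / 10 / A (k - 2)) * Real.exp (-(1 / 10 * (A k / A (k - 1))))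
      = (8 * (1 / 10) * (δ k * A (k + 1) ^ 2)) * Real.exp (-(1 / 10 * (A k / A (k - 1)))) *
          (1 / (2 * A (k - 2))) := by
        field_simp
        ring
    _ ≤ (A (k - 2) * A k * Real.exp (1 / 20 * (A k / A (k - 1)))) *
          Real.exp (-(1 / 10 * (A k / A (k - 1)))) * (1 / (2 * A (k - 2))) := by
        refine mul_le_mul_of_nonneg_right (mul_le_mul_of_nonneg_right h2 hpos1.le) ?_
        positivity
    _ = 1 / 2 * A k * Real.exp (-(1 / 20 * (A k / A (k - 1)))) := by
        rw [mul_assoc (A (k - 2) * A k), hE]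
        field_simp
    _ ≤ 1 / 2 * A k * Real.exp (-(1 / 20 * (A (k - 1) / A (k - 2)))) :=
        mul_le_mul_of_nonneg_left hexp_le (by linarith)

/-- S2 for the exponential data. [cite: Palasek2026ElementaryModel, §3.1 Lemma 3.2 (z_bound) Case 2] -/
theorem S2_exp (k : ℕ) (h16 : 16 ≤ Real.exp (2 * (b - 1) * (α - β) * (b ^ k * L))) :
    8 * expDelta b α L k * expAmp b β L (k + 1) ^ 2 ≤ 1 / 2 * expAmp b β L k ^ 2 := by
  have h : 16 * (expDelta b α L k * expAmp b β L (k + 1) ^ 2) ≤ expAmp b β L k ^ 2 := by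
    rw [expDelta_eq, expAmp, expAmp, exp_sq, exp_sq, ← Real.exp_add]
    refine mul_exp_le_exp (h16.trans (le_of_eq ?_))
    congr 1
    rw [pow_succ]
    ring
  linarith

/-- V1 for the exponential data (`μ₀ = νN₀²`, `T = c/A₀`, `c = 1/10`, `β > 2`).
[cite: Palasek2026ElementaryModel, §3.1 Lemma 3.2 (z0_bound)] -/
theorem V1_exp (h3 : 3 * ν * (1 / 10) ≤ Real.exp ((β - 2) * L)) :
    Real.exp (ν * scale (Real.exp L) b 0 ^ 2 * blowupT (expAmp b β L) (1 / 10)) ≤ 3 / 2 := by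
  have hT : blowupT (expAmp b β L) (1 / 10) = 1 / 10 / expAmp b β L 0 := rfl
  have hA0 : expAmp b β L 0 = Real.exp (β * L) := by rw [expAmp]; simp
  have hμT : ν * scale (Real.exp L) b 0 ^ 2 * blowupT (expAmp b β L) (1 / 10) =
      ν / 10 * Real.exp ((2 - β) * L) := by
    rw [hT, hA0, scale_zero, exp_sq, show (2 - β) * L = 2 * L - β * L by ring, Real.exp_sub]
    ring
  rw [hμT]
  have h2 : ν / 10 * Real.exp ((2 - β) * L) ≤ 1 / 3 := by
    have h3' : ν / 10 * Real.exp ((2 - β) * L) * Real.exp ((β - 2) * L) = ν / 10 := by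
      rw [mul_assoc, ← Real.exp_add, show (2 - β) * L + (β - 2) * L = 0 by ring, Real.exp_zero,
        mul_one]
    have h4 := Real.exp_pos ((β - 2) * L)
    have h5 := Real.exp_pos ((2 - β) * L)
    nlinarith
  exact (Real.exp_le_exp.2 h2).trans exp_one_third_le

/-- V2 for the exponential data. [cite: Palasek2026ElementaryModel, §3.1 Lemma 3.2 (z0_bound)] -/
theorem V2_exp (h16 : 16 ≤ Real.exp (2 * (b - 1) * (α - β) * L)) :
    12 * expDelta b α L 0 * expAmp b β L 1 ^ 2 ≤ expAmp b β L 0 ^ 2 := by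
  rw [expDelta_eq, expAmp, expAmp, exp_sq, exp_sq, mul_assoc, ← Real.exp_add]
  refine mul_exp_le_exp (le_trans (by norm_num) (h16.trans (le_of_eq ?_)))
  congr 1
  simp only [pow_zero, pow_one, mul_one]
  ring

/-- E1 for the exponential data (`j ≥ 3`). [cite: Palasek2026ElementaryModel, §3.1 Lemma 3.2 (eta_global_bound)] -/
theorem E1_exp (hb : 1 ≤ b) (hβ : 0 ≤ β) (hL : 0 ≤ L) {j : ℕ} (hj : 3 ≤ j)
    (h5 : 1 / 5 * Real.exp (β * b * (b ^ (j - 2) * L)) ≤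
      Real.exp (1 / 20 * Real.exp (β * (b - 1) * (b ^ (j - 2) * L)))) :
    2 * expAmp b β L j * blowupT (expAmp b β L) (1 / 10) *
        Real.exp (expAmp b β L (j - 1) / 2 * tk (expAmp b β L) (1 / 10) j) ≤
      expAmp b β L j / expAmp b β L (j - 1) := by
  set A := expAmp b β L with hA
  have hApos : ∀ k, 0 < A k := expAmp_pos b β L
  have hT : blowupT A (1 / 10) = 1 / 10 / A 0 := rfl
  have hρ : A (j - 1) / A (j - 2) = Real.exp (β * (b - 1) * (b ^ (j - 2) * L)) := by
    have := expAmp_ratio_eq b β L (k := j - 1) (by omega)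
    rwa [show j - 1 - 1 = j - 2 by omega] at this
  have htk : A (j - 1) / 2 * tk A (1 / 10) j = -(1 / 20 * (A (j - 1) / A (j - 2))) := by
    show A (j - 1) / 2 * -(1 / 10 / A (j - 2)) = _
    ring
  rw [hT, htk]
  have hK : 1 / 5 * (A (j - 1) / A 0) ≤ Real.exp (1 / 20 * (A (j - 1) / A (j - 2))) := by
    rw [hρ]
    refine le_trans ?_ h5
    refine mul_le_mul_of_nonneg_left ?_ (by norm_num)
    rw [hA, expAmp_div]
    refine Real.exp_le_exp.2 ?_
    have hbk : 1 ≤ b ^ (j - 2) := one_le_pow₀ hb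
    have e1 : b ^ (j - 1) = b ^ (j - 2) * b := by rw [← pow_succ]; congr 1; omega
    rw [e1, pow_zero]
    have : 0 ≤ β * L := mul_nonneg hβ hL
    nlinarith
  have hAj := hApos j
  have hAj1 := hApos (j - 1)
  have hA0 := hApos 0
  have hE' : Real.exp (1 / 20 * (A (j - 1) / A (j - 2))) *
      Real.exp (-(1 / 20 * (A (j - 1) / A (j - 2)))) = 1 := by
    rw [← Real.exp_add, add_neg_cancel, Real.exp_zero]
  have hE := Real.exp_pos (-(1 / 20 * (A (j - 1) / A (j - 2))))
  calc 2 * A j * (1 / 10 / A 0) * Real.exp (-(1 / 20 * (A (j - 1) / A (j - 2))))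
      = A j / A (j - 1) * (1 / 5 * (A (j - 1) / A 0) *
          Real.exp (-(1 / 20 * (A (j - 1) / A (j - 2))))) := by
        field_simp
        ring
    _ ≤ A j / A (j - 1) * (Real.exp (1 / 20 * (A (j - 1) / A (j - 2))) *
          Real.exp (-(1 / 20 * (A (j - 1) / A (j - 2))))) :=
        mul_le_mul_of_nonneg_left (mul_le_mul_of_nonneg_right hK hE.le) (div_pos hAj hAj1).le
    _ = A j / A (j - 1) := by rw [hE', mul_one]

/-- S4 for the exponential data (`k ≥ 3`). [cite: Palasek2026ElementaryModel, §3.2 proof of Prop. 3.3 (case t < t_k)] -/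
theorem S4_exp (hb : 1 ≤ b) (hβ : 0 ≤ β) (hL : 0 < L) (hα : 0 ≤ α) {k : ℕ} (hk : 3 ≤ k)
    (h4 : 4 * Real.exp (2 * β * b ^ 2 * (b ^ (k - 1) * L)) ≤
      Real.exp (1 / 20 * Real.exp (β * (b - 1) * (b ^ (k - 1) * L))))
    (h101 : 101 ≤ Real.exp (β * (b - 1) ^ 2 * (b ^ (k - 2) * L))) :
    4 * expDelta b α L k * expAmp b β L (k + 1) ^ 2 *
        Real.exp (expAmp b β L k * tk (expAmp b β L) (1 / 10) (k + 1)) ≤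
      expAmp b β L (k - 1) * expAmp b β L k *
        Real.exp (expAmp b β L (k - 1) / 2 * tk (expAmp b β L) (1 / 10) k -
          5 * (expAmp b β L (k - 2) / expAmp b β L (k - 3))) := by
  set A := expAmp b β L with hA
  set δ := expDelta b α L with hδ
  have hApos : ∀ k, 0 < A k := expAmp_pos b β L
  have htk1 : A k * tk A (1 / 10) (k + 1) = -(1 / 10 * (A k / A (k - 1))) := by
    show A k * -(1 / 10 / A (k + 1 - 2)) = _
    rw [show k + 1 - 2 = k - 1 by omega]
    ring
  have htk : A (k - 1) / 2 * tk A (1 / 10) k = -(1 / 20 * (A (k - 1) / A (k - 2))) := by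
    show A (k - 1) / 2 * -(1 / 10 / A (k - 2)) = _
    ring
  -- the three ratios
  have hr : A k / A (k - 1) = Real.exp (β * (b - 1) * (b ^ (k - 1) * L)) := expAmp_ratio_eq b β L (by omega)
  have hr₁ : A (k - 1) / A (k - 2) = Real.exp (β * (b - 1) * (b ^ (k - 2) * L)) := by
    have := expAmp_ratio_eq b β L (k := k - 1) (by omega)
    rwa [show k - 1 - 1 = k - 2 by omega] at this
  have hr21 : A (k - 2) / A (k - 3) ≤ A (k - 1) / A (k - 2) := by
    have := expAmp_ratio_step hb hβ hL.le (k - 1) (by omega)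
    rwa [show k - 1 - 1 = k - 2 by omega, show k - 1 - 2 = k - 3 by omega] at this
  have hrr : 101 * (A (k - 1) / A (k - 2)) ≤ A k / A (k - 1) := by
    rw [hr, hr₁]
    refine mul_exp_le_exp (h101.trans (le_of_eq ?_))
    congr 1
    have : b ^ (k - 1) = b ^ (k - 2) * b := by rw [← pow_succ]; congr 1; omega
    rw [this]
    ring
  rw [htk1, htk]
  have hK := key_exp hb hβ hα hL.le (k - 1) (show 1 ≤ k by omega) h4
  have hAk := hApos k
  have hAk1 := hApos (k - 1)
  have hδ0 : 0 ≤ δ k := by rw [hδ, expDelta_eq]; exact (Real.exp_pos _).le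
  have h2 : 4 * (δ k * A (k + 1) ^ 2) ≤ A (k - 1) * A k * Real.exp (1 / 20 * (A k / A (k - 1))) := by
    have h3 : δ k * A (k + 1) ^ 2 / (A (k - 1) * A k) * (A (k - 1) * A k) = δ k * A (k + 1) ^ 2 := by
      field_simp
    have h5 := mul_le_mul_of_nonneg_right hK (mul_pos hAk1 hAk).le
    rw [mul_assoc, h3] at h5
    linarith
  have hr0 : 0 ≤ A (k - 2) / A (k - 3) := (div_pos (hApos _) (hApos _)).le
  have hexp : Real.exp (1 / 20 * (A k / A (k - 1))) * Real.exp (-(1 / 10 * (A k / A (k - 1)))) ≤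
      Real.exp (-(1 / 20 * (A (k - 1) / A (k - 2))) - 5 * (A (k - 2) / A (k - 3))) := by
    rw [← Real.exp_add]
    refine Real.exp_le_exp.2 ?_
    linarith
  have hpos := Real.exp_pos (-(1 / 10 * (A k / A (k - 1))))
  calc 4 * δ k * A (k + 1) ^ 2 * Real.exp (-(1 / 10 * (A k / A (k - 1))))
      = 4 * (δ k * A (k + 1) ^ 2) * Real.exp (-(1 / 10 * (A k / A (k - 1)))) := by ring
    _ ≤ A (k - 1) * A k * Real.exp (1 / 20 * (A k / A (k - 1))) *
          Real.exp (-(1 / 10 * (A k / A (k - 1)))) := mul_le_mul_of_nonneg_right h2 hpos.le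
    _ = A (k - 1) * A k * (Real.exp (1 / 20 * (A k / A (k - 1))) *
          Real.exp (-(1 / 10 * (A k / A (k - 1))))) := by ring
    _ ≤ A (k - 1) * A k * Real.exp (-(1 / 20 * (A (k - 1) / A (k - 2))) -
          5 * (A (k - 2) / A (k - 3))) :=
        mul_le_mul_of_nonneg_left hexp (mul_pos hAk1 hAk).le

/-- The viscous bound `νN_k² ≤ ¼A_{k-1}` for the exponential data (`β > 2b`).
[cite: Palasek2026ElementaryModel, §3.3 proof of Prop. 3.4 ("using that β > 2b")] -/
theorem visc_exp {k : ℕ} (hk : 1 ≤ k)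
    (h4ν : 4 * ν ≤ Real.exp ((β - 2 * b) * (b ^ (k - 1) * L))) :
    ν * scale (Real.exp L) b k ^ 2 ≤ expAmp b β L (k - 1) / 4 := by
  rw [scale_exp, exp_sq, expAmp, le_div_iff₀ (by norm_num : (0 : ℝ) < 4),
    show ν * Real.exp (2 * (b ^ k * L)) * 4 = (4 * ν) * Real.exp (2 * (b ^ k * L)) by ring]
  refine mul_exp_le_exp (h4ν.trans (le_of_eq ?_))
  congr 1
  rw [pow_eq_pow_pred_mul b hk]
  ring

/-- `δ_k ≤ 1`. [cite: Palasek2026ElementaryModel, §3 (delta_def)] -/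
theorem expDelta_le_one (hb : 1 ≤ b) (hα : 0 ≤ α) (hL : 0 ≤ L) (k : ℕ) : expDelta b α L k ≤ 1 := by
  rw [expDelta_eq, Real.exp_le_one_iff]
  have h1 : 1 ≤ b ^ k := one_le_pow₀ hb
  have h2 : 0 ≤ b - 1 := by linarith
  have : 0 ≤ 2 * α * (b - 1) * b ^ k * L := by positivity
  linarith

end Fields

/-- **The standing inequalities of §3.1 for `N₀ = e^L` large.** For `ν ≥ 0`, `1 < b`, `2b < β < α`
there is `L₀ > 0` such that for all `L ≥ L₀` the data `A_k = e^{βb^kL}`, `δ_k = (N_k/N_{k+1})^{2α}`,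
`μ₀ = νN₀²`, `c = 1/10` satisfy `BarrierHypotheses`, the viscous bound `νN_k² ≤ ¼A_{k-1}`, `δ_k ≤ 1`
and the monotonicity of `A_{k+1}/A_k`. [cite: Palasek2026ElementaryModel, §3.1 (exp_small), (ratios), (viscous_A_assumptions)] -/
theorem barrierHypotheses_exp (hν : 0 ≤ ν) (hb : 1 < b) (hβ2b : 2 * b < β) (hβα : β < α) :
    ∃ L₀ : ℝ, 0 < L₀ ∧ ∀ L, L₀ ≤ L →
      BarrierHypotheses (expAmp b β L) (expDelta b α L) (ν * scale (Real.exp L) b 0 ^ 2) (1 / 10) ∧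
      (∀ k, 1 ≤ k → ν * scale (Real.exp L) b k ^ 2 ≤ expAmp b β L (k - 1) / 4) ∧
      (∀ k, expDelta b α L k ≤ 1) ∧
      (∀ k, expAmp b β L (k + 1) / expAmp b β L k ≤ expAmp b β L (k + 2) / expAmp b β L (k + 1)) := by
  have hb1 : 1 ≤ b := hb.le
  have hq : 0 < b - 1 := by linarith
  have hβ2 : 2 < β := by linarith
  have hβ0 : 0 ≤ β := by linarith
  have hα0 : 0 ≤ α := by linarith
  -- the six largeness conditions
  obtain ⟨y₁, _, hy₁⟩ := exists_affine_le_mul_exp 0 (3 * ν * (1 / 10)) one_pos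
    (show 0 < β - 2 by linarith)
  obtain ⟨y₂, _, hy₂⟩ := exists_affine_le_mul_exp 0 16 one_pos
    (show 0 < 2 * (b - 1) * (α - β) by nlinarith)
  obtain ⟨y₃, _, hy₃⟩ := exists_affine_le_mul_exp 0 (4 * ν) one_pos (show 0 < β - 2 * b by linarith)
  obtain ⟨y₄, _, hy₄⟩ := exists_mul_exp_le_exp_exp (show (0 : ℝ) < 4 by norm_num) (2 * β * b ^ 2)
    (show (0 : ℝ) < 1 / 20 by norm_num) (show 0 < β * (b - 1) by positivity)
  obtain ⟨y₅, _, hy₅⟩ := exists_mul_exp_le_exp_exp (show (0 : ℝ) < 1 / 5 by norm_num) (β * b)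
    (show (0 : ℝ) < 1 / 20 by norm_num) (show 0 < β * (b - 1) by positivity)
  obtain ⟨y₆, _, hy₆⟩ := exists_affine_le_mul_exp 0 101 one_pos
    (show 0 < β * (b - 1) ^ 2 by positivity)
  set L₀ := max 1 (max (max y₁ y₂) (max (max y₃ y₄) (max y₅ y₆))) with hL₀
  refine ⟨L₀, lt_of_lt_of_le one_pos (le_max_left _ _), fun L hL => ?_⟩
  have hL1 : 1 ≤ L := (le_max_left _ _).trans hL
  have hL0 : 0 < L := one_pos.trans_le hL1
  have hLy₁ : y₁ ≤ L := le_trans (by simp [hL₀]) hL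
  have hLy₂ : y₂ ≤ L := le_trans (by simp [hL₀]) hL
  have hLy₃ : y₃ ≤ L := le_trans (by simp [hL₀]) hL
  have hLy₄ : y₄ ≤ L := le_trans (by simp [hL₀]) hL
  have hLy₅ : y₅ ≤ L := le_trans (by simp [hL₀]) hL
  have hLy₆ : y₆ ≤ L := le_trans (by simp [hL₀]) hL
  have hyk : ∀ n : ℕ, L ≤ b ^ n * L := le_pow_mul hb1 hL0.le
  -- clean the `0 * y +` and `1 *` in the affine conditions
  simp only [zero_mul, zero_add, one_mul] at hy₁ hy₂ hy₃ hy₆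
  refine ⟨⟨expAmp_pos b β L, expAmp_mono hb1 hβ0 hL0.le, fun k => ?_, by norm_num, ?_, ?_, ?_,
    ?_, ?_, ?_, ?_, ?_⟩, ?_, expDelta_le_one hb1 hα0 hL0.le, ?_⟩
  · rw [expDelta_eq]; exact (Real.exp_pos _).le
  · have := Real.add_one_le_exp (-(2 * (1 / 10 : ℝ)))
    linarith
  · positivity
  · exact V1_exp (hy₁ L hLy₁)
  · exact V2_exp (hy₂ L hLy₂)
  · exact fun k hk => S1_exp hb1 hβ0 hL0 hα0 hk (hy₄ _ (hLy₄.trans (hyk _)))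
  · exact fun k _ => S2_exp k (hy₂ _ (hLy₂.trans (hyk _)))
  · exact fun j hj => E1_exp hb1 hβ0 hL0.le hj (hy₅ _ (hLy₅.trans (hyk _)))
  · exact fun k hk => S4_exp hb1 hβ0 hL0 hα0 hk (hy₄ _ (hLy₄.trans (hyk _)))
      (hy₆ _ (hLy₆.trans (hyk _)))
  · exact fun k hk => visc_exp hk (hy₃ _ (hLy₃.trans (hyk _)))
  · intro k
    have := expAmp_ratio_step hb1 hβ0 hL0.le (k + 2) (by omega)
    simpa using this

end Param

/-! ### The four asymptotic hypotheses of the assembly -/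

section Asymptotics

variable {b β α L ν : ℝ}

/-- `N_k^p = e^{p b^k L}`. [cite: Palasek2026ElementaryModel, §1.2 (nk_choice)] -/
theorem scale_exp_rpow (L b p : ℝ) (k : ℕ) :
    scale (Real.exp L) b k ^ p = Real.exp (p * (b ^ k * L)) := by
  rw [scale_exp, ← Real.exp_mul, mul_comm]

/-- `e^{a max{u,v}} ≤ e^{au} + e^{av}` for `a ≥ 0`. [folklore] -/
private theorem exp_mul_max_le (a u v : ℝ) :
    Real.exp (a * max u v) ≤ Real.exp (a * u) + Real.exp (a * v) := by
  rcases le_total u v with h | h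
  · rw [max_eq_right h]; linarith [Real.exp_pos (a * u)]
  · rw [max_eq_left h]; linarith [Real.exp_pos (a * v)]

/-- **(hX)**: the weighted amplitude bounds `N_k^{σ-α} 2A_k e^{½A_{k-1}max{-d,t_k}}` are bounded in
`k ≥ 1`, for every `σ` and `d > 0` (no largeness of `L` needed). [cite: Palasek2026ElementaryModel, §3.2 proof of Thm 1.8 ("sup_{k>k_*} … < ∞"), (exp_small)] -/
theorem hX_exp (hb : 1 < b) (hβ : 0 < β) (hL : 0 < L) (σ d : ℝ) (hd : 0 < d) :
    ∃ C, ∀ k, 1 ≤ k → scale (Real.exp L) b k ^ (σ - α) * (2 * expAmp b β L k) *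
      Real.exp (expAmp b β L (k - 1) / 2 * max (-d) (tk (expAmp b β L) (1 / 10) k)) ≤ C := by
  set A := expAmp b β L with hA
  set p := σ - α + β with hp
  have hb1 : 1 ≤ b := hb.le
  obtain ⟨B₁, hB₁⟩ := exists_bound_affine_sub_mul_exp (p * b) 0 (show 0 < d / 2 by linarith) hβ
  obtain ⟨B₂, hB₂⟩ := exists_bound_affine_sub_mul_exp (p * b ^ 2) 0 (show (0 : ℝ) < 1 / 20 by norm_num)
    (show 0 < β * (b - 1) by nlinarith)
  refine ⟨2 * Real.exp B₁ + 2 * Real.exp B₂ + 2 * Real.exp (p * (b * L) - 1 / 20), fun k hk => ?_⟩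
  have hy0 : ∀ j : ℕ, 0 ≤ b ^ j * L := fun j => by
    have := one_le_pow₀ (n := j) hb1; nlinarith
  -- the prefactor `N_k^{σ-α} 2A_k = 2 exp(p b^k L)`
  have hpre : scale (Real.exp L) b k ^ (σ - α) * (2 * A k) = 2 * Real.exp (p * (b ^ k * L)) := by
    rw [scale_exp_rpow, hA, expAmp, show p * (b ^ k * L) = (σ - α) * (b ^ k * L) + β * b ^ k * L by
      rw [hp]; ring, Real.exp_add]
    ring
  have hApos : 0 < A (k - 1) := expAmp_pos b β L _
  have hmax := exp_mul_max_le (A (k - 1) / 2) (-d) (tk A (1 / 10) k)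
  have hpre0 : 0 ≤ 2 * Real.exp (p * (b ^ k * L)) := by positivity
  rw [hpre]
  -- Term 1: `2 e^{p b^k L} e^{-(d/2) A_{k-1}} ≤ 2 e^{B₁}`
  have hT1 : 2 * Real.exp (p * (b ^ k * L)) * Real.exp (A (k - 1) / 2 * -d) ≤ 2 * Real.exp B₁ := by
    have h1 := hB₁ (b ^ (k - 1) * L) (hy0 _)
    rw [mul_assoc, ← Real.exp_add]
    refine mul_le_mul_of_nonneg_left (Real.exp_le_exp.2 (le_trans (le_of_eq ?_) h1)) (by norm_num)
    rw [hA, expAmp, pow_eq_pow_pred_mul b hk]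
    ring_nf
  -- Term 2: `2 e^{p b^k L} e^{(A_{k-1}/2) t_k}`
  have htk : A (k - 1) / 2 * tk A (1 / 10) k = -(1 / 20 * (A (k - 1) / A (k - 2))) := by
    show A (k - 1) / 2 * -(1 / 10 / A (k - 2)) = _
    ring
  have hT2 : 2 * Real.exp (p * (b ^ k * L)) * Real.exp (A (k - 1) / 2 * tk A (1 / 10) k) ≤
      2 * Real.exp B₂ + 2 * Real.exp (p * (b * L) - 1 / 20) := by
    rw [htk, mul_assoc, ← Real.exp_add]
    rcases Nat.lt_or_ge k 2 with hk2 | hk2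
    · -- `k = 1`: `A₀/A₀ = 1`
      have hk1 : k = 1 := by omega
      subst hk1
      have h1 : A (1 - 1) / A (1 - 2) = 1 := div_self (expAmp_pos b β L 0).ne'
      rw [h1, pow_one, mul_one, ← sub_eq_add_neg]
      linarith [Real.exp_pos B₂]
    · have hρ : A (k - 1) / A (k - 2) = Real.exp (β * (b - 1) * (b ^ (k - 2) * L)) := by
        have := expAmp_ratio_eq b β L (k := k - 1) (by omega)
        rwa [show k - 1 - 1 = k - 2 by omega] at this
      have h2 := hB₂ (b ^ (k - 2) * L) (hy0 _)
      have h3 : Real.exp (p * (b ^ k * L) + -(1 / 20 * (A (k - 1) / A (k - 2)))) ≤ Real.exp B₂ := by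
        refine Real.exp_le_exp.2 (le_trans (le_of_eq ?_) h2)
        rw [hρ, show b ^ k = b ^ (k - 2) * b ^ 2 by rw [← pow_add]; congr 1; omega]
        ring
      have h4 := Real.exp_pos (p * (b * L) - 1 / 20)
      linarith
  have hE1 := Real.exp_pos (A (k - 1) / 2 * -d)
  have hE2 := Real.exp_pos (A (k - 1) / 2 * tk A (1 / 10) k)
  calc 2 * Real.exp (p * (b ^ k * L)) * Real.exp (A (k - 1) / 2 * max (-d) (tk A (1 / 10) k))
      ≤ 2 * Real.exp (p * (b ^ k * L)) *
          (Real.exp (A (k - 1) / 2 * -d) + Real.exp (A (k - 1) / 2 * tk A (1 / 10) k)) :=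
        mul_le_mul_of_nonneg_left hmax hpre0
    _ = 2 * Real.exp (p * (b ^ k * L)) * Real.exp (A (k - 1) / 2 * -d) +
          2 * Real.exp (p * (b ^ k * L)) * Real.exp (A (k - 1) / 2 * tk A (1 / 10) k) := by ring
    _ ≤ 2 * Real.exp B₁ + (2 * Real.exp B₂ + 2 * Real.exp (p * (b * L) - 1 / 20)) :=
        add_le_add hT1 hT2
    _ = _ := by ring

/-- The amplitude scale is exponentially bounded: `Λ_j ≤ (23 + ν) e^{(2+β) b^j L}`.
[cite: Palasek2026ElementaryModel, §3.3 proof of Thm 1.3 ("local amplitudes and frequencies")] -/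
theorem ampBound_exp_le (hν : 0 ≤ ν) (hb : 1 ≤ b) (hβ : 0 ≤ β) (hL : 0 ≤ L) (j : ℕ) :
    ampBound ν (scale (Real.exp L) b) (expAmp b β L) (1 / 10) j ≤
      (23 + ν) * Real.exp ((2 + β) * (b ^ j * L)) := by
  have hy : 0 ≤ b ^ j * L := by have := one_le_pow₀ (n := j) hb; nlinarith
  unfold ampBound
  rw [scale_exp, exp_sq, expAmp]
  set y := b ^ j * L with hydef
  have h1 : 1 ≤ Real.exp ((2 + β) * y) := Real.one_le_exp (by positivity)
  have h2 : Real.exp (2 * y) ≤ Real.exp ((2 + β) * y) := Real.exp_le_exp.2 (by nlinarith)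
  have h3 : Real.exp (β * b ^ j * L) ≤ Real.exp ((2 + β) * y) := Real.exp_le_exp.2 (by rw [hydef]; nlinarith)
  have h4 := Real.exp_pos ((2 + β) * y)
  nlinarith [mul_le_mul_of_nonneg_left h2 hν]

/-- **(hF)**: the weighted force-derivative bounds `N_k^{σ-α} θ_k · forceBound` are bounded in `k ≥ 3`
("the small factor … once again defeats the polynomial factors"). [cite: Palasek2026ElementaryModel, §3.3 proof of Thm 1.3 (higher derivatives of the force), (exp_small)] -/
theorem hF_exp (hν : 0 ≤ ν) (hb : 1 < b) (hβ : 0 < β) (hL : 0 < L) (σ : ℝ) (M m : ℕ) :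
    ∃ C, ∀ k, 3 ≤ k → scale (Real.exp L) b k ^ (σ - α) *
      (smallFactor (expAmp b β L) (1 / 10) k *
        forceBound ν (scale (Real.exp L) b) (expAmp b β L) (1 / 10) M k m) ≤ C := by
  set A := expAmp b β L with hA
  set N := scale (Real.exp L) b with hN
  set Λs : ℝ := 23 + ν with hΛs
  set γ : ℝ := 2 + β with hγ
  set Kb := derivConst (M + 1) with hKb
  set κb := derivConst M with hκb
  have hb1 : 1 ≤ b := hb.le
  have hΛs0 : 0 ≤ Λs := by rw [hΛs]; linarith
  have hKb0 : 0 ≤ Kb := derivConst_nonneg _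
  have hκb0 : 0 ≤ κb + 2 := by linarith [derivConst_nonneg M]
  -- the polynomial coefficient of the exponent and its bound
  set P : ℝ := ((σ - α) + 2 + m * γ) * b ^ 2 + 3 ^ m * γ * b ^ (m + 2) with hP
  obtain ⟨B, hB⟩ := exists_bound_affine_sub_mul_exp P 0 (show (0 : ℝ) < 1 / 40 by norm_num)
    (show 0 < β * (b - 1) by nlinarith)
  set G : ℝ := ν * Kb * (2 * Λs) ^ m * ((κb + 2) ^ m * (m.factorial : ℝ) ^ 2 * Λs ^ 3 ^ m) with hG
  have hG0 : 0 ≤ G := by positivity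
  refine ⟨G * Real.exp B, fun k hk => ?_⟩
  have hy0 : ∀ j : ℕ, 0 ≤ b ^ j * L := fun j => by
    have := one_le_pow₀ (n := j) hb1; nlinarith
  set z := b ^ (k - 2) * L with hz
  -- exponential forms of the factors
  have hNpow : N k ^ (σ - α) = Real.exp ((σ - α) * (b ^ k * L)) := scale_exp_rpow L b _ k
  have hN2 : N k ^ 2 = Real.exp (2 * (b ^ k * L)) := by rw [hN, scale_exp, exp_sq]
  have hθ : smallFactor A (1 / 10) k = Real.exp (-(1 / 40 * Real.exp (β * (b - 1) * z))) := by
    have hρ : A (k - 1) / A (k - 2) = Real.exp (β * (b - 1) * (b ^ (k - 2) * L)) := by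
      have := expAmp_ratio_eq b β L (k := k - 1) (by omega)
      rwa [show k - 1 - 1 = k - 2 by omega] at this
    rw [smallFactor, hρ, hz]
    ring_nf
  have hΛk : ampBound ν N A (1 / 10) k ≤ Λs * Real.exp (γ * (b ^ k * L)) :=
    ampBound_exp_le hν hb1 hβ.le hL.le k
  have hΛkm : ampBound ν N A (1 / 10) (k + m) ≤ Λs * Real.exp (γ * (b ^ (k + m) * L)) :=
    ampBound_exp_le hν hb1 hβ.le hL.le (k + m)
  have hΛnn : ∀ j, 0 ≤ ampBound ν N A (1 / 10) j := fun j => by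
    unfold ampBound
    have h1 : 0 ≤ ν * N j ^ 2 := mul_nonneg hν (sq_nonneg _)
    have h2 : 0 ≤ A j := (expAmp_pos b β L j).le
    positivity
  -- the monomial bounds
  have hpow1 : (2 * ampBound ν N A (1 / 10) k) ^ m ≤ (2 * Λs) ^ m * Real.exp (m * (γ * (b ^ k * L))) := by
    calc (2 * ampBound ν N A (1 / 10) k) ^ m ≤ (2 * Λs * Real.exp (γ * (b ^ k * L))) ^ m := by
          refine pow_le_pow_left₀ (by linarith [hΛnn k]) ?_ m
          rw [mul_assoc]
          exact mul_le_mul_of_nonneg_left hΛk zero_le_two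
      _ = (2 * Λs) ^ m * Real.exp (γ * (b ^ k * L)) ^ m := mul_pow _ _ _
      _ = (2 * Λs) ^ m * Real.exp (m * (γ * (b ^ k * L))) := by rw [← Real.exp_nat_mul]
  have hpow2 : ampBound ν N A (1 / 10) (k + m) ^ 3 ^ m ≤
      Λs ^ 3 ^ m * Real.exp ((3 ^ m : ℕ) * (γ * (b ^ (k + m) * L))) := by
    have h := pow_le_pow_left₀ (hΛnn (k + m)) hΛkm (3 ^ m)
    rw [mul_pow, ← Real.exp_nat_mul] at h
    exact h
  -- assemble: `quantity ≤ G * exp(E)`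
  set E : ℝ := (σ - α) * (b ^ k * L) + -(1 / 40 * Real.exp (β * (b - 1) * z)) + 2 * (b ^ k * L) +
    m * (γ * (b ^ k * L)) + (3 ^ m : ℕ) * (γ * (b ^ (k + m) * L)) with hE
  have hexpE : Real.exp E = Real.exp ((σ - α) * (b ^ k * L)) *
      Real.exp (-(1 / 40 * Real.exp (β * (b - 1) * z))) * Real.exp (2 * (b ^ k * L)) *
      Real.exp (m * (γ * (b ^ k * L))) * Real.exp ((3 ^ m : ℕ) * (γ * (b ^ (k + m) * L))) := by
    rw [hE, Real.exp_add, Real.exp_add, Real.exp_add, Real.exp_add]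
  have hq : N k ^ (σ - α) * (smallFactor A (1 / 10) k * forceBound ν N A (1 / 10) M k m) ≤
      G * Real.exp E := by
    rw [forceBound, hNpow, hθ, hN2, hexpE, hG]
    have e1 := Real.exp_pos ((σ - α) * (b ^ k * L))
    have e2 := Real.exp_pos (-(1 / 40 * Real.exp (β * (b - 1) * z)))
    have e3 := Real.exp_pos (2 * (b ^ k * L))
    have hfac : 0 ≤ (κb + 2) ^ m * (m.factorial : ℝ) ^ 2 :=
      mul_nonneg (pow_nonneg hκb0 m) (pow_nonneg (Nat.cast_nonneg _) 2)
    -- compare factor by factor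
    have hcore : ν * Real.exp (2 * (b ^ k * L)) * derivConst (M + 1) *
        (2 * ampBound ν N A (1 / 10) k) ^ m *
        ((derivConst M + 2) ^ m * (m.factorial : ℝ) ^ 2 * ampBound ν N A (1 / 10) (k + m) ^ 3 ^ m) ≤
        ν * Real.exp (2 * (b ^ k * L)) * Kb * ((2 * Λs) ^ m * Real.exp (m * (γ * (b ^ k * L)))) *
        ((κb + 2) ^ m * (m.factorial : ℝ) ^ 2 *
          (Λs ^ 3 ^ m * Real.exp ((3 ^ m : ℕ) * (γ * (b ^ (k + m) * L))))) := by
      rw [← hKb, ← hκb]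
      have hx : 0 ≤ ν * Real.exp (2 * (b ^ k * L)) * Kb := by positivity
      have hc0 : 0 ≤ (κb + 2) ^ m * (m.factorial : ℝ) ^ 2 * ampBound ν N A (1 / 10) (k + m) ^ 3 ^ m :=
        mul_nonneg hfac (pow_nonneg (hΛnn _) _)
      have hb0' : 0 ≤ ν * Real.exp (2 * (b ^ k * L)) * Kb *
          ((2 * Λs) ^ m * Real.exp (m * (γ * (b ^ k * L)))) := by positivity
      exact mul_le_mul (mul_le_mul_of_nonneg_left hpow1 hx) (mul_le_mul_of_nonneg_left hpow2 hfac)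
        hc0 hb0'
    calc Real.exp ((σ - α) * (b ^ k * L)) *
          (Real.exp (-(1 / 40 * Real.exp (β * (b - 1) * z))) *
            (ν * Real.exp (2 * (b ^ k * L)) * derivConst (M + 1) *
              (2 * ampBound ν N A (1 / 10) k) ^ m *
              ((derivConst M + 2) ^ m * (m.factorial : ℝ) ^ 2 *
                ampBound ν N A (1 / 10) (k + m) ^ 3 ^ m)))
        ≤ Real.exp ((σ - α) * (b ^ k * L)) *
          (Real.exp (-(1 / 40 * Real.exp (β * (b - 1) * z))) *
            (ν * Real.exp (2 * (b ^ k * L)) * Kb * ((2 * Λs) ^ m * Real.exp (m * (γ * (b ^ k * L)))) *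
              ((κb + 2) ^ m * (m.factorial : ℝ) ^ 2 *
                (Λs ^ 3 ^ m * Real.exp ((3 ^ m : ℕ) * (γ * (b ^ (k + m) * L))))))) :=
          mul_le_mul_of_nonneg_left (mul_le_mul_of_nonneg_left hcore e2.le) e1.le
      _ = _ := by ring
  -- the exponent is an instance of the bounded family
  have hEz : E = P * z + 0 - 1 / 40 * Real.exp (β * (b - 1) * z) := by
    have hk2 : b ^ k = b ^ (k - 2) * b ^ 2 := by rw [← pow_add]; congr 1; omega
    have hkm : b ^ (k + m) = b ^ (k - 2) * b ^ (m + 2) := by rw [← pow_add]; congr 1; omega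
    rw [hE, hP, hkm, hk2, hz]
    push_cast
    ring
  have hEB : E ≤ B := by rw [hEz]; exact hB z (hy0 _)
  exact hq.trans (mul_le_mul_of_nonneg_left (Real.exp_le_exp.2 hEB) hG0)

/-- **(hF0)**: `N_k^{σ-α} νN_k² 2A_k θ_k → 0` — "the force has no role at the blow-up time".
[cite: Palasek2026ElementaryModel, §1.2 Rem. 1.4; §3.3 proof of Thm 1.3 (first display), (exp_small)] -/
theorem hF0_exp (hb : 1 < b) (hβ : 0 < β) (hL : 0 < L) (ν σ : ℝ) :
    Tendsto (fun k => scale (Real.exp L) b k ^ (σ - α) * (ν * scale (Real.exp L) b k ^ 2) *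
      (2 * expAmp b β L k) * smallFactor (expAmp b β L) (1 / 10) k) atTop (𝓝 0) := by
  set A := expAmp b β L with hA
  set P : ℝ := ((σ - α) + 2 + β) * b ^ 2 with hP
  -- `z_k = b^{k-2} L → ∞`
  have hz : Tendsto (fun k : ℕ => b ^ (k - 2) * L) atTop atTop := by
    have h1 : Tendsto (fun n : ℕ => b ^ n) atTop atTop := tendsto_pow_atTop_atTop_of_one_lt hb
    exact (h1.comp (tendsto_sub_atTop_nat 2)).atTop_mul_const hL
  have hmodel : Tendsto (fun k : ℕ => 2 * ν *
      Real.exp (P * (b ^ (k - 2) * L) + 0 - 1 / 40 * Real.exp (β * (b - 1) * (b ^ (k - 2) * L))))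
      atTop (𝓝 0) := by
    have h := ((tendsto_affine_sub_mul_exp_atBot P 0 (show (0 : ℝ) < 1 / 40 by norm_num)
      (show 0 < β * (b - 1) by nlinarith)).comp hz)
    have h2 := Real.tendsto_exp_atBot.comp h
    simpa using h2.const_mul (2 * ν)
  refine hmodel.congr' ?_
  filter_upwards [eventually_ge_atTop 2] with k hk
  have hρ : A (k - 1) / A (k - 2) = Real.exp (β * (b - 1) * (b ^ (k - 2) * L)) := by
    have := expAmp_ratio_eq b β L (k := k - 1) (by omega)
    rwa [show k - 1 - 1 = k - 2 by omega] at this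
  rw [scale_exp_rpow, scale_exp, exp_sq, smallFactor, hρ, hA, expAmp]
  have hk2 : b ^ k = b ^ (k - 2) * b ^ 2 := by rw [← pow_add]; congr 1; omega
  rw [show P * (b ^ (k - 2) * L) + 0 - 1 / 40 * Real.exp (β * (b - 1) * (b ^ (k - 2) * L)) =
      (σ - α) * (b ^ k * L) + 2 * (b ^ k * L) + β * b ^ k * L +
        -(1 / 10 / 4 * Real.exp (β * (b - 1) * (b ^ (k - 2) * L))) by rw [hP, hk2]; ring,
    Real.exp_add, Real.exp_add, Real.exp_add]
  ring

/-- **(hblow)**: `A_k N_k^{s-α} = N_k^{β-α+s}` is unbounded (`β > α - s`).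
[cite: Palasek2026ElementaryModel, §3.2 proof of Thm 1.8 ("sup_k N_k^{β-α+s} = ∞ due to β > -s+α")] -/
theorem hblow_exp (hb : 1 < b) (hL : 0 < L) {s : ℝ} (hβs : 0 < β + s - α) (M : ℝ) :
    ∃ k, 1 ≤ k ∧ M < 3 / 4 * expAmp b β L k * scale (Real.exp L) b k ^ (s - α) := by
  have hy : Tendsto (fun k : ℕ => b ^ k * L) atTop atTop :=
    (tendsto_pow_atTop_atTop_of_one_lt hb).atTop_mul_const hL
  have h1 : Tendsto (fun k : ℕ => 3 / 4 * Real.exp ((β + s - α) * (b ^ k * L))) atTop atTop := by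
    have h2 := Real.tendsto_exp_atTop.comp (hy.const_mul_atTop hβs)
    exact h2.const_mul_atTop (by norm_num)
  obtain ⟨k, hk⟩ := ((h1.eventually (eventually_gt_atTop M)).and (eventually_ge_atTop 1)).exists
  refine ⟨k, hk.2, hk.1.trans_le (le_of_eq ?_)⟩
  rw [scale_exp_rpow, expAmp, mul_assoc, ← Real.exp_add]
  ring_nf

end Asymptotics

end PalasekObukhov

/-! ### The discharge -/

open PalasekObukhov in
/-- **Palasek 2026, Theorem 1.3 with Remark 1.4 — the named fact `Palasek2026_viscousBlowup` holds.**
Parameters: `b = (α+2)/4 ∈ (1, α/2)`, `β = (max{2b, α-s} + α)/2 ∈ (max{2b, α-s}, α)`, `c = 1/10`,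
`N₀ = e^L` with `L` beyond the six largeness thresholds of `barrierHypotheses_exp`; then
`viscousBlowup_of_hypotheses` with the asymptotics `hX_exp`, `hF_exp`, `hF0_exp`, `hblow_exp`.
[cite: Palasek2026ElementaryModel, §1.2 Thm 1.3, Rem 1.4; §3 (proof)] -/
theorem Palasek2026_viscousBlowup_holds : Palasek2026_viscousBlowup := by
  intro ν α s hν hα hs
  -- the exponents
  set b : ℝ := (α + 2) / 4 with hb
  have hb1 : 1 < b := by rw [hb]; linarith
  have h2b : 2 * b < α := by rw [hb]; linarith
  set β : ℝ := (max (2 * b) (α - s) + α) / 2 with hβ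
  have hmax : max (2 * b) (α - s) < α := max_lt h2b (by linarith)
  have hβ2b : 2 * b < β := by
    have := le_max_left (2 * b) (α - s)
    rw [hβ]; linarith
  have hβα : β < α := by rw [hβ]; linarith
  have hβs : 0 < β + s - α := by
    have := le_max_right (2 * b) (α - s)
    rw [hβ]; linarith
  have hβ0 : 0 < β := by linarith
  -- `N₀ = e^L` large
  obtain ⟨L₀, hL₀, hpar⟩ := barrierHypotheses_exp (b := b) (β := β) (α := α) hν.le hb1 hβ2b hβα
  set L := max L₀ 1 with hL
  have hLL₀ : L₀ ≤ L := le_max_left _ _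
  have hLpos : 0 < L := lt_of_lt_of_le one_pos (le_max_right _ _)
  obtain ⟨hH, hvisc, hδ1, hratio⟩ := hpar L hLL₀
  refine ⟨Real.exp L, b, Real.one_lt_exp_iff.2 hLpos, hb1, ?_⟩
  exact viscousBlowup_of_hypotheses (α := α) (s := s) (A := expAmp b β L) (δ := expDelta b α L)
    (c := 1 / 10) (μ0 := ν * scale (Real.exp L) b 0 ^ 2) hν (Real.one_lt_exp_iff.2 hLpos) hb1 hH rfl
    hvisc (fun k => rfl) hδ1 hratio (fun σ d hd => hX_exp hb1 hβ0 hLpos σ d hd)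
    (fun σ M m _ => hF_exp hν.le hb1 hβ0 hLpos σ M m) (fun σ => hF0_exp hb1 hβ0 hLpos ν σ)
    (fun M => hblow_exp hb1 hLpos hβs M)

end Literature.Analysis.FluidPDE

end
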